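/-
Copyright: cell `langlands-arthur-audit` (papers/Langlands/langlands-arthur-audit), unit `pub-arthur-down-g58`
(downstream tracer, gen 58; v2 – v4 appended by unit `pub-arthur-down-g59`, gen 59; v5 by unit `pub-arthur-down-g60`, gen 60; v6 by unit `pub-arthur-down-g61`, gen 61, filed unchanged by unit `pub-arthur-down-g62`, gen 62; v7 by unit `pub-arthur-down-g62`; v8 by unit `pub-arthur-down-g65`, gen 65).  Sixteenth file of the exact-support certificates of the downstream register (module M276 of the
cell's MODULE-MAP — CLAIMed in `lean/MODULE-MAP3.md` 2026-08-25).  `DownstreamSupport15.lean` (module M274, sections 121–130: the supports of tranches 118–127, `Downstream35.lean` /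
`Downstream36.lean`) CLOSED at the gate's 200,000-byte bound; this file continues the store-thaw backlog APPEND-ONLY in the same conventions and the same namespace
`…Arthur2013.Downstream.Support`, importing `…DownstreamSupport14` (through it every earlier support file — none of `DownstreamSupport15`'s own sections 121–130 is
used here: the canonical readings `canon`, `canon₂`, …, `canon₁₁₇`, the tops `νtop` / `μtop` / `κtop`, `bookInputs_top` / `mokInputs_top` / `kmswInputs_top`, `not_B_cm` /
`not_M_cm`, `κnoMok` / `κnoMok_facts`, `scope_of_onlyFull`, section 54's `baLine_open_leaves` / `baLine_weighted_leaves`, section 48's `moeglinUnitaryDS_cm_holds` / `_fails`,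
section 103's `canon₁₀₀` / `hundredth_holds_top` / `c100_book_cm` / `c100_unitary_independent`, the `…_holds_top` theorems of the premise tranches), `…Downstream37` (module
M266, tranches 128–131) and, from v2, `…Downstream38` (module M269, tranches 132–137).
v1 (p391769) = sections 131–134: the supports of the hundred-and-twenty-eighth … hundred-and-thirty-first tranches (`Downstream37.lean` v1 – v4, unit `pub-arthur-down-g56`: THE
SECOND-HAND RESIDUE TYPED and THE FIELD-COVERAGE AUDIT — C174's Proposition 4.7, Jantzen 2018, Matić 2017a / 2017b with the two supply edges for (BA) (section 131, with the two
tranche-51 readings `canon₅₁qs0` / `canon₅₁gl` that the premise-free « QSp » supply edge requires); C76 Kumar – Kumari – Weiss and C103 Horinaga – Ma (section 132); Tam 2023,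
C288 Katsurada – Takeda, C300 Clare – Hunt (section 133); Tam 2025, C117 Helm – Tian – Xiao, C130 Kakuhama (section 134)).
v2 (this version) = v1 unchanged + sections 135–139: the supports of the hundred-and-thirty-second … hundred-and-thirty-seventh tranches (`Downstream38.lean` v1 – v8; units
`pub-arthur-down-g57` / `pub-arthur-down-g58`: THE FIELD-COVERAGE AUDIT's DESK LIST and THE 2026-08-25 MAILING — C126 ≡ C209 Enns – Lee by the version of record, C139
Ginzburg – Soudry, C131 Jiang – Zhang 2014 (section 135); C78 Bergström – Dummigan – Mégarbané and C149 Bergström – Dummigan – Farmer – Koutsoliotas (section 136); C142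
Cai – Fan arXiv v1 / v2 and C152 Matringe (section 137, tranches 134 and 136 together); B16 Cunningham – Fiori – Moussaoui – Mracek – Xu (section 138); C251 Dang arXiv v2's
premise-free Theorem 5.2 beside the same row's tranche-100 Theorem 2.4 (section 139)).  Sections 135–138 were written and compiled by unit `pub-arthur-down-g58`
(`HOME/pub-arthur-down-g58/tree/DownstreamSupport16.v2pre.staged.lean`) while the hub's olean store still served `Downstream38` v6; they are filed unchanged but for
their « v2 of this file » labels now that the store serves v8.
v3 (unit `pub-arthur-down-g59`) = ERRATUM, docstring wording only — no declaration, statement or proof changed: the referee's D-REF-g230-3 (section 132's `c129_book_cm`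
quoted « by Arthur's classification »; Kumar – Kumari – Weiss print « the existence of this lift follows from Arthur’s classification [Art13,GT19,AGI+24] », arXiv v2 p0002:L24-25,
as `Downstream37.lean` tranche 129 quotes it — « by Arthur » occurs nowhere in that text; `HOME/pub-arthur-ref-g230/R234.md`).
v4 (unit `pub-arthur-down-g59`) = section 140 APPENDED: the supports of the hundred-and-thirty-eighth tranche (`Downstream39.lean` v1, module M280, this unit: row C73
A. Graham, Algebra & Number Theory 18:6 (2024), typed from the version of record — `GrahamSMO` / `GrahamFamily` / `GrahamThmB` = Mok ∧ KMSW's proved scope, through row C13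
and row A6's case U nothing further, NO book leaf; row C306 W. T. Gan – A. Raghuram, Tata Inst. Fundam. Res. Stud. Math. 22 (2013) — `GanRaghuramSigma` / `GanRaghuramGeneric`
= the book ∧ Mok, NO KMSW leaf); adds `import …Downstream39`; v1 – v3 declarations unchanged.
v5 (unit `pub-arthur-down-g60`) = sections 141 and 142 APPENDED: the supports of the hundred-and-thirty-ninth tranche (`Downstream39.lean` v2: row C73's Corollary C,
`GrahamCorC` ⇐ `GrahamThmB` once its further printed input [Chen and Gan 2021] = arXiv:2108.04064 was read — Mok ∧ KMSW's proved scope, NO book leaf, the same support as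
Theorem B) and of the hundred-and-fortieth (`Downstream39.lean` v3: row C307 N. Grbac 2012, `GrbacFrankeSiegel` = the book's 24 leaves; row C308 A. Saha 2015, `SahaProp419` = its
node `SahaStrongLift` only); plus an ERRATUM of wording in section 140's heading and docstrings — row C306's statements carry their PRINTED numbers (Gan – Raghuram arXiv v2:
Theorem 9.5 / Corollary 9.6 / Theorem 10.1 / Remark 9.1) where v4 repeated the held corpus TeX's sequential « Theorem 26 » / « Corollary 27 » / « Theorem 28 » / « Remark 22 »
(cell `DIVERGENCE3.md` D-DN-g60-5); no declaration, statement or proof changed; no new import; v1 – v4 declarations unchanged.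
v6 (unit `pub-arthur-down-g61`) = sections 143 and 144 APPENDED: the supports of the hundred-and-forty-first tranche (`Downstream39.lean` v6: row C312 NEW, A. Zenteno, Math. Res.
Lett. 26 (2019) — `ZentenoRAESDC` / `ZentenoCompatible` / `ZentenoOrthGalois` = the book's 24 leaves, row C171's support, the two siblings certified to fail together in every book
countermodel through section 67's `canon₆₄`) and of the hundred-and-forty-second (`Downstream39.lean` v7: row C313 NEW, A. Zenteno, J. Number Theory 206 (2020) — `ZentenoLuebeckGalois`
= the book's 24 leaves through C312's Corollary 7.4, second order; `ZentenoLuebeckImages` = ∅, premise-free) and of the hundred-and-forty-third (`Downstream39.lean` v8: row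
B127 NEW, M. Hanzer, J. Lie Theory 28 (2018) 71–78, a class-B82 member read first-hand — `HanzerGenericSupp` = the book's 24 leaves ∧ B75's node, over section 48's `canon₄₅` /
`canon₄₅noR` and section 54's `canon₅₁`, for any readings of tranches 45 / 51; section 145); no new import; v1 – v5 declarations unchanged.
v7 (unit `pub-arthur-down-g62`) = section 146 APPENDED: the supports of the hundred-and-forty-fourth tranche (the NEW `Downstream40.lean` v1 = p402629, module M293: row C170, M. Furusawa – K. Martin,
J. Number Theory 146 (2015) 150–170 — `FMGJThm4` / `FMGJThm7` / `FMGJThm8` = ∅ (premise-free); `LocalGPSO5SO2` = `FMGJCor5` = the free node `GPStandardHyps`, no book leaf;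
`FMSimpleRTF` = `FMGJCor6` = the node ∧ the SIX book leaves under `StabTw` (section 21's `LeafSupport.Leaf.stabTwB`, two-sided, leaf for leaf row B94's Hypothesis 3.2 (a) support —
`c144_cor6_iff_B94hyp`), holding on all seven 2024–2026 preprint leaves, failing on the two unwritten weighted lemmas; nothing of Mok / KMSW); ONE NEW IMPORT
(`…Downstream40`, the register's new head); v1 – v6 declarations unchanged.
v8 (unit `pub-arthur-down-g65`) = sections 147 and 148 APPENDED: the supports of the hundred-and-forty-fifth tranche (`Downstream40.lean` v2 = p430946: row C315 NEW, B. Liu – B. Xu, Amer. J.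
Math. 145 (2023) 807–859, the standing want acq-10080 read in the authors' accepted version — `LiuXuProp43` / `LiuXuThm13` / `LiuXuThm14` / `LiuXuThm62` / `LiuXuProp66` = the book's 24
leaves, `LiuXuThm15` = the 24 leaves ∧ the node `FJPeriodLvalue`; beside row C56's reading of section 68 (`canon₆₅` / `canon₆₅noCh9`): C315 holds where C56 fails for want of Chapter 9
or of a Mok leaf) and of the hundred-and-forty-sixth (same filing: rows C316 / C317 NEW, H. Xue, J. reine angew. Math. 756 (2019) / Duke Math. J. 168 (2019), author versions —
`XueWeakBC` = `XueGGParch` = Mok's 29 leaves ∧ all thirteen KMSW leaves, both sequels included (= row C181's support, section 19 of `DownstreamSupport2.lean`: `c146_c181_same_support`);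
`XueProp410` = `XueAGGP52` = Mok ∧ KMSW's proved scope; `XueAGGP53` = ∅); no new import; v1 – v7 declarations unchanged.

WHAT IS CERTIFIED (supports as typed; « book » = all 24 leaves of the book's DAG, the seven 2024–2026 preprint leaves and the two unwritten weighted lemmas included; « Mok » = all
29 leaves of the memoir's DAG; « scope » = KMSW's eleven proved-scope leaves, not `AubertSS` / `KMS_A` / `KMS_B`): 128 `HanzerProp47` / `MaticSPduals` / `MaticLQduals` = book,
`JantzenHalfIntDuality` = book by the characteristic-0 route « QS0 » and ∅ by the positive-characteristic route « QSp » ⇐ E51 Gan – Lomelí; 129 C76's three statements = book,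
C103's two = book ∧ the node `HMlocalAJ`; 130 `TamEpipelagicLift` = book ∧ Mok ∧ scope, `KTspinLift` / `KTharder` = book ∧ Mok, `CHarthurGSp4` / `CHrigidity` = book; 131
`TamCount` = book ∧ B75's node, `TamTASpackets` = book ∧ Mok ∧ scope ∧ B75's node, `HTXtate` = its node, `KakNonarch` = its two nodes; (v2) 132 C126's four statements and
`GSmultiplicities` = book, `GSexactJ` = book ∧ Theorem 3.4, `JZtransferL` = book ∧ Mok; 133 `BDMexamples` / `BDFKexamples` = book; 134 / 136 `CFrelSC` = `CFv2part3` =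
`CFrelSCv2` = Mok ∧ scope, `MatLCTclassical` = node ∧ book ∧ Mok; 135 `CFMMXvoganLLC` = book ∧ the Chapter-9 leaf, `CFMMXpurePackets` / `CFMMXexamples` = that ∧ B75's
node; 137 `DangTypeVa` = ∅ (no leaf of any of the three DAGs), beside `DangRB` = book (section 103); (v4) 138 `GrahamSMO` = `GrahamFamily` = `GrahamThmB` =
Mok ∧ scope, no book leaf; `GanRaghuramSigma` = `GanRaghuramGeneric` = book ∧ Mok, no KMSW leaf; (v5) 139 `GrahamCorC` = Mok ∧ scope, no book leaf; 140 `GrbacFrankeSiegel` =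
book, `SahaProp419` = its node; (v6) 143 `ZentenoRAESDC` = `ZentenoCompatible` = `ZentenoOrthGalois` = book (all 24 leaves; C171's support, section 67 of `DownstreamSupport7.lean`);
144 `ZentenoLuebeckGalois` = book through C312's Corollary 7.4, `ZentenoLuebeckImages` = ∅ (premise-free); 145 `HanzerGenericSupp` = book ∧ B75's node. (v7) 146 `FMGJThm4` = `FMGJThm7` =
`FMGJThm8` = ∅, `LocalGPSO5SO2` = `FMGJCor5` = the node `GPStandardHyps`, `FMSimpleRTF` = `FMGJCor6` = that node ∧ {FL, W4_Thm38, TwistedTF, MW_Stab, WFL_general, WFL_nonstandard} (= B94's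
Hypothesis 3.2 (a) support), no Mok / KMSW leaf. (v8) 147 `LiuXuProp43` = `LiuXuThm13` = `LiuXuThm14` = `LiuXuThm62` = `LiuXuProp66` = book, `LiuXuThm15` = book ∧ its node, no Mok /
KMSW leaf, no Chapter-9 node; 148 `XueWeakBC` = `XueGGParch` = Mok ∧ every KMSW leaf incl. both sequels, `XueProp410` = `XueAGGP52` = Mok ∧ scope, `XueAGGP53` = ∅, no book leaf.
No census row, grade or premise is changed by this file; no new named fact is introduced (canonical readings are `abbrev`s, every statement is a proved `theorem`).
-/
import HarnessLib
import Literature.NumberTheory.Automorphic.Arthur2013.DownstreamSupport14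
import Literature.NumberTheory.Automorphic.Arthur2013.Downstream37
import Literature.NumberTheory.Automorphic.Arthur2013.Downstream38
import Literature.NumberTheory.Automorphic.Arthur2013.Downstream39
import Literature.NumberTheory.Automorphic.Arthur2013.Downstream40

set_option autoImplicit false

namespace Literature.NumberTheory.Automorphic.Arthur2013

namespace Downstream

namespace Support

/-! ## 131. Hundred-and-twenty-eighth tranche (v1 of this file, after `Downstream37.lean` v1; unit `pub-arthur-down-g56`'s SECOND-HAND RESIDUE TYPED): supports of row C174 Hanzer's
Proposition 4.7 (`HanzerProp47` ⇐ the book), and of class row B82's members Jantzen 2018 (`JantzenHalfIntDuality` ⇐ (BA) ∧ the Mœglin – Tadić classification), Matić 2017a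
(`MaticSPduals` ⇐ book ∧ E41) and Matić 2017b (`MaticLQduals` ⇐ book ∧ E41 ∧ the classification), with the tranche's two supply edges for (BA): « QS0 » ⇐ book ∧ E41 and
« QSp » ⇐ row B82's Gan – Lomeli statement `Consumers51.GanLomeliBA` ALONE.  Because the second supply edge carries no book premise, the canonical tranche-51 reading `canon₅₁`
of section 54 (Gan – Lomeli granted, (BA) := the book) is not a model of this tranche off the top; two readings of `Consumers51` are used instead — `canon₅₁qs0` (Gan – Lomeli's
statement NOT invoked: everything as `canon₅₁` but `GanLomeliBA` false) and `canon₅₁gl` (Gan – Lomeli's statement invoked: (BA), the classification and everything tranche 51 hangs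
on them true outright) — and the certificates below show what each route gives AS TYPED. -/

section Canon128

variable (ν : Nodes)

/-- Tranche 51 read WITHOUT Gan – Lomeli's statement: `GanLomeliBA` false, every other field as section 54's `canon₅₁` ((BA), the classification, Tadić, Matić ×3 := everything
the book establishes). [cite: Jantzen2018DualityHalfIntegral, §1 (separating model; bookkeeping)] -/
abbrev canon₅₁qs0 : Consumers51 where
  BasicAssumption := ∀ N, ν.Everything N
  GanLomeliBA := False
  MoeglinTadicDS := ∀ N, ν.Everything N
  TadicTempered := ∀ N, ν.Everything N
  MaticGPS := ∀ N, ν.Everything N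
  MaticAubert := ∀ N, ν.Everything N
  MaticSpeh := ∀ N, ν.Everything N

/-- Tranche 51 read WITH Gan – Lomeli's statement invoked through tranche 128's premise-free supply edge: (BA) and everything tranches 51 / 128 derive from (BA) alone true
outright. [cite: Jantzen2018DualityHalfIntegral, §1, §3 (separating model; bookkeeping)] -/
abbrev canon₅₁gl : Consumers51 where
  BasicAssumption := True
  GanLomeliBA := True
  MoeglinTadicDS := True
  TadicTempered := True
  MaticGPS := True
  MaticAubert := True
  MaticSpeh := True

/-- Every fifty-first-tranche edge holds in the reading without Gan – Lomeli, for arbitrary ν. [cite: Jantzen2018DualityHalfIntegral, §1 (bookkeeping proved here)] -/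
theorem canon_implications₅₁qs0 : Implications51 ν (canon₄₅ ν) (canon₅₀ ν) (canon₅₁qs0 ν) where
  ba := fun b _ _ => b
  ba13 := fun b _ => b
  mtds := fun b => b
  tadic := fun b _ => b
  matic16 := fun d => d
  matic19 := fun b _ => b
  matic24 := fun d => d

/-- Every fifty-first-tranche edge holds in the Gan – Lomeli reading, for arbitrary ν. [cite: Jantzen2018DualityHalfIntegral, §1 (bookkeeping proved here)] -/
theorem canon_implications₅₁gl : Implications51 ν (canon₄₅ ν) (canon₅₀ ν) canon₅₁gl where
  ba := fun _ _ _ => True.intro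
  ba13 := fun _ _ => True.intro
  mtds := fun _ => True.intro
  tadic := fun _ _ => True.intro
  matic16 := fun _ => True.intro
  matic19 := fun _ _ => True.intro
  matic24 := fun _ => True.intro

/-- The parametrised canonical reading of the hundred-and-twenty-eighth tranche over an assignment `c₅₁` of tranche 51: Hanzer's Proposition 4.7 := everything the book establishes;
Jantzen 2018 := (BA)'s value ∧ the classification's value; Matić 2017a := book ∧ E41's seven premises (section 53's `canon₅₀`); Matić 2017b := that ∧ the classification's value.
[cite: Hanzer2015UnipotentSp, Prop. 4.7; Jantzen2018DualityHalfIntegral, §1, §3; Matic2017AubertSP, Thms 3.5, 3.6, 4.1; Matic2017LanglandsQuotients, Thm 1.1 (canonical model; bookkeeping)] -/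
abbrev canon₁₂₈W (c₅₁ : Consumers51) : Consumers128 where
  HanzerProp47 := ∀ N, ν.Everything N
  JantzenHalfIntDuality := c₅₁.BasicAssumption ∧ c₅₁.MoeglinTadicDS
  MaticSPduals := (∀ N, ν.Everything N) ∧ (canon₅₀ ν).MoeglinHalfInt
  MaticLQduals := (∀ N, ν.Everything N) ∧ (canon₅₀ ν).MoeglinHalfInt ∧ c₅₁.MoeglinTadicDS

/-- The reading without Gan – Lomeli (over `canon₅₁qs0`). [cite: Jantzen2018DualityHalfIntegral, §1 (canonical model; bookkeeping)] -/
abbrev canon₁₂₈ : Consumers128 := canon₁₂₈W ν (canon₅₁qs0 ν)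

/-- The reading with Gan – Lomeli (over `canon₅₁gl`). [cite: Jantzen2018DualityHalfIntegral, §1, §3 (separating model; bookkeeping)] -/
abbrev canon₁₂₈gl : Consumers128 := canon₁₂₈W ν canon₅₁gl

/-- Every hundred-and-twenty-eighth-tranche edge holds in the parametrised reading over ANY tranche-51 assignment whose (BA) follows from the book ∧ E41 and from its own
Gan – Lomeli field, for arbitrary ν. [cite: Hanzer2015UnipotentSp, Prop. 4.7; Jantzen2018DualityHalfIntegral, §1, §3; Matic2017AubertSP, Thm 4.1; Matic2017LanglandsQuotients, Thm 1.1 (bookkeeping proved here)] -/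
theorem canon_implications₁₂₈W (c₅₁ : Consumers51) (h0 : (∀ N, ν.Everything N) → (canon₅₀ ν).MoeglinHalfInt → c₅₁.BasicAssumption)
    (hp : c₅₁.GanLomeliBA → c₅₁.BasicAssumption) : Implications128 ν (canon₅₀ ν) c₅₁ (canon₁₂₈W ν c₅₁) where
  hanzer := fun b => b
  jantzen := fun b d => ⟨b, d⟩
  baQS0 := h0
  baQSp := hp
  maticSP := fun b m => ⟨b, m⟩
  maticLQ := fun b m d => ⟨b, m, d⟩

/-- The edges hold in the reading without Gan – Lomeli, for arbitrary ν. [cite: Jantzen2018DualityHalfIntegral, §1 (bookkeeping proved here)] -/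
theorem canon_implications₁₂₈ : Implications128 ν (canon₅₀ ν) (canon₅₁qs0 ν) (canon₁₂₈ ν) :=
  canon_implications₁₂₈W ν _ (fun b _ => b) (fun f => f.elim)

/-- The edges hold in the Gan – Lomeli reading, for arbitrary ν. [cite: Jantzen2018DualityHalfIntegral, §1, §3 (bookkeeping proved here)] -/
theorem canon_implications₁₂₈gl : Implications128 ν (canon₅₀ ν) canon₅₁gl (canon₁₂₈gl ν) :=
  canon_implications₁₂₈W ν _ (fun _ _ => True.intro) (fun _ => True.intro)

/-- At the top section 54's own `canon₅₁` (Gan – Lomeli granted, (BA) := the book) IS a model of the tranche. [cite: Jantzen2018DualityHalfIntegral, §1 (bookkeeping proved here)] -/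
theorem canon_implications₁₂₈top : Implications128 νtop (canon₅₀ νtop) (canon₅₁ νtop) (canon₁₂₈W νtop (canon₅₁ νtop)) :=
  canon_implications₁₂₈W νtop _ (fun b _ => b) (fun _ => bookInputs_top.everything)

end Canon128

/-- At the top (every input of the book's DAG) all four statements and (BA) hold in each of the three tranche-51 readings — through the tranche's own `hundredtwentyeighth_of_inputs`
fed by `canon_implications₅₁` / `₅₁qs0` / `₅₁gl`, `canon_implications₅₀`, `canon_implications₁₄`, `bookInputs_top`. [cite: Hanzer2015UnipotentSp, Prop. 4.7; Jantzen2018DualityHalfIntegral, §1, §3; Matic2017AubertSP, Thms 3.5, 3.6, 4.1; Matic2017LanglandsQuotients, Thm 1.1 (bookkeeping proved here)] -/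
theorem hundredtwentyeighth_holds_top :
    ((canon₁₂₈ νtop).HanzerProp47 ∧ (canon₅₁qs0 νtop).BasicAssumption ∧ (canon₁₂₈ νtop).JantzenHalfIntDuality ∧ (canon₁₂₈ νtop).MaticSPduals ∧ (canon₁₂₈ νtop).MaticLQduals) ∧
      ((canon₁₂₈W νtop (canon₅₁ νtop)).HanzerProp47 ∧ (canon₅₁ νtop).BasicAssumption ∧ (canon₁₂₈W νtop (canon₅₁ νtop)).JantzenHalfIntDuality ∧
        (canon₁₂₈W νtop (canon₅₁ νtop)).MaticSPduals ∧ (canon₁₂₈W νtop (canon₅₁ νtop)).MaticLQduals) ∧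
      ((canon₁₂₈gl νtop).HanzerProp47 ∧ canon₅₁gl.BasicAssumption ∧ (canon₁₂₈gl νtop).JantzenHalfIntDuality ∧ (canon₁₂₈gl νtop).MaticSPduals ∧ (canon₁₂₈gl νtop).MaticLQduals) :=
  ⟨hundredtwentyeighth_of_inputs (canon_implications₁₂₈ νtop) (canon_implications₅₁qs0 νtop) (canon_implications₅₀ νtop) (canon_implications₁₄ νtop) bookInputs_top,
    hundredtwentyeighth_of_inputs canon_implications₁₂₈top (canon_implications₅₁ νtop) (canon_implications₅₀ νtop) (canon_implications₁₄ νtop) bookInputs_top,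
    hundredtwentyeighth_of_inputs (canon_implications₁₂₈gl νtop) (canon_implications₅₁gl νtop) (canon_implications₅₀ νtop) (canon_implications₁₄ νtop) bookInputs_top⟩

/-- BOOK SIDE WITHOUT GAN – LOMELI, EXACT SUPPORT AS TYPED — in the book countermodel of ANY of the 24 leaves `l` (every edge of tranches 50 / 51 / 128 valid over `canon₅₁qs0`): all
four statements and (BA) FAIL (« [1] » the book by number; (BA) through the book's QS0 route). [cite: Hanzer2015UnipotentSp, Prop. 4.7; Jantzen2018DualityHalfIntegral, §1; Matic2017AubertSP, Thm 4.1; Matic2017LanglandsQuotients, Thm 1.1 (bookkeeping proved here)] -/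
theorem c128_book_cm (l : LeafSupport.Leaf) :
    ¬ (LeafSupport.mkN (LeafSupport.cm l)).leaf l ∧
      Implications128 (LeafSupport.mkN (LeafSupport.cm l)) (canon₅₀ (LeafSupport.mkN (LeafSupport.cm l))) (canon₅₁qs0 (LeafSupport.mkN (LeafSupport.cm l))) (canon₁₂₈ (LeafSupport.mkN (LeafSupport.cm l))) ∧
      Implications51 (LeafSupport.mkN (LeafSupport.cm l)) (canon₄₅ (LeafSupport.mkN (LeafSupport.cm l))) (canon₅₀ (LeafSupport.mkN (LeafSupport.cm l))) (canon₅₁qs0 (LeafSupport.mkN (LeafSupport.cm l))) ∧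
      (¬ (canon₁₂₈ (LeafSupport.mkN (LeafSupport.cm l))).HanzerProp47 ∧ ¬ (canon₅₁qs0 (LeafSupport.mkN (LeafSupport.cm l))).BasicAssumption ∧
        ¬ (canon₁₂₈ (LeafSupport.mkN (LeafSupport.cm l))).JantzenHalfIntDuality ∧ ¬ (canon₁₂₈ (LeafSupport.mkN (LeafSupport.cm l))).MaticSPduals ∧
        ¬ (canon₁₂₈ (LeafSupport.mkN (LeafSupport.cm l))).MaticLQduals) :=
  have cmod := LeafSupport.countermodel l
  have n := not_B_cm l
  ⟨cmod.2.2.1, canon_implications₁₂₈ _, canon_implications₅₁qs0 _, ⟨n, n, fun h => n h.1, fun h => n h.1, fun h => n h.1⟩⟩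

/-- THE PREPRINT LEAVES AND THE WEIGHTED LEMMAS (reading without Gan – Lomeli): on each of the seven 2024–2026 preprint leaves E41's Théorème 3.1.1 HOLDS (section 54's `baLine_open_leaves`)
while Matić 2017a / 2017b FAIL through their book premise; on the two unwritten weighted fundamental lemmas E41 FAILS as well. [cite: Matic2017AubertSP, Thm 4.1; Matic2017LanglandsQuotients, Thm 1.1; Moeglin2014Stable, Théorème 3.1.1 (bookkeeping proved here)] -/
theorem c128_open_and_weighted_leaves (l : LeafSupport.Leaf) :
    ((l = .AGIKMS_181 ∨ l = .AGIKMS_191 ∨ l = .AGIKMS_1105 ∨ l = .AGIKMS_D21 ∨ l = .AGIKMS_AppE ∨ l = .KM26 ∨ l = .CK26) →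
        (canon₅₀ (LeafSupport.mkN (LeafSupport.cm l))).MoeglinHalfInt ∧ ¬ (canon₁₂₈ (LeafSupport.mkN (LeafSupport.cm l))).MaticSPduals ∧
          ¬ (canon₁₂₈ (LeafSupport.mkN (LeafSupport.cm l))).MaticLQduals) ∧
      ((l = .WFL_general ∨ l = .WFL_nonstandard) →
        ¬ (canon₅₀ (LeafSupport.mkN (LeafSupport.cm l))).MoeglinHalfInt ∧ ¬ (canon₁₂₈ (LeafSupport.mkN (LeafSupport.cm l))).MaticSPduals) :=
  have n := not_B_cm l
  ⟨fun hl => ⟨(baLine_open_leaves l hl).2.2.1.1, fun h => n h.1, fun h => n h.1⟩, fun hl => ⟨(baLine_weighted_leaves l hl).2.2.1.1, fun h => n h.1⟩⟩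

/-- BOOK SIDE WITH GAN – LOMELI, AS TYPED — in the book countermodel of ANY of the 24 leaves `l` (every edge of tranches 50 / 51 / 128 valid over `canon₅₁gl`): (BA) and Jantzen's duality
HOLD — the « QSp » supply edge and tranche 51's `E_MoeglinTadicDS` ⇐ (BA) carry no book premise, so this route inherits NOTHING from the three DAGs — while Hanzer's Proposition 4.7 and
Matić 2017a / 2017b still FAIL through their own book premise. [cite: Jantzen2018DualityHalfIntegral, §1, §3; Hanzer2015UnipotentSp, Prop. 4.7; Matic2017AubertSP, Thm 4.1 (separating model; bookkeeping proved here)] -/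
theorem c128_book_cm_gl (l : LeafSupport.Leaf) :
    Implications128 (LeafSupport.mkN (LeafSupport.cm l)) (canon₅₀ (LeafSupport.mkN (LeafSupport.cm l))) canon₅₁gl (canon₁₂₈gl (LeafSupport.mkN (LeafSupport.cm l))) ∧
      Implications51 (LeafSupport.mkN (LeafSupport.cm l)) (canon₄₅ (LeafSupport.mkN (LeafSupport.cm l))) (canon₅₀ (LeafSupport.mkN (LeafSupport.cm l))) canon₅₁gl ∧
      (canon₅₁gl.BasicAssumption ∧ (canon₁₂₈gl (LeafSupport.mkN (LeafSupport.cm l))).JantzenHalfIntDuality) ∧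
      (¬ (canon₁₂₈gl (LeafSupport.mkN (LeafSupport.cm l))).HanzerProp47 ∧ ¬ (canon₁₂₈gl (LeafSupport.mkN (LeafSupport.cm l))).MaticSPduals ∧
        ¬ (canon₁₂₈gl (LeafSupport.mkN (LeafSupport.cm l))).MaticLQduals) :=
  have n := not_B_cm l
  ⟨canon_implications₁₂₈gl _, canon_implications₅₁gl _, ⟨True.intro, ⟨True.intro, True.intro⟩⟩, ⟨n, fun h => n h.1, fun h => n h.1⟩⟩

/-- MOK and KMSW SIDES: in the Mok countermodel of ANY of the 29 leaves and in KMSW's countermodel of ANY leaf (book at the top) every edge holds and all four statements and (BA) HOLD —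
no Mok / KMSW premise anywhere in the tranche (symplectic / odd-orthogonal and metaplectic p-adic groups). [cite: Hanzer2015UnipotentSp, Prop. 4.7; Jantzen2018DualityHalfIntegral, §1; Matic2017AubertSP, Thm 4.1; Matic2017LanglandsQuotients, Thm 1.1 (bookkeeping proved here)] [claim: KalethaMinguezShinWhite2014, under-review] -/
theorem c128_mok_kmsw (l : Mok2015.LeafSupport.Leaf) (l' : KMSW2014.LeafSupport.Leaf) :
    ¬ (Mok2015.LeafSupport.mkN (Mok2015.LeafSupport.cm l)).leaf l ∧ ¬ (KMSW2014.LeafSupport.mkN (KMSW2014.LeafSupport.cm l')).leaf l' ∧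
      Implications128 νtop (canon₅₀ νtop) (canon₅₁qs0 νtop) (canon₁₂₈ νtop) ∧
      ((canon₁₂₈ νtop).HanzerProp47 ∧ (canon₅₁qs0 νtop).BasicAssumption ∧ (canon₁₂₈ νtop).JantzenHalfIntDuality ∧ (canon₁₂₈ νtop).MaticSPduals ∧ (canon₁₂₈ νtop).MaticLQduals) :=
  ⟨(Mok2015.LeafSupport.countermodel l).2.2.1, (KMSW2014.LeafSupport.countermodel l').2.2.1, canon_implications₁₂₈ _, hundredtwentyeighth_holds_top.1⟩

/-- THE HUNDRED-AND-TWENTY-EIGHTH TRANCHE REGRADED, in one statement: (i) at the top all four statements and (BA) hold in all three tranche-51 readings; (ii) WITHOUT Gan – Lomeli, in the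
book countermodel of ANY of the 24 leaves all four statements and (BA) fail — on the seven preprint leaves with E41 holding, on the two weighted lemmas with E41 failing; (iii) WITH
Gan – Lomeli, (BA) and Jantzen's duality hold in every book countermodel while Hanzer's Proposition 4.7 and Matić 2017a / 2017b fail; (iv) Mok / KMSW countermodels change nothing.
Supports: support(`HanzerProp47`) = support(`MaticSPduals`) = support(`MaticLQduals`) = all 24 book leaves; support(`JantzenHalfIntDuality`) = all 24 book leaves UNLESS row B82's
Gan – Lomeli statement is granted, in which case — as typed through the premise-free « QSp » supply edge — it is ∅. [cite: Hanzer2015UnipotentSp, Prop. 4.7; Jantzen2018DualityHalfIntegral, §1, §3; Matic2017AubertSP, Thms 3.5, 3.6, 4.1; Matic2017LanglandsQuotients, Thm 1.1 (bookkeeping proved here)] [claim: KalethaMinguezShinWhite2014, under-review] -/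
theorem c128_regraded :
    ((canon₁₂₈ νtop).HanzerProp47 ∧ (canon₅₁qs0 νtop).BasicAssumption ∧ (canon₁₂₈ νtop).JantzenHalfIntDuality ∧ (canon₁₂₈ νtop).MaticSPduals ∧ (canon₁₂₈ νtop).MaticLQduals) ∧
      (∀ l : LeafSupport.Leaf, ¬ (LeafSupport.mkN (LeafSupport.cm l)).leaf l ∧ ¬ (canon₁₂₈ (LeafSupport.mkN (LeafSupport.cm l))).HanzerProp47 ∧
        ¬ (canon₅₁qs0 (LeafSupport.mkN (LeafSupport.cm l))).BasicAssumption ∧ ¬ (canon₁₂₈ (LeafSupport.mkN (LeafSupport.cm l))).JantzenHalfIntDuality ∧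
        ¬ (canon₁₂₈ (LeafSupport.mkN (LeafSupport.cm l))).MaticSPduals ∧ ¬ (canon₁₂₈ (LeafSupport.mkN (LeafSupport.cm l))).MaticLQduals) ∧
      (∀ l : LeafSupport.Leaf, (l = .AGIKMS_181 ∨ l = .AGIKMS_191 ∨ l = .AGIKMS_1105 ∨ l = .AGIKMS_D21 ∨ l = .AGIKMS_AppE ∨ l = .KM26 ∨ l = .CK26) →
        (canon₅₀ (LeafSupport.mkN (LeafSupport.cm l))).MoeglinHalfInt ∧ ¬ (canon₁₂₈ (LeafSupport.mkN (LeafSupport.cm l))).MaticSPduals) ∧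
      (∀ l : LeafSupport.Leaf, (canon₁₂₈gl (LeafSupport.mkN (LeafSupport.cm l))).JantzenHalfIntDuality ∧ ¬ (canon₁₂₈gl (LeafSupport.mkN (LeafSupport.cm l))).HanzerProp47 ∧
        ¬ (canon₁₂₈gl (LeafSupport.mkN (LeafSupport.cm l))).MaticLQduals) ∧
      (∀ (l : Mok2015.LeafSupport.Leaf) (l' : KMSW2014.LeafSupport.Leaf), ¬ (Mok2015.LeafSupport.mkN (Mok2015.LeafSupport.cm l)).leaf l ∧
        ¬ (KMSW2014.LeafSupport.mkN (KMSW2014.LeafSupport.cm l')).leaf l' ∧ (canon₁₂₈ νtop).JantzenHalfIntDuality ∧ (canon₁₂₈ νtop).MaticLQduals) :=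
  ⟨hundredtwentyeighth_holds_top.1,
    fun l => have h := c128_book_cm l
      ⟨h.1, h.2.2.2⟩,
    fun l hl => have h := (c128_open_and_weighted_leaves l).1 hl
      ⟨h.1, h.2.1⟩,
    fun l => have h := c128_book_cm_gl l
      ⟨h.2.2.1.2, h.2.2.2.1, h.2.2.2.2.2⟩,
    fun l l' => have h := c128_mok_kmsw l l'
      ⟨h.1, h.2.1, h.2.2.2.2.2.1, h.2.2.2.2.2.2.2⟩⟩


/-! ## 132. Hundred-and-twenty-ninth tranche (v1 of this file, after `Downstream37.lean` v2; unit `pub-arthur-down-g56`'s FIELD-COVERAGE AUDIT): supports of row C76 Kumar – Kumari – Weiss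
(the node-theorem `KKWLiftGL4` ⇐ book ∧ A4; Theorems 1.1 / 1.2 `KKWopenImage` ⇐ the node ∧ C82; Theorem 1.5 `KKWLangTrotter` ⇐ the open-image theorem) and of row C103 Horinaga – Ma
(the node `HMlocalAJ`; Theorem 5.6 `HMamf56` ⇐ book ∧ A3 ∧ A5 ∧ the node; Theorem 1.1 `HMforms` ⇐ Theorem 5.6). -/

section Canon129

variable (ν : Nodes) (μ : Mok2015.Nodes) (κ : KMSW2014.Nodes)

/-- The parametrised canonical reading of the hundred-and-twenty-ninth tranche: `n` is the value of C103's node; C76's lifting node := book ∧ A4, its open-image and Lang – Trotter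
theorems := that ∧ C82's value; C103's Theorems 5.6 / 1.1 := book ∧ A3 ∧ A5 ∧ the node. [cite: KumarKumariWeiss2026, Thms 1.1, 1.2, 1.5; HorinagaMa2026, Thms 1.1, 5.6 (canonical model; bookkeeping)] -/
abbrev canon₁₂₉W (n : Prop) (c : Consumers) (c₂₉ : Consumers29) : Consumers129 where
  KKWLiftGL4 := (∀ N, ν.Everything N) ∧ c.GeeTaibi
  KKWopenImage := ((∀ N, ν.Everything N) ∧ c.GeeTaibi) ∧ c₂₉.WeissImages
  KKWLangTrotter := ((∀ N, ν.Everything N) ∧ c.GeeTaibi) ∧ c₂₉.WeissImages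
  HMlocalAJ := n
  HMamf56 := (∀ N, ν.Everything N) ∧ c.TaibiInner ∧ c.IshimotoGeneric ∧ n
  HMforms := (∀ N, ν.Everything N) ∧ c.TaibiInner ∧ c.IshimotoGeneric ∧ n

/-- The canonical instance: node GRANTED; tranches 1 / 29 canonical. [cite: HorinagaMa2026, proof of Thm 5.6 (canonical model; bookkeeping)] -/
abbrev canon₁₂₉ : Consumers129 := canon₁₂₉W ν True (canon ν μ κ) (canon₂₉ ν μ κ)

/-- NODE DENIED: C103's bridging assertion false (Theorems 5.6 / 1.1 with it). [cite: HorinagaMa2026, proof of Thm 5.6 (separating model; bookkeeping)] -/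
abbrev canon₁₂₉noN : Consumers129 := canon₁₂₉W ν False (canon ν μ κ) (canon₂₉ ν μ κ)

/-- Every hundred-and-twenty-ninth-tranche edge holds in the parametrised reading over ANY node value and any assignments of tranches 1, 29. [cite: KumarKumariWeiss2026, Thms 1.1, 1.2, 1.5; HorinagaMa2026, Thms 1.1, 5.6 (bookkeeping proved here)] -/
theorem canon_implications₁₂₉W (n : Prop) (c : Consumers) (c₂₉ : Consumers29) : Implications129 ν c c₂₉ (canon₁₂₉W ν n c c₂₉) where
  kkwLift := fun b g => ⟨b, g⟩
  kkwOpen := fun l w => ⟨l, w⟩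
  kkwLT := fun o => o
  hm56 := fun b t i hn => ⟨b, t, i, hn⟩
  hmForms := fun h => h

/-- The edges hold in the canonical instance. [cite: KumarKumariWeiss2026, Thm 1.1; HorinagaMa2026, Thm 5.6 (bookkeeping proved here)] -/
theorem canon_implications₁₂₉ : Implications129 ν (canon ν μ κ) (canon₂₉ ν μ κ) (canon₁₂₉ ν μ κ) :=
  canon_implications₁₂₉W ν True _ _

/-- The edges hold with the node denied. [cite: HorinagaMa2026, Thm 5.6 (bookkeeping proved here)] -/
theorem canon_implications₁₂₉noN : Implications129 ν (canon ν μ κ) (canon₂₉ ν μ κ) (canon₁₂₉noN ν μ κ) :=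
  canon_implications₁₂₉W ν False _ _

end Canon129

/-- At the top (every input of the book's DAG; node granted) all six fields hold — through the tranche's own `hundredtwentyninth_of_inputs` fed by `canon_implications₂₉`,
`canon_implications₂₈`, `canon_implications`, `bookInputs_top`; the node by its grant. [cite: KumarKumariWeiss2026, Thms 1.1, 1.2, 1.5; HorinagaMa2026, Thms 1.1, 5.6 (bookkeeping proved here)] -/
theorem hundredtwentyninth_holds_top :
    (canon₁₂₉ νtop μtop κtop).KKWLiftGL4 ∧ (canon₁₂₉ νtop μtop κtop).KKWopenImage ∧ (canon₁₂₉ νtop μtop κtop).KKWLangTrotter ∧ (canon₁₂₉ νtop μtop κtop).HMlocalAJ ∧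
      (canon₁₂₉ νtop μtop κtop).HMamf56 ∧ (canon₁₂₉ νtop μtop κtop).HMforms :=
  have h := hundredtwentyninth_of_inputs (canon_implications₁₂₉ νtop μtop κtop) (canon_implications₂₉ νtop μtop κtop) (canon_implications₂₈ νtop μtop κtop)
    (canon_implications νtop μtop κtop) bookInputs_top
  have n := h.2.2.2 True.intro
  ⟨h.1, h.2.1, h.2.2.1, True.intro, n.1, n.2⟩

/-- NODE GRANTED / DENIED, for EVERY assignment: with C103's node denied Theorems 5.6 / 1.1 FAIL, C76's statements keep their values; every edge valid. [cite: HorinagaMa2026, proof of Thm 5.6 (separating model; bookkeeping proved here)] -/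
theorem c129_node (ν : Nodes) (μ : Mok2015.Nodes) (κ : KMSW2014.Nodes) :
    Implications129 ν (canon ν μ κ) (canon₂₉ ν μ κ) (canon₁₂₉noN ν μ κ) ∧ ¬ (canon₁₂₉noN ν μ κ).HMamf56 ∧ ¬ (canon₁₂₉noN ν μ κ).HMforms ∧
      ((canon₁₂₉noN ν μ κ).KKWLangTrotter ↔ (canon₁₂₉ ν μ κ).KKWLangTrotter) :=
  ⟨canon_implications₁₂₉noN ν μ κ, fun h => h.2.2.2, fun h => h.2.2.2, Iff.rfl⟩

/-- BOOK SIDE, EXACT SUPPORT AS TYPED — in the book countermodel of ANY of the 24 leaves `l` (node granted; every edge of tranches 1 / 28 / 29 / 129 valid): all five theorems FAIL (A4, C82,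
C191, A3, A5 are book rows; « follows from Arthur’s classification » / [GT19] / [Ish24]); the node holds by its grant. [cite: KumarKumariWeiss2026, Thms 1.1, 1.2, 1.5; HorinagaMa2026, Thms 1.1, 5.6 (bookkeeping proved here)] -/
theorem c129_book_cm (l : LeafSupport.Leaf) :
    ¬ (LeafSupport.mkN (LeafSupport.cm l)).leaf l ∧
      Implications129 (LeafSupport.mkN (LeafSupport.cm l)) (canon (LeafSupport.mkN (LeafSupport.cm l)) μtop κtop) (canon₂₉ (LeafSupport.mkN (LeafSupport.cm l)) μtop κtop)
        (canon₁₂₉ (LeafSupport.mkN (LeafSupport.cm l)) μtop κtop) ∧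
      (¬ (canon₁₂₉ (LeafSupport.mkN (LeafSupport.cm l)) μtop κtop).KKWLiftGL4 ∧ ¬ (canon₁₂₉ (LeafSupport.mkN (LeafSupport.cm l)) μtop κtop).KKWopenImage ∧
        ¬ (canon₁₂₉ (LeafSupport.mkN (LeafSupport.cm l)) μtop κtop).KKWLangTrotter ∧ ¬ (canon₁₂₉ (LeafSupport.mkN (LeafSupport.cm l)) μtop κtop).HMamf56 ∧
        ¬ (canon₁₂₉ (LeafSupport.mkN (LeafSupport.cm l)) μtop κtop).HMforms) ∧
      (canon₁₂₉ (LeafSupport.mkN (LeafSupport.cm l)) μtop κtop).HMlocalAJ :=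
  have cmod := LeafSupport.countermodel l
  have n := not_B_cm l
  ⟨cmod.2.2.1, canon_implications₁₂₉ _ _ _, ⟨fun h => n h.1, fun h => n h.1.1, fun h => n h.1.1, fun h => n h.1, fun h => n h.1⟩, True.intro⟩

/-- MOK and KMSW SIDES: in the Mok countermodel of ANY of the 29 leaves (KMSW without its Mok import) and in KMSW's countermodel of ANY leaf (book at the top) every edge holds and all six
fields HOLD — GSp(4) / SO(3,2) over ℚ and totally real fields: no Mok / KMSW premise. [cite: KumarKumariWeiss2026, Thms 1.1, 1.5; HorinagaMa2026, Thm 1.1 (bookkeeping proved here)] [claim: KalethaMinguezShinWhite2014, under-review] -/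
theorem c129_mok_kmsw (l : Mok2015.LeafSupport.Leaf) (l' : KMSW2014.LeafSupport.Leaf) :
    ¬ (Mok2015.LeafSupport.mkN (Mok2015.LeafSupport.cm l)).leaf l ∧ ¬ (KMSW2014.LeafSupport.mkN (KMSW2014.LeafSupport.cm l')).leaf l' ∧
      Implications129 νtop (canon νtop (Mok2015.LeafSupport.mkN (Mok2015.LeafSupport.cm l)) κnoMok) (canon₂₉ νtop (Mok2015.LeafSupport.mkN (Mok2015.LeafSupport.cm l)) κnoMok)
        (canon₁₂₉ νtop (Mok2015.LeafSupport.mkN (Mok2015.LeafSupport.cm l)) κnoMok) ∧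
      ((canon₁₂₉ νtop (Mok2015.LeafSupport.mkN (Mok2015.LeafSupport.cm l)) κnoMok).KKWLangTrotter ∧ (canon₁₂₉ νtop (Mok2015.LeafSupport.mkN (Mok2015.LeafSupport.cm l)) κnoMok).HMforms) ∧
      Implications129 νtop (canon νtop μtop (KMSW2014.LeafSupport.mkN (KMSW2014.LeafSupport.cm l'))) (canon₂₉ νtop μtop (KMSW2014.LeafSupport.mkN (KMSW2014.LeafSupport.cm l')))
        (canon₁₂₉ νtop μtop (KMSW2014.LeafSupport.mkN (KMSW2014.LeafSupport.cm l'))) ∧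
      ((canon₁₂₉ νtop μtop (KMSW2014.LeafSupport.mkN (KMSW2014.LeafSupport.cm l'))).KKWLangTrotter ∧ (canon₁₂₉ νtop μtop (KMSW2014.LeafSupport.mkN (KMSW2014.LeafSupport.cm l'))).HMforms) :=
  have b : ∀ N, νtop.Everything N := bookInputs_top.everything
  ⟨(Mok2015.LeafSupport.countermodel l).2.2.1, (KMSW2014.LeafSupport.countermodel l').2.2.1, canon_implications₁₂₉ _ _ _, ⟨⟨⟨b, b⟩, ⟨b, b⟩, b, b⟩, ⟨b, b, b, True.intro⟩⟩,
    canon_implications₁₂₉ _ _ _, ⟨⟨⟨b, b⟩, ⟨b, b⟩, b, b⟩, ⟨b, b, b, True.intro⟩⟩⟩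

/-- THE HUNDRED-AND-TWENTY-NINTH TRANCHE REGRADED, in one statement: (i) at the top all six fields hold; (ii) node denied: C103's two theorems fail for every assignment; (iii) in the book
countermodel of any of the 24 leaves all five theorems fail; (iv) Mok / KMSW countermodels change nothing.  Supports: support(`KKWLiftGL4`) = support(`KKWopenImage`) = support(`KKWLangTrotter`)
= all 24 book leaves (A4, C82 ⇐ C191 ∧ A4: book-only); support(`HMamf56`) = support(`HMforms`) = all 24 book leaves ∧ the node `HMlocalAJ`. [cite: KumarKumariWeiss2026, Thms 1.1, 1.2, 1.5; HorinagaMa2026, Thms 1.1, 5.6 (bookkeeping proved here)] [claim: KalethaMinguezShinWhite2014, under-review] -/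
theorem c129_regraded :
    ((canon₁₂₉ νtop μtop κtop).KKWLiftGL4 ∧ (canon₁₂₉ νtop μtop κtop).KKWopenImage ∧ (canon₁₂₉ νtop μtop κtop).KKWLangTrotter ∧ (canon₁₂₉ νtop μtop κtop).HMlocalAJ ∧
        (canon₁₂₉ νtop μtop κtop).HMamf56 ∧ (canon₁₂₉ νtop μtop κtop).HMforms) ∧
      (∀ (ν : Nodes) (μ : Mok2015.Nodes) (κ : KMSW2014.Nodes), ¬ (canon₁₂₉noN ν μ κ).HMamf56 ∧ ¬ (canon₁₂₉noN ν μ κ).HMforms) ∧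
      (∀ l : LeafSupport.Leaf, ¬ (LeafSupport.mkN (LeafSupport.cm l)).leaf l ∧ ¬ (canon₁₂₉ (LeafSupport.mkN (LeafSupport.cm l)) μtop κtop).KKWLiftGL4 ∧
        ¬ (canon₁₂₉ (LeafSupport.mkN (LeafSupport.cm l)) μtop κtop).KKWLangTrotter ∧ ¬ (canon₁₂₉ (LeafSupport.mkN (LeafSupport.cm l)) μtop κtop).HMforms) ∧
      (∀ (l : Mok2015.LeafSupport.Leaf) (l' : KMSW2014.LeafSupport.Leaf), (canon₁₂₉ νtop (Mok2015.LeafSupport.mkN (Mok2015.LeafSupport.cm l)) κnoMok).KKWLangTrotter ∧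
        (canon₁₂₉ νtop (Mok2015.LeafSupport.mkN (Mok2015.LeafSupport.cm l)) κnoMok).HMforms ∧ (canon₁₂₉ νtop μtop (KMSW2014.LeafSupport.mkN (KMSW2014.LeafSupport.cm l'))).KKWLangTrotter ∧
        (canon₁₂₉ νtop μtop (KMSW2014.LeafSupport.mkN (KMSW2014.LeafSupport.cm l'))).HMforms) :=
  ⟨hundredtwentyninth_holds_top,
    fun ν μ κ => have h := c129_node ν μ κ
      ⟨h.2.1, h.2.2.1⟩,
    fun l => have h := c129_book_cm l
      ⟨h.1, h.2.2.1.1, h.2.2.1.2.2.1, h.2.2.1.2.2.2.2⟩,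
    fun l l' => have h := c129_mok_kmsw l l'
      ⟨h.2.2.2.1.1, h.2.2.2.1.2, h.2.2.2.2.2.1, h.2.2.2.2.2.2⟩⟩

/-! ## 133. Hundred-and-thirtieth tranche (v1 of this file, after `Downstream37.lean` v3; unit `pub-arthur-down-g56`): supports of class row B82's member Tam 2023 (`TamEpipelagicLift` ⇐ book ∧
Mok ∧ KMSW's proved scope ∧ A5 ∧ E19 `Consumers14.MoeglinStable` ∧ E43 `Consumers45.MoeglinUnitaryDS`), of row C288 Katsurada – Takeda (`KTspinLift` ⇐ book ∧ Mok; Theorem 1.1 `KTharder` ⇐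
the lift) and of row C300 Clare – Hunt (the node-theorem `CHarthurGSp4` ⇐ book ∧ A4; Theorem 1.1 `CHrigidity` ⇐ the node ∧ C82). -/

section Canon130

variable (ν : Nodes) (μ : Mok2015.Nodes) (κ : KMSW2014.Nodes)

/-- The parametrised canonical reading of the hundred-and-thirtieth tranche over assignments of tranches 1, 14, 29, 45: each statement := exactly the conjunction of the premises of its
typed edge (Katsurada – Takeda's Theorem 1.1 := the lift's value). [cite: Tam2023EpipelagicLiftings, §5; KatsuradaTakeda2026Harder, Thm 1.1; ClareHunt2026Rigidity, Thm 1.1 (canonical model; bookkeeping)] [claim: KalethaMinguezShinWhite2014, under-review] -/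
abbrev canon₁₃₀W (c : Consumers) (c₁₄ : Consumers14) (c₂₉ : Consumers29) (c₄₅ : Consumers45) : Consumers130 where
  TamEpipelagicLift := (∀ N, ν.Everything N) ∧ (∀ N, μ.Everything N) ∧ (∀ N, κ.Scope N) ∧ c.IshimotoGeneric ∧ c₁₄.MoeglinStable ∧ c₄₅.MoeglinUnitaryDS
  KTspinLift := (∀ N, ν.Everything N) ∧ (∀ N, μ.Everything N)
  KTharder := (∀ N, ν.Everything N) ∧ (∀ N, μ.Everything N)
  CHarthurGSp4 := (∀ N, ν.Everything N) ∧ c.GeeTaibi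
  CHrigidity := ((∀ N, ν.Everything N) ∧ c.GeeTaibi) ∧ c₂₉.WeissImages

/-- The canonical instance over `canon`, `canon₁₄`, `canon₂₉`, `canon₄₅`. [cite: Tam2023EpipelagicLiftings, §5 (canonical model; bookkeeping)] [claim: KalethaMinguezShinWhite2014, under-review] -/
abbrev canon₁₃₀ : Consumers130 := canon₁₃₀W ν μ κ (canon ν μ κ) (canon₁₄ ν) (canon₂₉ ν μ κ) (canon₄₅ ν)

/-- Every hundred-and-thirtieth-tranche edge holds in the parametrised reading over ANY assignments of tranches 1, 14, 29, 45, for arbitrary ν, μ, κ. [cite: Tam2023EpipelagicLiftings, §5; KatsuradaTakeda2026Harder, Thm 1.1; ClareHunt2026Rigidity, Thm 1.1 (bookkeeping proved here)] [claim: KalethaMinguezShinWhite2014, under-review] -/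
theorem canon_implications₁₃₀W (c : Consumers) (c₁₄ : Consumers14) (c₂₉ : Consumers29) (c₄₅ : Consumers45) :
    Implications130 ν μ κ c c₁₄ c₂₉ c₄₅ (canon₁₃₀W ν μ κ c c₁₄ c₂₉ c₄₅) where
  tam := fun b m k i s u => ⟨b, m, k, i, s, u⟩
  ktLift := fun b m => ⟨b, m⟩
  ktHarder := fun h => h
  chNode := fun b g => ⟨b, g⟩
  chRig := fun n w => ⟨n, w⟩

/-- The edges hold in the canonical instance, for arbitrary ν, μ, κ. [cite: Tam2023EpipelagicLiftings, §5; ClareHunt2026Rigidity, Thm 1.1 (bookkeeping proved here)] [claim: KalethaMinguezShinWhite2014, under-review] -/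
theorem canon_implications₁₃₀ : Implications130 ν μ κ (canon ν μ κ) (canon₁₄ ν) (canon₂₉ ν μ κ) (canon₄₅ ν) (canon₁₃₀ ν μ κ) :=
  canon_implications₁₃₀W ν μ κ _ _ _ _

end Canon130

/-- At the top (every input of the three DAGs) all five statements hold — through the tranche's own `hundredthirtieth_of_inputs` fed by `canon_implications`, `canon_implications₁₄`,
`canon_implications₄₅`, `canon_implications₂₉`, `canon_implications₂₈`, `bookInputs_top`, `mokInputs_top`, `kmswInputs_top`. [cite: Tam2023EpipelagicLiftings, §5; KatsuradaTakeda2026Harder, Thm 1.1; ClareHunt2026Rigidity, Thm 1.1 (bookkeeping proved here)] [claim: KalethaMinguezShinWhite2014, under-review] -/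
theorem hundredthirtieth_holds_top :
    (canon₁₃₀ νtop μtop κtop).TamEpipelagicLift ∧ (canon₁₃₀ νtop μtop κtop).KTspinLift ∧ (canon₁₃₀ νtop μtop κtop).KTharder ∧ (canon₁₃₀ νtop μtop κtop).CHarthurGSp4 ∧
      (canon₁₃₀ νtop μtop κtop).CHrigidity :=
  hundredthirtieth_of_inputs (canon_implications₁₃₀ νtop μtop κtop) (canon_implications νtop μtop κtop) (canon_implications₁₄ νtop) (canon_implications₄₅ νtop μtop κtop)
    (canon_implications₂₉ νtop μtop κtop) (canon_implications₂₈ νtop μtop κtop) bookInputs_top mokInputs_top (kmswInputs_top μtop).1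

/-- BOOK SIDE, EXACT SUPPORT AS TYPED — in the book countermodel of ANY of the 24 leaves `l` (Mok, KMSW at the top; every edge of tranches 1 / 14 / 28 / 29 / 45 / 130 valid): all five statements
FAIL (Tam's « [Art13, Theorem 1.5.1] », Katsurada – Takeda's and Clare – Hunt's uses of the book by name / through A4 and C82). [cite: Tam2023EpipelagicLiftings, §5; KatsuradaTakeda2026Harder, Thm 1.1; ClareHunt2026Rigidity, Thm 1.1 (bookkeeping proved here)] [claim: KalethaMinguezShinWhite2014, under-review] -/
theorem c130_book_cm (l : LeafSupport.Leaf) :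
    ¬ (LeafSupport.mkN (LeafSupport.cm l)).leaf l ∧
      Implications130 (LeafSupport.mkN (LeafSupport.cm l)) μtop κtop (canon (LeafSupport.mkN (LeafSupport.cm l)) μtop κtop) (canon₁₄ (LeafSupport.mkN (LeafSupport.cm l)))
        (canon₂₉ (LeafSupport.mkN (LeafSupport.cm l)) μtop κtop) (canon₄₅ (LeafSupport.mkN (LeafSupport.cm l))) (canon₁₃₀ (LeafSupport.mkN (LeafSupport.cm l)) μtop κtop) ∧
      (¬ (canon₁₃₀ (LeafSupport.mkN (LeafSupport.cm l)) μtop κtop).TamEpipelagicLift ∧ ¬ (canon₁₃₀ (LeafSupport.mkN (LeafSupport.cm l)) μtop κtop).KTspinLift ∧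
        ¬ (canon₁₃₀ (LeafSupport.mkN (LeafSupport.cm l)) μtop κtop).KTharder ∧ ¬ (canon₁₃₀ (LeafSupport.mkN (LeafSupport.cm l)) μtop κtop).CHarthurGSp4 ∧
        ¬ (canon₁₃₀ (LeafSupport.mkN (LeafSupport.cm l)) μtop κtop).CHrigidity) :=
  have cmod := LeafSupport.countermodel l
  have n := not_B_cm l
  ⟨cmod.2.2.1, canon_implications₁₃₀ _ _ _, ⟨fun h => n h.1, fun h => n h.1, fun h => n h.1, fun h => n h.1, fun h => n h.1.1⟩⟩

/-- MOK SIDE, EXACT SUPPORT AS TYPED — in the Mok countermodel of ANY of the 29 leaves `l` (book at the top; KMSW WITHOUT its Mok import; every edge valid): Tam's lifting and Katsurada – Takeda's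
lift / Theorem 1.1 FAIL (unitary groups: « [Mok15] »), Clare – Hunt's two statements HOLD. [cite: Tam2023EpipelagicLiftings, §5; KatsuradaTakeda2026Harder, Thm 1.1; ClareHunt2026Rigidity, Thm 1.1 (bookkeeping proved here)] [claim: KalethaMinguezShinWhite2014, under-review] -/
theorem c130_mok_cm (l : Mok2015.LeafSupport.Leaf) :
    ¬ (Mok2015.LeafSupport.mkN (Mok2015.LeafSupport.cm l)).leaf l ∧
      Implications130 νtop (Mok2015.LeafSupport.mkN (Mok2015.LeafSupport.cm l)) κnoMok (canon νtop (Mok2015.LeafSupport.mkN (Mok2015.LeafSupport.cm l)) κnoMok) (canon₁₄ νtop)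
        (canon₂₉ νtop (Mok2015.LeafSupport.mkN (Mok2015.LeafSupport.cm l)) κnoMok) (canon₄₅ νtop) (canon₁₃₀ νtop (Mok2015.LeafSupport.mkN (Mok2015.LeafSupport.cm l)) κnoMok) ∧
      (¬ (canon₁₃₀ νtop (Mok2015.LeafSupport.mkN (Mok2015.LeafSupport.cm l)) κnoMok).TamEpipelagicLift ∧ ¬ (canon₁₃₀ νtop (Mok2015.LeafSupport.mkN (Mok2015.LeafSupport.cm l)) κnoMok).KTspinLift ∧
        ¬ (canon₁₃₀ νtop (Mok2015.LeafSupport.mkN (Mok2015.LeafSupport.cm l)) κnoMok).KTharder) ∧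
      ((canon₁₃₀ νtop (Mok2015.LeafSupport.mkN (Mok2015.LeafSupport.cm l)) κnoMok).CHarthurGSp4 ∧ (canon₁₃₀ νtop (Mok2015.LeafSupport.mkN (Mok2015.LeafSupport.cm l)) κnoMok).CHrigidity) :=
  have cmod := Mok2015.LeafSupport.countermodel l
  have nm := not_M_cm l
  have b : ∀ N, νtop.Everything N := bookInputs_top.everything
  ⟨cmod.2.2.1, canon_implications₁₃₀ _ _ _, ⟨fun h => nm h.2.1, fun h => nm h.2, fun h => nm h.2⟩, ⟨⟨b, b⟩, ⟨⟨b, b⟩, ⟨b, b⟩, b, b⟩⟩⟩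

/-- KMSW SIDE — (i) with KMSW's Mok import DENIED (`κnoMok`; book, Mok at the top) Tam's lifting FAILS (« [KMSW14] », the proved scope); (ii) in KMSW's countermodel of the leaf `l'` (book, Mok at the
top) it HOLDS iff `l'` ∈ {`AubertSS`, `KMS_A`, `KMS_B`}; Katsurada – Takeda's and Clare – Hunt's statements hold throughout. [cite: Tam2023EpipelagicLiftings, §5; KatsuradaTakeda2026Harder, Thm 1.1; ClareHunt2026Rigidity, Thm 1.1 (bookkeeping proved here)] [claim: KalethaMinguezShinWhite2014, under-review] -/
theorem c130_kmsw (l' : KMSW2014.LeafSupport.Leaf) :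
    ¬ (canon₁₃₀ νtop μtop κnoMok).TamEpipelagicLift ∧
      Implications130 νtop μtop (KMSW2014.LeafSupport.mkN (KMSW2014.LeafSupport.cm l')) (canon νtop μtop (KMSW2014.LeafSupport.mkN (KMSW2014.LeafSupport.cm l'))) (canon₁₄ νtop)
        (canon₂₉ νtop μtop (KMSW2014.LeafSupport.mkN (KMSW2014.LeafSupport.cm l'))) (canon₄₅ νtop) (canon₁₃₀ νtop μtop (KMSW2014.LeafSupport.mkN (KMSW2014.LeafSupport.cm l'))) ∧
      ((canon₁₃₀ νtop μtop (KMSW2014.LeafSupport.mkN (KMSW2014.LeafSupport.cm l'))).TamEpipelagicLift ↔ l'.onlyFull = true) ∧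
      ((canon₁₃₀ νtop μtop (KMSW2014.LeafSupport.mkN (KMSW2014.LeafSupport.cm l'))).KTharder ∧ (canon₁₃₀ νtop μtop (KMSW2014.LeafSupport.mkN (KMSW2014.LeafSupport.cm l'))).CHrigidity) := by
  have ns : ∀ N, ¬ κnoMok.Scope N := κnoMok_facts.2.2.2.2.2.1
  have b : ∀ N, νtop.Everything N := bookInputs_top.everything
  have m : ∀ N, μtop.Everything N := mokInputs_top.everything
  have sc : (∀ N, (KMSW2014.LeafSupport.mkN (KMSW2014.LeafSupport.cm l')).Scope N) ↔ l'.onlyFull = true := by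
    refine ⟨fun h => ?_, fun h => scope_of_onlyFull l' h⟩
    cases hb : l'.onlyFull
    · exact absurd (h 0) (KMSW2014.LeafSupport.not_scope_of (KMSW2014.LeafSupport.scope_fails l' hb 0))
    · rfl
  exact ⟨fun h => ns 0 (h.2.2.1 0), canon_implications₁₃₀ _ _ _,
    ⟨fun h => sc.1 h.2.2.1, fun h => ⟨b, m, sc.2 h, b, fourteenth_holds_top, fortyfifth_holds_top.2.2.2.2.2⟩⟩, ⟨⟨b, m⟩, ⟨⟨b, b⟩, ⟨b, b⟩, b, b⟩⟩⟩

/-- THE HUNDRED-AND-THIRTIETH TRANCHE REGRADED, in one statement: (i) at the top all five statements hold; (ii) in the book countermodel of any of the 24 leaves all five fail; (iii) in every Mok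
countermodel Tam's lifting and Katsurada – Takeda's two statements fail, Clare – Hunt's hold; (iv) in KMSW's countermodel of `l'` Tam's lifting holds iff `l'` ∈ {`AubertSS`, `KMS_A`, `KMS_B`},
and fails with the Mok import denied; the other four are KMSW-free.  Supports: support(`TamEpipelagicLift`) = all 24 book leaves ∧ all 29 Mok leaves ∧ KMSW's proved scope (E19's seven and
E43's five leaves inside the book's 24); support(`KTspinLift`) = support(`KTharder`) = all 24 book leaves ∧ all 29 Mok leaves; support(`CHarthurGSp4`) = support(`CHrigidity`) = all 24 book
leaves. [cite: Tam2023EpipelagicLiftings, §5; KatsuradaTakeda2026Harder, Thm 1.1; ClareHunt2026Rigidity, Thm 1.1 (bookkeeping proved here)] [claim: KalethaMinguezShinWhite2014, under-review] -/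
theorem c130_regraded :
    ((canon₁₃₀ νtop μtop κtop).TamEpipelagicLift ∧ (canon₁₃₀ νtop μtop κtop).KTspinLift ∧ (canon₁₃₀ νtop μtop κtop).KTharder ∧ (canon₁₃₀ νtop μtop κtop).CHarthurGSp4 ∧
        (canon₁₃₀ νtop μtop κtop).CHrigidity) ∧
      (∀ l : LeafSupport.Leaf, ¬ (LeafSupport.mkN (LeafSupport.cm l)).leaf l ∧ ¬ (canon₁₃₀ (LeafSupport.mkN (LeafSupport.cm l)) μtop κtop).TamEpipelagicLift ∧
        ¬ (canon₁₃₀ (LeafSupport.mkN (LeafSupport.cm l)) μtop κtop).KTharder ∧ ¬ (canon₁₃₀ (LeafSupport.mkN (LeafSupport.cm l)) μtop κtop).CHrigidity) ∧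
      (∀ l : Mok2015.LeafSupport.Leaf, ¬ (Mok2015.LeafSupport.mkN (Mok2015.LeafSupport.cm l)).leaf l ∧ ¬ (canon₁₃₀ νtop (Mok2015.LeafSupport.mkN (Mok2015.LeafSupport.cm l)) κnoMok).TamEpipelagicLift ∧
        ¬ (canon₁₃₀ νtop (Mok2015.LeafSupport.mkN (Mok2015.LeafSupport.cm l)) κnoMok).KTharder ∧ (canon₁₃₀ νtop (Mok2015.LeafSupport.mkN (Mok2015.LeafSupport.cm l)) κnoMok).CHrigidity) ∧
      ((∀ l' : KMSW2014.LeafSupport.Leaf, ((canon₁₃₀ νtop μtop (KMSW2014.LeafSupport.mkN (KMSW2014.LeafSupport.cm l'))).TamEpipelagicLift ↔ l'.onlyFull = true) ∧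
          (canon₁₃₀ νtop μtop (KMSW2014.LeafSupport.mkN (KMSW2014.LeafSupport.cm l'))).KTharder ∧ (canon₁₃₀ νtop μtop (KMSW2014.LeafSupport.mkN (KMSW2014.LeafSupport.cm l'))).CHrigidity) ∧
        ¬ (canon₁₃₀ νtop μtop κnoMok).TamEpipelagicLift) :=
  ⟨hundredthirtieth_holds_top,
    fun l => have h := c130_book_cm l
      ⟨h.1, h.2.2.1, h.2.2.2.2.1, h.2.2.2.2.2.2⟩,
    fun l => have h := c130_mok_cm l
      ⟨h.1, h.2.2.1.1, h.2.2.1.2.2, h.2.2.2.2⟩,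
    ⟨fun l' => have h := c130_kmsw l'
      ⟨h.2.2.1, h.2.2.2.1, h.2.2.2.2⟩, (c130_kmsw .MokMain).1⟩⟩

/-! ## 134. Hundred-and-thirty-first tranche (v1 of this file, after `Downstream37.lean` v4; unit `pub-arthur-down-g56`): supports of class row B82's member Tam 2025 (the node `TamCount` ⇐ B75
`Consumers45.MoeglinMult1` ∧ E43; `TamTASpackets` ⇐ book ∧ Mok ∧ KMSW's proved scope ∧ E19 ∧ E43 ∧ B75 ∧ B8 `Consumers13.MRpadic` ∧ the node), of row C117 Helm – Tian – Xiao (node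
`HTXmultEq`; Theorem 4.18 (2) `HTXtate` ⇐ the node) and of row C130 Kakuhama (nodes `KakLLC`, `KakLifting`; §6.4.4 `KakNonarch` ⇐ both). -/

section Canon131

variable (ν : Nodes) (μ : Mok2015.Nodes) (κ : KMSW2014.Nodes)

/-- The parametrised canonical reading of the hundred-and-thirty-first tranche: `e`, `k₁`, `k₂` are the values of C117's node and of C130's two nodes; Tam's count := B75's value ∧ E43's
value; Tam's packets := the conjunction of the eight premises (the count by its value); C117's theorem := its node; C130's §6.4.4 := its two nodes. [cite: Tam2025DepthZero, Thm 1.1; HelmTianXiao2014, Thm 4.18; Kakuhama2020LocalFactors, §6.4.4 (canonical model; bookkeeping)] [claim: KalethaMinguezShinWhite2014, under-review] -/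
abbrev canon₁₃₁W (e k₁ k₂ : Prop) (c₁₃ : Consumers13) (c₁₄ : Consumers14) (c₄₅ : Consumers45) : Consumers131 where
  TamCount := c₄₅.MoeglinMult1 ∧ c₄₅.MoeglinUnitaryDS
  TamTASpackets := (∀ N, ν.Everything N) ∧ (∀ N, μ.Everything N) ∧ (∀ N, κ.Scope N) ∧ c₁₄.MoeglinStable ∧ c₄₅.MoeglinUnitaryDS ∧ c₄₅.MoeglinMult1 ∧ c₁₃.MRpadic
  HTXmultEq := e
  HTXtate := e
  KakLLC := k₁
  KakLifting := k₂
  KakNonarch := k₁ ∧ k₂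

/-- The canonical instance: the three nodes GRANTED; tranches 13 / 14 / 45 canonical (B75's « hypothèse générale » granted in section 48's `canon₄₅`). [cite: Tam2025DepthZero, Thm 1.1; HelmTianXiao2014, Thm 4.18; Kakuhama2020LocalFactors, §6.4.4 (canonical model; bookkeeping)] [claim: KalethaMinguezShinWhite2014, under-review] -/
abbrev canon₁₃₁ : Consumers131 := canon₁₃₁W ν μ κ True True True (canon₁₃ ν κ) (canon₁₄ ν) (canon₄₅ ν)

/-- NODES DENIED: C117's multiplicity equality and C130's lifting hypothesis false, everything else canonical. [cite: HelmTianXiao2014, Thm 4.18 (2); Kakuhama2020LocalFactors, §6.4.4 (separating model; bookkeeping)] [claim: KalethaMinguezShinWhite2014, under-review] -/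
abbrev canon₁₃₁noN : Consumers131 := canon₁₃₁W ν μ κ False True False (canon₁₃ ν κ) (canon₁₄ ν) (canon₄₅ ν)

/-- B75's NODE DENIED: Mœglin's « hypothèse générale » false (section 48's `canon₄₅noR`), so B75's multiplicity one fails and Tam's count with it; the three nodes of this tranche granted.
[cite: Tam2025DepthZero, Thm 1.1 with Moeglin2011Mult1, §1 (separating model; bookkeeping)] [claim: KalethaMinguezShinWhite2014, under-review] -/
abbrev canon₁₃₁noR : Consumers131 := canon₁₃₁W ν μ κ True True True (canon₁₃ ν κ) (canon₁₄ ν) (canon₄₅noR ν)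

/-- Every hundred-and-thirty-first-tranche edge holds in the parametrised reading over ANY node values and any assignments of tranches 13, 14, 45, for arbitrary ν, μ, κ. [cite: Tam2025DepthZero, Thm 1.1; HelmTianXiao2014, Thm 4.18; Kakuhama2020LocalFactors, §6.4.4 (bookkeeping proved here)] [claim: KalethaMinguezShinWhite2014, under-review] -/
theorem canon_implications₁₃₁W (e k₁ k₂ : Prop) (c₁₃ : Consumers13) (c₁₄ : Consumers14) (c₄₅ : Consumers45) :
    Implications131 ν μ κ c₁₃ c₁₄ c₄₅ (canon₁₃₁W ν μ κ e k₁ k₂ c₁₃ c₁₄ c₄₅) where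
  tamCount := fun m1 u => ⟨m1, u⟩
  tamPackets := fun b m k s u m1 r _ => ⟨b, m, k, s, u, m1, r⟩
  htx := fun h => h
  kak := fun a l => ⟨a, l⟩

/-- The edges hold in the canonical instance. [cite: Tam2025DepthZero, Thm 1.1 (bookkeeping proved here)] [claim: KalethaMinguezShinWhite2014, under-review] -/
theorem canon_implications₁₃₁ : Implications131 ν μ κ (canon₁₃ ν κ) (canon₁₄ ν) (canon₄₅ ν) (canon₁₃₁ ν μ κ) :=
  canon_implications₁₃₁W ν μ κ True True True _ _ _

/-- The edges hold with C117's and C130's nodes denied. [cite: HelmTianXiao2014, Thm 4.18; Kakuhama2020LocalFactors, §6.4.4 (bookkeeping proved here)] [claim: KalethaMinguezShinWhite2014, under-review] -/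
theorem canon_implications₁₃₁noN : Implications131 ν μ κ (canon₁₃ ν κ) (canon₁₄ ν) (canon₄₅ ν) (canon₁₃₁noN ν μ κ) :=
  canon_implications₁₃₁W ν μ κ False True False _ _ _

/-- The edges hold over section 48's node-denied `canon₄₅noR`. [cite: Tam2025DepthZero, Thm 1.1 (bookkeeping proved here)] [claim: KalethaMinguezShinWhite2014, under-review] -/
theorem canon_implications₁₃₁noR : Implications131 ν μ κ (canon₁₃ ν κ) (canon₁₄ ν) (canon₄₅noR ν) (canon₁₃₁noR ν μ κ) :=
  canon_implications₁₃₁W ν μ κ True True True _ _ _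

end Canon131

/-- At the top (every input of the three DAGs; all nodes granted) all seven fields hold — Tam's count and packets, C117's theorem and C130's §6.4.4 through the tranche's own
`hundredthirtyfirst_of_inputs` fed by `canon_implications`, `canon_implications₁₃`, `canon_implications₁₄`, `canon_implications₄₅`, `bookInputs_top`, `mokInputs_top`, `kmswInputs_top`, B75's
node from section 48's `fortyfifth_holds_top` and the three grants; the nodes by their grants. [cite: Tam2025DepthZero, Thm 1.1; HelmTianXiao2014, Thm 4.18; Kakuhama2020LocalFactors, §6.4.4 (bookkeeping proved here)] [claim: KalethaMinguezShinWhite2014, under-review] -/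
theorem hundredthirtyfirst_holds_top :
    (canon₁₃₁ νtop μtop κtop).TamCount ∧ (canon₁₃₁ νtop μtop κtop).TamTASpackets ∧ (canon₁₃₁ νtop μtop κtop).HTXmultEq ∧ (canon₁₃₁ νtop μtop κtop).HTXtate ∧
      (canon₁₃₁ νtop μtop κtop).KakLLC ∧ (canon₁₃₁ νtop μtop κtop).KakLifting ∧ (canon₁₃₁ νtop μtop κtop).KakNonarch :=
  have h := hundredthirtyfirst_of_inputs (canon_implications₁₃₁ νtop μtop κtop) (canon_implications νtop μtop κtop) (canon_implications₁₃ νtop μtop κtop)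
    (canon_implications₁₄ νtop) (canon_implications₄₅ νtop μtop κtop) bookInputs_top mokInputs_top (kmswInputs_top μtop).1 fortyfifth_holds_top.1 True.intro True.intro True.intro
  ⟨h.1, h.2.1, True.intro, h.2.2.1, True.intro, True.intro, h.2.2.2⟩

/-- THE NODES, for EVERY assignment of the three DAGs: with C117's equality and C130's lifting hypothesis denied, Theorem 4.18 (2) and §6.4.4 FAIL; with B75's « hypothèse générale » denied
(section 48's `canon₄₅noR`) Tam's count and packets FAIL; every edge valid in each reading. [cite: HelmTianXiao2014, Thm 4.18 (2); Kakuhama2020LocalFactors, §6.4.4; Tam2025DepthZero, Thm 1.1 with Moeglin2011Mult1, §1 (separating models; bookkeeping proved here)] [claim: KalethaMinguezShinWhite2014, under-review] -/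
theorem c131_nodes (ν : Nodes) (μ : Mok2015.Nodes) (κ : KMSW2014.Nodes) :
    (Implications131 ν μ κ (canon₁₃ ν κ) (canon₁₄ ν) (canon₄₅ ν) (canon₁₃₁noN ν μ κ) ∧ ¬ (canon₁₃₁noN ν μ κ).HTXtate ∧ ¬ (canon₁₃₁noN ν μ κ).KakNonarch ∧
        ((canon₁₃₁noN ν μ κ).TamTASpackets ↔ (canon₁₃₁ ν μ κ).TamTASpackets)) ∧
      (Implications131 ν μ κ (canon₁₃ ν κ) (canon₁₄ ν) (canon₄₅noR ν) (canon₁₃₁noR ν μ κ) ∧ ¬ (canon₁₃₁noR ν μ κ).TamCount ∧ ¬ (canon₁₃₁noR ν μ κ).TamTASpackets) :=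
  ⟨⟨canon_implications₁₃₁noN ν μ κ, fun h => h, fun h => h.2, Iff.rfl⟩,
    ⟨canon_implications₁₃₁noR ν μ κ, fun h => h.1.2, fun h => h.2.2.2.2.2.1.2⟩⟩

/-- BOOK SIDE, EXACT SUPPORT AS TYPED — in the book countermodel of ANY of the 24 leaves `l` (Mok, KMSW at the top; nodes granted; every edge of tranches 13 / 14 / 45 / 131 valid): Tam's packets
FAIL (« [Art13] », B75 and B8 through the book); Tam's count FAILS too (B75's multiplicity one := the book's value in section 48's reading); C117's and C130's statements hold by their grants.
[cite: Tam2025DepthZero, Thm 1.1; HelmTianXiao2014, Thm 4.18; Kakuhama2020LocalFactors, §6.4.4 (bookkeeping proved here)] [claim: KalethaMinguezShinWhite2014, under-review] -/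
theorem c131_book_cm (l : LeafSupport.Leaf) :
    ¬ (LeafSupport.mkN (LeafSupport.cm l)).leaf l ∧
      Implications131 (LeafSupport.mkN (LeafSupport.cm l)) μtop κtop (canon₁₃ (LeafSupport.mkN (LeafSupport.cm l)) κtop) (canon₁₄ (LeafSupport.mkN (LeafSupport.cm l)))
        (canon₄₅ (LeafSupport.mkN (LeafSupport.cm l))) (canon₁₃₁ (LeafSupport.mkN (LeafSupport.cm l)) μtop κtop) ∧
      (¬ (canon₁₃₁ (LeafSupport.mkN (LeafSupport.cm l)) μtop κtop).TamCount ∧ ¬ (canon₁₃₁ (LeafSupport.mkN (LeafSupport.cm l)) μtop κtop).TamTASpackets) ∧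
      ((canon₁₃₁ (LeafSupport.mkN (LeafSupport.cm l)) μtop κtop).HTXtate ∧ (canon₁₃₁ (LeafSupport.mkN (LeafSupport.cm l)) μtop κtop).KakNonarch) :=
  have cmod := LeafSupport.countermodel l
  have n := not_B_cm l
  ⟨cmod.2.2.1, canon_implications₁₃₁ _ _ _, ⟨fun h => n h.1.1, fun h => n h.1⟩, ⟨True.intro, ⟨True.intro, True.intro⟩⟩⟩

/-- MOK SIDE, EXACT SUPPORT AS TYPED — in the Mok countermodel of ANY of the 29 leaves `l` (book at the top; KMSW WITHOUT its Mok import; every edge valid): Tam's packets FAIL (unitary groups,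
« [Mok15] »), Tam's count HOLDS (B75 ∧ E43 are book-side), C117's and C130's statements hold. [cite: Tam2025DepthZero, Thm 1.1 (bookkeeping proved here)] [claim: KalethaMinguezShinWhite2014, under-review] -/
theorem c131_mok_cm (l : Mok2015.LeafSupport.Leaf) :
    ¬ (Mok2015.LeafSupport.mkN (Mok2015.LeafSupport.cm l)).leaf l ∧
      Implications131 νtop (Mok2015.LeafSupport.mkN (Mok2015.LeafSupport.cm l)) κnoMok (canon₁₃ νtop κnoMok) (canon₁₄ νtop) (canon₄₅ νtop)
        (canon₁₃₁ νtop (Mok2015.LeafSupport.mkN (Mok2015.LeafSupport.cm l)) κnoMok) ∧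
      ¬ (canon₁₃₁ νtop (Mok2015.LeafSupport.mkN (Mok2015.LeafSupport.cm l)) κnoMok).TamTASpackets ∧
      ((canon₁₃₁ νtop (Mok2015.LeafSupport.mkN (Mok2015.LeafSupport.cm l)) κnoMok).TamCount ∧ (canon₁₃₁ νtop (Mok2015.LeafSupport.mkN (Mok2015.LeafSupport.cm l)) κnoMok).HTXtate ∧
        (canon₁₃₁ νtop (Mok2015.LeafSupport.mkN (Mok2015.LeafSupport.cm l)) κnoMok).KakNonarch) :=
  have cmod := Mok2015.LeafSupport.countermodel l
  have nm := not_M_cm l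
  ⟨cmod.2.2.1, canon_implications₁₃₁ _ _ _, fun h => nm h.2.1, ⟨⟨fortyfifth_holds_top.2.2.1, fortyfifth_holds_top.2.2.2.2.2⟩, True.intro, ⟨True.intro, True.intro⟩⟩⟩

/-- KMSW SIDE — (i) with KMSW's Mok import DENIED (`κnoMok`; book, Mok at the top) Tam's packets FAIL (« [KMSW14] » proved scope, also inside B8's value); (ii) in KMSW's countermodel of the leaf
`l'` (book, Mok at the top; nodes granted) they HOLD iff `l'` ∈ {`AubertSS`, `KMS_A`, `KMS_B`}; Tam's count, C117's and C130's statements hold throughout. [cite: Tam2025DepthZero, Thm 1.1 (bookkeeping proved here)] [claim: KalethaMinguezShinWhite2014, under-review] -/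
theorem c131_kmsw (l' : KMSW2014.LeafSupport.Leaf) :
    ¬ (canon₁₃₁ νtop μtop κnoMok).TamTASpackets ∧
      Implications131 νtop μtop (KMSW2014.LeafSupport.mkN (KMSW2014.LeafSupport.cm l')) (canon₁₃ νtop (KMSW2014.LeafSupport.mkN (KMSW2014.LeafSupport.cm l'))) (canon₁₄ νtop)
        (canon₄₅ νtop) (canon₁₃₁ νtop μtop (KMSW2014.LeafSupport.mkN (KMSW2014.LeafSupport.cm l'))) ∧
      ((canon₁₃₁ νtop μtop (KMSW2014.LeafSupport.mkN (KMSW2014.LeafSupport.cm l'))).TamTASpackets ↔ l'.onlyFull = true) ∧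
      ((canon₁₃₁ νtop μtop (KMSW2014.LeafSupport.mkN (KMSW2014.LeafSupport.cm l'))).TamCount ∧ (canon₁₃₁ νtop μtop (KMSW2014.LeafSupport.mkN (KMSW2014.LeafSupport.cm l'))).HTXtate ∧
        (canon₁₃₁ νtop μtop (KMSW2014.LeafSupport.mkN (KMSW2014.LeafSupport.cm l'))).KakNonarch) := by
  have ns : ∀ N, ¬ κnoMok.Scope N := κnoMok_facts.2.2.2.2.2.1
  have b : ∀ N, νtop.Everything N := bookInputs_top.everything
  have m : ∀ N, μtop.Everything N := mokInputs_top.everything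
  have sc : (∀ N, (KMSW2014.LeafSupport.mkN (KMSW2014.LeafSupport.cm l')).Scope N) ↔ l'.onlyFull = true := by
    refine ⟨fun h => ?_, fun h => scope_of_onlyFull l' h⟩
    cases hb : l'.onlyFull
    · exact absurd (h 0) (KMSW2014.LeafSupport.not_scope_of (KMSW2014.LeafSupport.scope_fails l' hb 0))
    · rfl
  have f45 := fortyfifth_holds_top
  exact ⟨fun h => ns 0 (h.2.2.1 0), canon_implications₁₃₁ _ _ _,
    ⟨fun h => sc.1 h.2.2.1, fun h => ⟨b, m, sc.2 h, fourteenth_holds_top, f45.2.2.2.2.2, f45.2.2.1, ⟨b, thirteenth_holds_top.1.1.2.1, sc.2 h⟩⟩⟩,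
    ⟨⟨f45.2.2.1, f45.2.2.2.2.2⟩, True.intro, ⟨True.intro, True.intro⟩⟩⟩

/-- THE HUNDRED-AND-THIRTY-FIRST TRANCHE REGRADED, in one statement: (i) at the top all seven fields hold; (ii) nodes denied: C117's theorem and C130's §6.4.4 fail for every assignment, B75's node
denied: Tam's count and packets fail; (iii) in the book countermodel of any of the 24 leaves Tam's count and packets fail; (iv) in every Mok countermodel Tam's packets fail, the count holds;
(v) in KMSW's countermodel of `l'` Tam's packets hold iff `l'` ∈ {`AubertSS`, `KMS_A`, `KMS_B`}, and fail with the Mok import denied; C117 / C130 hold off their nodes nowhere else.  Supports: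
support(`TamCount`) = all 24 book leaves ∧ B75's node (E43's five leaves inside the 24); support(`TamTASpackets`) = all 24 book leaves ∧ all 29 Mok leaves ∧ KMSW's proved scope ∧ B75's node;
support(`HTXtate`) = the node `HTXmultEq` alone; support(`KakNonarch`) = the nodes `KakLLC` ∧ `KakLifting` alone. [cite: Tam2025DepthZero, Thm 1.1; HelmTianXiao2014, Thm 4.18; Kakuhama2020LocalFactors, §6.4.4 (bookkeeping proved here)] [claim: KalethaMinguezShinWhite2014, under-review] -/
theorem c131_regraded :
    ((canon₁₃₁ νtop μtop κtop).TamCount ∧ (canon₁₃₁ νtop μtop κtop).TamTASpackets ∧ (canon₁₃₁ νtop μtop κtop).HTXmultEq ∧ (canon₁₃₁ νtop μtop κtop).HTXtate ∧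
        (canon₁₃₁ νtop μtop κtop).KakLLC ∧ (canon₁₃₁ νtop μtop κtop).KakLifting ∧ (canon₁₃₁ νtop μtop κtop).KakNonarch) ∧
      (∀ (ν : Nodes) (μ : Mok2015.Nodes) (κ : KMSW2014.Nodes), ¬ (canon₁₃₁noN ν μ κ).HTXtate ∧ ¬ (canon₁₃₁noN ν μ κ).KakNonarch ∧ ¬ (canon₁₃₁noR ν μ κ).TamCount ∧
        ¬ (canon₁₃₁noR ν μ κ).TamTASpackets) ∧
      (∀ l : LeafSupport.Leaf, ¬ (LeafSupport.mkN (LeafSupport.cm l)).leaf l ∧ ¬ (canon₁₃₁ (LeafSupport.mkN (LeafSupport.cm l)) μtop κtop).TamCount ∧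
        ¬ (canon₁₃₁ (LeafSupport.mkN (LeafSupport.cm l)) μtop κtop).TamTASpackets) ∧
      (∀ l : Mok2015.LeafSupport.Leaf, ¬ (Mok2015.LeafSupport.mkN (Mok2015.LeafSupport.cm l)).leaf l ∧ ¬ (canon₁₃₁ νtop (Mok2015.LeafSupport.mkN (Mok2015.LeafSupport.cm l)) κnoMok).TamTASpackets ∧
        (canon₁₃₁ νtop (Mok2015.LeafSupport.mkN (Mok2015.LeafSupport.cm l)) κnoMok).TamCount) ∧
      ((∀ l' : KMSW2014.LeafSupport.Leaf, ((canon₁₃₁ νtop μtop (KMSW2014.LeafSupport.mkN (KMSW2014.LeafSupport.cm l'))).TamTASpackets ↔ l'.onlyFull = true) ∧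
          (canon₁₃₁ νtop μtop (KMSW2014.LeafSupport.mkN (KMSW2014.LeafSupport.cm l'))).TamCount) ∧ ¬ (canon₁₃₁ νtop μtop κnoMok).TamTASpackets) :=
  ⟨hundredthirtyfirst_holds_top,
    fun ν μ κ => have h := c131_nodes ν μ κ
      ⟨h.1.2.1, h.1.2.2.1, h.2.2.1, h.2.2.2⟩,
    fun l => have h := c131_book_cm l
      ⟨h.1, h.2.2.1.1, h.2.2.1.2⟩,
    fun l => have h := c131_mok_cm l
      ⟨h.1, h.2.2.1, h.2.2.2.1⟩,
    ⟨fun l' => have h := c131_kmsw l'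
      ⟨h.2.2.1, h.2.2.2.1⟩, (c131_kmsw .MokMain).1⟩⟩


/-! ## 135. Hundred-and-thirty-second tranche (v2 of this file, after `Downstream38.lean` v1; unit `pub-arthur-down-g57`): supports of row C126 ≡ C209 Enns – Lee by the version of record (Lemma 4.1.6
`ELjlTransfer` ⇐ book ∧ A3, Theorem 4.1.4 `ELgalois` ⇐ C191, and the VoR supply edges to tranche 82's Cor. 4.1.1 / Lemma 4.1.7 `ELstableTempered` and Theorem 4.5.1 `ELmain`); of
row C139 Ginzburg – Soudry (the §1 multiplicity statement `GSmultiplicities` ⇐ book; the §3 remark `GSexactJ` ⇐ book ∧ the text's own Theorem 3.4 `GSdoubleDescent`); of row C131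
Jiang – Zhang 2014 (`JZtransferL` ⇐ book ∧ Mok). Row C126's tranche-82 fields are read by section 85's parametrised
`canon₈₂W` with its Taïbi / Gee – Taïbi slots filled from `canon`. -/

section Canon132

variable (ν : Nodes) (μ : Mok2015.Nodes) (κ : KMSW2014.Nodes)

/-- The parametrised canonical reading of the hundred-and-thirty-second tranche: `d` is the value of Ginzburg – Soudry's Theorem 3.4 (the text's own theorem; no typed edge concludes it); C126's
Lemma 4.1.6 := book ∧ A3, its Theorem 4.1.4 := C191's value; Ginzburg – Soudry's §1 statement := the book, their §3 remark := book ∧ `d`; Jiang – Zhang's transfer := book ∧ Mok.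
[cite: EnnsLee2024ModpLGCGSp4, Lemma 4.1.6, Thm 4.1.4 (VoR); GinzburgSoudry2022DoubleDescent, §§1, 3, Thm 3.4; JiangZhang2014HermitianType, §1 (canonical model; bookkeeping)] -/
abbrev canon₁₃₂W (d : Prop) (c : Consumers) (c₂₈ : Consumers28) : Consumers132 where
  ELjlTransfer := (∀ N, ν.Everything N) ∧ c.TaibiInner
  ELgalois := c₂₈.MokGSp4
  GSmultiplicities := ∀ N, ν.Everything N
  GSdoubleDescent := d
  GSexactJ := (∀ N, ν.Everything N) ∧ d
  JZtransferL := (∀ N, ν.Everything N) ∧ (∀ N, μ.Everything N)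

/-- The canonical instance: Theorem 3.4 GRANTED; tranches 1 / 28 canonical. [cite: GinzburgSoudry2022DoubleDescent, Thm 3.4 (canonical model; bookkeeping)] -/
abbrev canon₁₃₂ : Consumers132 := canon₁₃₂W ν μ True (canon ν μ κ) (canon₂₈ ν μ κ)

/-- Theorem 3.4 DENIED (the §3 remark with it), everything else canonical. [cite: GinzburgSoudry2022DoubleDescent, Thm 3.4 (separating model; bookkeeping)] -/
abbrev canon₁₃₂noD : Consumers132 := canon₁₃₂W ν μ False (canon ν μ κ) (canon₂₈ ν μ κ)

/-- Every hundred-and-thirty-second-tranche edge holds in the parametrised reading over `canon`, `canon₂₈` and section 85's `canon₈₂W ν μ w (canon).TaibiInner (canon).GeeTaibi fp` for ANY `w`, `fp`,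
any `d`, arbitrary ν, μ, κ — including the two VoR supply edges into tranche 82's `ELstableTempered` / `ELmain`. [cite: EnnsLee2024ModpLGCGSp4, Lemma 4.1.6, Thm 4.1.4, Cor. 4.1.1, Thm 4.5.1 (VoR); GinzburgSoudry2022DoubleDescent, §§1, 3; JiangZhang2014HermitianType, §1 (bookkeeping proved here)] -/
theorem canon_implications₁₃₂W (d w fp : Prop) :
    Implications132 ν μ (canon ν μ κ) (canon₂₈ ν μ κ) (canon₈₂W ν μ w (canon ν μ κ).TaibiInner (canon ν μ κ).GeeTaibi fp) (canon₁₃₂W ν μ d (canon ν μ κ) (canon₂₈ ν μ κ)) where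
  elJL := fun b t => ⟨b, t⟩
  elGalois := fun k => k
  elStVoR := fun j b g => ⟨b, g, j.2⟩
  elMainVoR := fun st _ _ => st
  gsMult := fun b => b
  gsExactJ := fun b hd => ⟨b, hd⟩
  jz := fun b m => ⟨b, m⟩

/-- The edges hold in the canonical instance. [cite: EnnsLee2024ModpLGCGSp4, Lemma 4.1.6 (VoR); GinzburgSoudry2022DoubleDescent, §1 (bookkeeping proved here)] -/
theorem canon_implications₁₃₂ (w fp : Prop) :
    Implications132 ν μ (canon ν μ κ) (canon₂₈ ν μ κ) (canon₈₂W ν μ w (canon ν μ κ).TaibiInner (canon ν μ κ).GeeTaibi fp) (canon₁₃₂ ν μ κ) :=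
  canon_implications₁₃₂W ν μ κ True w fp

/-- The edges hold with Theorem 3.4 denied. [cite: GinzburgSoudry2022DoubleDescent, Thm 3.4 (bookkeeping proved here)] -/
theorem canon_implications₁₃₂noD (w fp : Prop) :
    Implications132 ν μ (canon ν μ κ) (canon₂₈ ν μ κ) (canon₈₂W ν μ w (canon ν μ κ).TaibiInner (canon ν μ κ).GeeTaibi fp) (canon₁₃₂noD ν μ κ) :=
  canon_implications₁₃₂W ν μ κ False w fp

end Canon132

/-- At the top (every input of the book's and Mok's DAGs; Theorem 3.4 granted) all six fields of the tranche and C126's two tranche-82 statements hold — through the tranche's own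
`hundredthirtysecond_of_inputs` fed by `canon_implications₂₈`, `canon_implications`, `bookInputs_top`, `mokInputs_top`. [cite: EnnsLee2024ModpLGCGSp4, Lemma 4.1.6, Thm 4.1.4, Thm 4.5.1 (VoR); GinzburgSoudry2022DoubleDescent, §§1, 3; JiangZhang2014HermitianType, §1 (bookkeeping proved here)] -/
theorem hundredthirtysecond_holds_top (w fp : Prop) :
    (canon₁₃₂ νtop μtop κtop).ELjlTransfer ∧ (canon₁₃₂ νtop μtop κtop).ELgalois ∧
      (canon₈₂W νtop μtop w (canon νtop μtop κtop).TaibiInner (canon νtop μtop κtop).GeeTaibi fp).ELstableTempered ∧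
      (canon₈₂W νtop μtop w (canon νtop μtop κtop).TaibiInner (canon νtop μtop κtop).GeeTaibi fp).ELmain ∧
      (canon₁₃₂ νtop μtop κtop).GSmultiplicities ∧ (canon₁₃₂ νtop μtop κtop).GSdoubleDescent ∧ (canon₁₃₂ νtop μtop κtop).GSexactJ ∧ (canon₁₃₂ νtop μtop κtop).JZtransferL :=
  have h := hundredthirtysecond_of_inputs (canon_implications₁₃₂ νtop μtop κtop w fp) (canon_implications₂₈ νtop μtop κtop) (canon_implications νtop μtop κtop)
    bookInputs_top mokInputs_top
  ⟨h.1, h.2.1, h.2.2.1, h.2.2.2.1, h.2.2.2.2.1, True.intro, h.2.2.2.2.2.1 True.intro, h.2.2.2.2.2.2⟩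

/-- THEOREM 3.4 GRANTED / DENIED, for EVERY assignment: denied, Ginzburg – Soudry's §3 remark FAILS, their §1 statement keeps its value; every edge valid. [cite: GinzburgSoudry2022DoubleDescent, §§1, 3, Thm 3.4 (separating model; bookkeeping proved here)] -/
theorem c132_thm34 (ν : Nodes) (μ : Mok2015.Nodes) (κ : KMSW2014.Nodes) (w fp : Prop) :
    Implications132 ν μ (canon ν μ κ) (canon₂₈ ν μ κ) (canon₈₂W ν μ w (canon ν μ κ).TaibiInner (canon ν μ κ).GeeTaibi fp) (canon₁₃₂noD ν μ κ) ∧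
      ¬ (canon₁₃₂noD ν μ κ).GSexactJ ∧ ((canon₁₃₂noD ν μ κ).GSmultiplicities ↔ (canon₁₃₂ ν μ κ).GSmultiplicities) :=
  ⟨canon_implications₁₃₂noD ν μ κ w fp, fun h => h.2, Iff.rfl⟩

/-- BOOK SIDE, EXACT SUPPORT AS TYPED — in the book countermodel of ANY of the 24 leaves `l` (Mok at the top; Theorem 3.4 granted; every edge of tranches 1 / 28 / 82 / 132 valid): C126's four
statements, Ginzburg – Soudry's two book-dependent statements and Jiang – Zhang's transfer all FAIL; Theorem 3.4 holds by its grant. [cite: EnnsLee2024ModpLGCGSp4, Lemma 4.1.6, Thm 4.1.4, Thm 4.5.1 (VoR); GinzburgSoudry2022DoubleDescent, §§1, 3; JiangZhang2014HermitianType, §1 (bookkeeping proved here)] -/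
theorem c132_book_cm (l : LeafSupport.Leaf) (w fp : Prop) :
    ¬ (LeafSupport.mkN (LeafSupport.cm l)).leaf l ∧
      Implications132 (LeafSupport.mkN (LeafSupport.cm l)) μtop (canon (LeafSupport.mkN (LeafSupport.cm l)) μtop κtop) (canon₂₈ (LeafSupport.mkN (LeafSupport.cm l)) μtop κtop)
        (canon₈₂W (LeafSupport.mkN (LeafSupport.cm l)) μtop w (canon (LeafSupport.mkN (LeafSupport.cm l)) μtop κtop).TaibiInner (canon (LeafSupport.mkN (LeafSupport.cm l)) μtop κtop).GeeTaibi fp)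
        (canon₁₃₂ (LeafSupport.mkN (LeafSupport.cm l)) μtop κtop) ∧
      (¬ (canon₁₃₂ (LeafSupport.mkN (LeafSupport.cm l)) μtop κtop).ELjlTransfer ∧ ¬ (canon₁₃₂ (LeafSupport.mkN (LeafSupport.cm l)) μtop κtop).ELgalois ∧
        ¬ (canon₈₂W (LeafSupport.mkN (LeafSupport.cm l)) μtop w (canon (LeafSupport.mkN (LeafSupport.cm l)) μtop κtop).TaibiInner (canon (LeafSupport.mkN (LeafSupport.cm l)) μtop κtop).GeeTaibi fp).ELmain ∧
        ¬ (canon₁₃₂ (LeafSupport.mkN (LeafSupport.cm l)) μtop κtop).GSmultiplicities ∧ ¬ (canon₁₃₂ (LeafSupport.mkN (LeafSupport.cm l)) μtop κtop).GSexactJ ∧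
        ¬ (canon₁₃₂ (LeafSupport.mkN (LeafSupport.cm l)) μtop κtop).JZtransferL) ∧
      (canon₁₃₂ (LeafSupport.mkN (LeafSupport.cm l)) μtop κtop).GSdoubleDescent :=
  have cmod := LeafSupport.countermodel l
  have n := not_B_cm l
  ⟨cmod.2.2.1, canon_implications₁₃₂ _ _ _ w fp, ⟨fun h => n h.1, fun h => n h.1, fun h => n h.1, n, fun h => n h.1, fun h => n h.1⟩, True.intro⟩

/-- MOK SIDE, EXACT SUPPORT AS TYPED — in the Mok countermodel of ANY of the 29 leaves `l` (book at the top; KMSW without its Mok import; every edge valid): Jiang – Zhang's transfer FAILS on its unitary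
premise (« [Mk12] »); C126's and Ginzburg – Soudry's statements HOLD. [cite: JiangZhang2014HermitianType, §1; EnnsLee2024ModpLGCGSp4, Lemma 4.1.6 (VoR); GinzburgSoudry2022DoubleDescent, §1 (bookkeeping proved here)] -/
theorem c132_mok_cm (l : Mok2015.LeafSupport.Leaf) (w fp : Prop) :
    ¬ (Mok2015.LeafSupport.mkN (Mok2015.LeafSupport.cm l)).leaf l ∧
      Implications132 νtop (Mok2015.LeafSupport.mkN (Mok2015.LeafSupport.cm l)) (canon νtop (Mok2015.LeafSupport.mkN (Mok2015.LeafSupport.cm l)) κnoMok)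
        (canon₂₈ νtop (Mok2015.LeafSupport.mkN (Mok2015.LeafSupport.cm l)) κnoMok)
        (canon₈₂W νtop (Mok2015.LeafSupport.mkN (Mok2015.LeafSupport.cm l)) w (canon νtop (Mok2015.LeafSupport.mkN (Mok2015.LeafSupport.cm l)) κnoMok).TaibiInner
          (canon νtop (Mok2015.LeafSupport.mkN (Mok2015.LeafSupport.cm l)) κnoMok).GeeTaibi fp)
        (canon₁₃₂ νtop (Mok2015.LeafSupport.mkN (Mok2015.LeafSupport.cm l)) κnoMok) ∧
      ¬ (canon₁₃₂ νtop (Mok2015.LeafSupport.mkN (Mok2015.LeafSupport.cm l)) κnoMok).JZtransferL ∧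
      ((canon₁₃₂ νtop (Mok2015.LeafSupport.mkN (Mok2015.LeafSupport.cm l)) κnoMok).ELgalois ∧
        (canon₈₂W νtop (Mok2015.LeafSupport.mkN (Mok2015.LeafSupport.cm l)) w (canon νtop (Mok2015.LeafSupport.mkN (Mok2015.LeafSupport.cm l)) κnoMok).TaibiInner
          (canon νtop (Mok2015.LeafSupport.mkN (Mok2015.LeafSupport.cm l)) κnoMok).GeeTaibi fp).ELmain ∧
        (canon₁₃₂ νtop (Mok2015.LeafSupport.mkN (Mok2015.LeafSupport.cm l)) κnoMok).GSexactJ) :=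
  have cmod := Mok2015.LeafSupport.countermodel l
  have nm := not_M_cm l
  have b : ∀ N, νtop.Everything N := bookInputs_top.everything
  ⟨cmod.2.2.1, canon_implications₁₃₂ _ _ _ w fp, fun h => nm h.2, ⟨⟨b, b⟩, ⟨b, b, b⟩, ⟨b, True.intro⟩⟩⟩

/-- KMSW SIDE: in KMSW's countermodel of ANY leaf `l'` (book, Mok at the top) every edge holds and all statements HOLD — no KMSW premise in the tranche. [cite: EnnsLee2024ModpLGCGSp4, Lemma 4.1.6 (VoR); GinzburgSoudry2022DoubleDescent, §1; JiangZhang2014HermitianType, §1 (bookkeeping proved here)] [claim: KalethaMinguezShinWhite2014, under-review] -/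
theorem c132_kmsw (l' : KMSW2014.LeafSupport.Leaf) (w fp : Prop) :
    ¬ (KMSW2014.LeafSupport.mkN (KMSW2014.LeafSupport.cm l')).leaf l' ∧
      Implications132 νtop μtop (canon νtop μtop (KMSW2014.LeafSupport.mkN (KMSW2014.LeafSupport.cm l'))) (canon₂₈ νtop μtop (KMSW2014.LeafSupport.mkN (KMSW2014.LeafSupport.cm l')))
        (canon₈₂W νtop μtop w (canon νtop μtop (KMSW2014.LeafSupport.mkN (KMSW2014.LeafSupport.cm l'))).TaibiInner (canon νtop μtop (KMSW2014.LeafSupport.mkN (KMSW2014.LeafSupport.cm l'))).GeeTaibi fp)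
        (canon₁₃₂ νtop μtop (KMSW2014.LeafSupport.mkN (KMSW2014.LeafSupport.cm l'))) ∧
      ((canon₁₃₂ νtop μtop (KMSW2014.LeafSupport.mkN (KMSW2014.LeafSupport.cm l'))).JZtransferL ∧ (canon₁₃₂ νtop μtop (KMSW2014.LeafSupport.mkN (KMSW2014.LeafSupport.cm l'))).GSexactJ ∧
        (canon₈₂W νtop μtop w (canon νtop μtop (KMSW2014.LeafSupport.mkN (KMSW2014.LeafSupport.cm l'))).TaibiInner (canon νtop μtop (KMSW2014.LeafSupport.mkN (KMSW2014.LeafSupport.cm l'))).GeeTaibi fp).ELmain) :=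
  have b : ∀ N, νtop.Everything N := bookInputs_top.everything
  ⟨(KMSW2014.LeafSupport.countermodel l').2.2.1, canon_implications₁₃₂ _ _ _ w fp, ⟨⟨b, mokInputs_top.everything⟩, ⟨b, True.intro⟩, ⟨b, b, b⟩⟩⟩

/-- THE HUNDRED-AND-THIRTY-SECOND TRANCHE REGRADED, in one statement (C126's tranche-82 slots `w`, `fp` arbitrary): (i) at the top everything holds; (ii) Theorem 3.4 denied: Ginzburg – Soudry's §3 remark
fails for every assignment; (iii) in the book countermodel of any of the 24 leaves all seven theorems fail; (iv) in every Mok countermodel only Jiang – Zhang's transfer fails; (v) KMSW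
countermodels change nothing.  Supports: support(`ELjlTransfer`) = support(`ELgalois`) = support(C126's `ELmain` by the VoR route) = support(`GSmultiplicities`) = all 24 book leaves;
support(`GSexactJ`) = all 24 book leaves ∧ Theorem 3.4; support(`JZtransferL`) = all 24 book leaves ∧ all 29 Mok leaves; no KMSW leaf anywhere. [cite: EnnsLee2024ModpLGCGSp4, Lemma 4.1.6, Thm 4.1.4, Thm 4.5.1 (VoR); GinzburgSoudry2022DoubleDescent, §§1, 3, Thm 3.4; JiangZhang2014HermitianType, §1 (bookkeeping proved here)] [claim: KalethaMinguezShinWhite2014, under-review] -/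
theorem c132_regraded (w fp : Prop) :
    ((canon₁₃₂ νtop μtop κtop).ELjlTransfer ∧ (canon₁₃₂ νtop μtop κtop).ELgalois ∧
        (canon₈₂W νtop μtop w (canon νtop μtop κtop).TaibiInner (canon νtop μtop κtop).GeeTaibi fp).ELmain ∧ (canon₁₃₂ νtop μtop κtop).GSmultiplicities ∧
        (canon₁₃₂ νtop μtop κtop).GSexactJ ∧ (canon₁₃₂ νtop μtop κtop).JZtransferL) ∧
      (∀ (ν : Nodes) (μ : Mok2015.Nodes) (κ : KMSW2014.Nodes), ¬ (canon₁₃₂noD ν μ κ).GSexactJ) ∧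
      (∀ l : LeafSupport.Leaf, ¬ (LeafSupport.mkN (LeafSupport.cm l)).leaf l ∧ ¬ (canon₁₃₂ (LeafSupport.mkN (LeafSupport.cm l)) μtop κtop).ELjlTransfer ∧
        ¬ (canon₁₃₂ (LeafSupport.mkN (LeafSupport.cm l)) μtop κtop).ELgalois ∧
        ¬ (canon₈₂W (LeafSupport.mkN (LeafSupport.cm l)) μtop w (canon (LeafSupport.mkN (LeafSupport.cm l)) μtop κtop).TaibiInner (canon (LeafSupport.mkN (LeafSupport.cm l)) μtop κtop).GeeTaibi fp).ELmain ∧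
        ¬ (canon₁₃₂ (LeafSupport.mkN (LeafSupport.cm l)) μtop κtop).GSmultiplicities ∧ ¬ (canon₁₃₂ (LeafSupport.mkN (LeafSupport.cm l)) μtop κtop).JZtransferL) ∧
      (∀ l : Mok2015.LeafSupport.Leaf, ¬ (Mok2015.LeafSupport.mkN (Mok2015.LeafSupport.cm l)).leaf l ∧ ¬ (canon₁₃₂ νtop (Mok2015.LeafSupport.mkN (Mok2015.LeafSupport.cm l)) κnoMok).JZtransferL ∧
        (canon₁₃₂ νtop (Mok2015.LeafSupport.mkN (Mok2015.LeafSupport.cm l)) κnoMok).ELgalois ∧ (canon₁₃₂ νtop (Mok2015.LeafSupport.mkN (Mok2015.LeafSupport.cm l)) κnoMok).GSexactJ) ∧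
      (∀ l' : KMSW2014.LeafSupport.Leaf, ¬ (KMSW2014.LeafSupport.mkN (KMSW2014.LeafSupport.cm l')).leaf l' ∧
        (canon₁₃₂ νtop μtop (KMSW2014.LeafSupport.mkN (KMSW2014.LeafSupport.cm l'))).JZtransferL) :=
  have t := hundredthirtysecond_holds_top w fp
  ⟨⟨t.1, t.2.1, t.2.2.2.1, t.2.2.2.2.1, t.2.2.2.2.2.2.1, t.2.2.2.2.2.2.2⟩,
    fun ν μ κ => (c132_thm34 ν μ κ w fp).2.1,
    fun l => have h := c132_book_cm l w fp
      ⟨h.1, h.2.2.1.1, h.2.2.1.2.1, h.2.2.1.2.2.1, h.2.2.1.2.2.2.1, h.2.2.1.2.2.2.2.2⟩,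
    fun l => have h := c132_mok_cm l w fp
      ⟨h.1, h.2.2.1, h.2.2.2.1, h.2.2.2.2.2⟩,
    fun l' => have h := c132_kmsw l' w fp
      ⟨h.1, h.2.2.1⟩⟩

/-! ## 136. Hundred-and-thirty-third tranche (v2 of this file, after `Downstream38.lean` v2; unit `pub-arthur-down-g57`): supports of rows C78 Bergström – Dummigan – Mégarbané (`BDMexamples` ⇐ row C3's ★ ∧
★★ statements `Consumers.ChenevierRenardStar` / `…StarStar`) and C149 Bergström – Dummigan – Farmer – Koutsoliotas (`BDFKexamples` ⇐ C3's ★ ∧ ★★ ∧ C97 `Consumers32.MegarbaneSO`). -/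

/-- The canonical reading of the hundred-and-thirty-third tranche over `canon` and `canon₃₂`: each statement := exactly the conjunction of its typed premises (all book rows).
[cite: BergstromDummiganMegarbane2018Eisenstein, §§6, 8; BergstromDummiganFarmerKoutsoliotas2020, §§1, 7–9 (canonical model; bookkeeping)] -/
abbrev canon₁₃₃ (ν : Nodes) (μ : Mok2015.Nodes) (κ : KMSW2014.Nodes) : Consumers133 where
  BDMexamples := (canon ν μ κ).ChenevierRenardStar ∧ (canon ν μ κ).ChenevierRenardStarStar
  BDFKexamples := (canon ν μ κ).ChenevierRenardStar ∧ (canon ν μ κ).ChenevierRenardStarStar ∧ (canon₃₂ ν μ κ).MegarbaneSO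

/-- Both hundred-and-thirty-third-tranche edges hold in the canonical reading, for arbitrary ν, μ, κ. [cite: BergstromDummiganMegarbane2018Eisenstein, §6; BergstromDummiganFarmerKoutsoliotas2020, §1 (bookkeeping proved here)] -/
theorem canon_implications₁₃₃ (ν : Nodes) (μ : Mok2015.Nodes) (κ : KMSW2014.Nodes) : Implications133 (canon ν μ κ) (canon₃₂ ν μ κ) (canon₁₃₃ ν μ κ) where
  bdm := fun s t => ⟨s, t⟩
  bdfk := fun s t g => ⟨s, t, g⟩

/-- At the top both statements hold, through the tranche's own `hundredthirtythird_of_inputs` fed by `canon_implications₃₂`, `canon_implications`, `bookInputs_top`. [cite: BergstromDummiganMegarbane2018Eisenstein, §6; BergstromDummiganFarmerKoutsoliotas2020, §1 (bookkeeping proved here)] -/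
theorem hundredthirtythird_holds_top : (canon₁₃₃ νtop μtop κtop).BDMexamples ∧ (canon₁₃₃ νtop μtop κtop).BDFKexamples :=
  hundredthirtythird_of_inputs (canon_implications₁₃₃ νtop μtop κtop) (canon_implications₃₂ νtop μtop κtop) (canon_implications νtop μtop κtop) bookInputs_top

/-- EXACT SUPPORT AS TYPED: in the book countermodel of ANY of the 24 leaves (Mok, KMSW at the top; every edge of tranches 1 / 32 / 133 valid) both statements FAIL (Chenevier – Renard's ★ / ★★ statements
and Mégarbané's theorems are book rows); in every Mok countermodel and every KMSW leaf countermodel both HOLD. Supports = all 24 book leaves, nothing else. [cite: BergstromDummiganMegarbane2018Eisenstein, §§6, 8; BergstromDummiganFarmerKoutsoliotas2020, §§1, 7–9 (bookkeeping proved here)] [claim: KalethaMinguezShinWhite2014, under-review] -/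
theorem c133_regraded :
    ((canon₁₃₃ νtop μtop κtop).BDMexamples ∧ (canon₁₃₃ νtop μtop κtop).BDFKexamples) ∧
      (∀ l : LeafSupport.Leaf, ¬ (LeafSupport.mkN (LeafSupport.cm l)).leaf l ∧
        Implications133 (canon (LeafSupport.mkN (LeafSupport.cm l)) μtop κtop) (canon₃₂ (LeafSupport.mkN (LeafSupport.cm l)) μtop κtop) (canon₁₃₃ (LeafSupport.mkN (LeafSupport.cm l)) μtop κtop) ∧
        ¬ (canon₁₃₃ (LeafSupport.mkN (LeafSupport.cm l)) μtop κtop).BDMexamples ∧ ¬ (canon₁₃₃ (LeafSupport.mkN (LeafSupport.cm l)) μtop κtop).BDFKexamples) ∧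
      (∀ l : Mok2015.LeafSupport.Leaf, ¬ (Mok2015.LeafSupport.mkN (Mok2015.LeafSupport.cm l)).leaf l ∧
        Implications133 (canon νtop (Mok2015.LeafSupport.mkN (Mok2015.LeafSupport.cm l)) κnoMok) (canon₃₂ νtop (Mok2015.LeafSupport.mkN (Mok2015.LeafSupport.cm l)) κnoMok)
          (canon₁₃₃ νtop (Mok2015.LeafSupport.mkN (Mok2015.LeafSupport.cm l)) κnoMok) ∧
        (canon₁₃₃ νtop (Mok2015.LeafSupport.mkN (Mok2015.LeafSupport.cm l)) κnoMok).BDFKexamples) ∧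
      (∀ l' : KMSW2014.LeafSupport.Leaf, ¬ (KMSW2014.LeafSupport.mkN (KMSW2014.LeafSupport.cm l')).leaf l' ∧
        (canon₁₃₃ νtop μtop (KMSW2014.LeafSupport.mkN (KMSW2014.LeafSupport.cm l'))).BDFKexamples) :=
  have b : ∀ N, νtop.Everything N := bookInputs_top.everything
  ⟨hundredthirtythird_holds_top,
    fun l => have n := not_B_cm l
      ⟨(LeafSupport.countermodel l).2.2.1, canon_implications₁₃₃ _ _ _, fun h => n h.1, fun h => n h.1⟩,
    fun l => ⟨(Mok2015.LeafSupport.countermodel l).2.2.1, canon_implications₁₃₃ _ _ _, ⟨b, b, b, b, b, b, b⟩⟩,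
    fun l' => ⟨(KMSW2014.LeafSupport.countermodel l').2.2.1, ⟨b, b, b, b, b, b, b⟩⟩⟩

/-! ## 137. Hundred-and-thirty-fourth and hundred-and-thirty-sixth tranches (v2 of this file, after `Downstream38.lean` v3 / v6; unit `pub-arthur-down-g57`): supports of row C142 Cai – Fan in arXiv
v1 (`CFrelSC` ⇐ Mok ∧ C25 `Consumers34.BPPlancherel`) and v2 (`CFv2part3` ⇐ the same; `CFrelSCv2` ⇐ part 3), and of row C152 Matringe (node `MatLCTassume`; `MatLCTclassical` ⇐ the node ∧ book ∧
Mok ∧ B105 `Consumers26.JantzenLiu`). -/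

section Canon134

variable (ν : Nodes) (μ : Mok2015.Nodes) (κ : KMSW2014.Nodes)

/-- The parametrised canonical reading of the hundred-and-thirty-fourth tranche: `a` is the value of Matringe's standing assumption; Cai – Fan v1 := Mok ∧ C25's value (section 37's `canon₃₄`);
Matringe's classical-group statement := the node ∧ book ∧ Mok ∧ B105's value (section 29's `canon₂₆`). [cite: CaiFan2022TopExt, Thm 1.1 (arXiv v1); Matringe2024LocalConverse, closing observation (canonical model; bookkeeping)] [claim: KalethaMinguezShinWhite2014, under-review] -/
abbrev canon₁₃₄W (a : Prop) : Consumers134 where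
  CFrelSC := (∀ N, μ.Everything N) ∧ (canon₃₄ μ κ).BPPlancherel
  MatLCTassume := a
  MatLCTclassical := a ∧ (∀ N, ν.Everything N) ∧ (∀ N, μ.Everything N) ∧ (canon₂₆ ν μ κ).JantzenLiu

/-- The canonical instance: Matringe's assumption GRANTED. [cite: Matringe2024LocalConverse, closing observation (canonical model; bookkeeping)] [claim: KalethaMinguezShinWhite2014, under-review] -/
abbrev canon₁₃₄ : Consumers134 := canon₁₃₄W ν μ κ True

/-- NODE DENIED: Matringe's assumption false. [cite: Matringe2024LocalConverse, closing observation (separating model; bookkeeping)] [claim: KalethaMinguezShinWhite2014, under-review] -/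
abbrev canon₁₃₄noA : Consumers134 := canon₁₃₄W ν μ κ False

/-- The canonical reading of the hundred-and-thirty-sixth tranche: both Cai – Fan v2 statements := Mok ∧ C25's value. [cite: CaiFan2022TopExt, Thm 1.2 (arXiv v2) (canonical model; bookkeeping)] [claim: KalethaMinguezShinWhite2014, under-review] -/
abbrev canon₁₃₆ : Consumers136 where
  CFv2part3 := (∀ N, μ.Everything N) ∧ (canon₃₄ μ κ).BPPlancherel
  CFrelSCv2 := (∀ N, μ.Everything N) ∧ (canon₃₄ μ κ).BPPlancherel

/-- Every hundred-and-thirty-fourth-tranche edge holds in the parametrised reading, for any node value and arbitrary ν, μ, κ. [cite: CaiFan2022TopExt, Thm 1.1 (arXiv v1); Matringe2024LocalConverse, closing observation (bookkeeping proved here)] [claim: KalethaMinguezShinWhite2014, under-review] -/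
theorem canon_implications₁₃₄W (a : Prop) : Implications134 ν μ (canon₂₆ ν μ κ) (canon₃₄ μ κ) (canon₁₃₄W ν μ κ a) where
  cf := fun m p => ⟨m, p⟩
  mat := fun ha b m j => ⟨ha, b, m, j⟩

/-- The edges hold in the canonical instance. [cite: CaiFan2022TopExt, Thm 1.1 (arXiv v1) (bookkeeping proved here)] [claim: KalethaMinguezShinWhite2014, under-review] -/
theorem canon_implications₁₃₄ : Implications134 ν μ (canon₂₆ ν μ κ) (canon₃₄ μ κ) (canon₁₃₄ ν μ κ) := canon_implications₁₃₄W ν μ κ True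

/-- The edges hold with the node denied. [cite: Matringe2024LocalConverse, closing observation (bookkeeping proved here)] [claim: KalethaMinguezShinWhite2014, under-review] -/
theorem canon_implications₁₃₄noA : Implications134 ν μ (canon₂₆ ν μ κ) (canon₃₄ μ κ) (canon₁₃₄noA ν μ κ) := canon_implications₁₃₄W ν μ κ False

/-- Both hundred-and-thirty-sixth-tranche edges hold in the canonical reading, for arbitrary μ, κ. [cite: CaiFan2022TopExt, Thm 1.2 (arXiv v2) (bookkeeping proved here)] [claim: KalethaMinguezShinWhite2014, under-review] -/
theorem canon_implications₁₃₆ : Implications136 μ (canon₃₄ μ κ) (canon₁₃₆ μ κ) where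
  cfPart3 := fun m p => ⟨m, p⟩
  cf2 := fun h => h

end Canon134

/-- At the top (every input of the three DAGs; Matringe's node and tranche 6's `BPhyp` granted) Cai – Fan v1 / v2 and Matringe's statement hold — through the tranches' own `hundredthirtyfourth_of_inputs` /
`hundredthirtysixth_of_inputs` fed by `canon_implications₃₄`, `canon_implications₃₃`, `canon_implications₆`, `canon_implications₂₆`, `bookInputs_top`, `mokInputs_top`, `kmswInputs_top`.
[cite: CaiFan2022TopExt, Thm 1.1 (arXiv v1), Thm 1.2 (arXiv v2); Matringe2024LocalConverse, closing observation (bookkeeping proved here)] [claim: KalethaMinguezShinWhite2014, under-review] -/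
theorem hundredthirtyfourth_sixth_hold_top :
    ((canon₁₃₄ νtop μtop κtop).CFrelSC ∧ (canon₁₃₄ νtop μtop κtop).MatLCTassume ∧ (canon₁₃₄ νtop μtop κtop).MatLCTclassical) ∧
      ((canon₁₃₆ μtop κtop).CFv2part3 ∧ (canon₁₃₆ μtop κtop).CFrelSCv2) :=
  have h := hundredthirtyfourth_of_inputs (canon_implications₁₃₄ νtop μtop κtop) (canon_implications₃₄ νtop μtop κtop) (canon_implications₃₃ νtop μtop κtop)
    (canon_implications₆ νtop μtop κtop) (canon_implications₂₆ νtop μtop κtop) bookInputs_top mokInputs_top (kmswInputs_top μtop).1 trivial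
  ⟨⟨h.1, True.intro, h.2 True.intro⟩,
    hundredthirtysixth_of_inputs (canon_implications₁₃₆ μtop κtop) (canon_implications₃₄ νtop μtop κtop) (canon_implications₃₃ νtop μtop κtop)
      (canon_implications₆ νtop μtop κtop) mokInputs_top (kmswInputs_top μtop).1 trivial⟩

/-- EXACT SUPPORTS AS TYPED, tranches 134 / 136: (i) node denied — Matringe's statement FAILS for every assignment; (ii) in the book countermodel of ANY of the 24 leaves (Mok, KMSW at the top) Matringe's statement
FAILS (its book premise), Cai – Fan v1 / v2 HOLD (unitary groups: no book premise); (iii) in the Mok countermodel of ANY of the 29 leaves all three consumer statements FAIL; (iv) with KMSW's Mok import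
denied Cai – Fan v1 / v2 FAIL (C25 runs on KMSW's proved scope) while Matringe's holds; in KMSW's countermodel of `l'` Cai – Fan v1 / v2 hold iff `l'` ∈ {`AubertSS`, `KMS_A`, `KMS_B`}.  Supports:
support(`CFrelSC`) = support(`CFv2part3`) = support(`CFrelSCv2`) = all 29 Mok leaves ∧ KMSW's proved scope (the v1 → v2 rewrite changed no premise, tranche 136's `cf_v1_v2_same_premises`);
support(`MatLCTclassical`) = the node ∧ all 24 book leaves ∧ all 29 Mok leaves. [cite: CaiFan2022TopExt, Thm 1.1 (arXiv v1), Thm 1.2 (arXiv v2); Matringe2024LocalConverse, closing observation (bookkeeping proved here)] [claim: KalethaMinguezShinWhite2014, under-review] -/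
theorem c134_c136_regraded :
    (∀ (ν : Nodes) (μ : Mok2015.Nodes) (κ : KMSW2014.Nodes), Implications134 ν μ (canon₂₆ ν μ κ) (canon₃₄ μ κ) (canon₁₃₄noA ν μ κ) ∧ ¬ (canon₁₃₄noA ν μ κ).MatLCTclassical) ∧
      (∀ l : LeafSupport.Leaf, ¬ (LeafSupport.mkN (LeafSupport.cm l)).leaf l ∧
        Implications134 (LeafSupport.mkN (LeafSupport.cm l)) μtop (canon₂₆ (LeafSupport.mkN (LeafSupport.cm l)) μtop κtop) (canon₃₄ μtop κtop) (canon₁₃₄ (LeafSupport.mkN (LeafSupport.cm l)) μtop κtop) ∧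
        ¬ (canon₁₃₄ (LeafSupport.mkN (LeafSupport.cm l)) μtop κtop).MatLCTclassical ∧ (canon₁₃₄ (LeafSupport.mkN (LeafSupport.cm l)) μtop κtop).CFrelSC ∧ (canon₁₃₆ μtop κtop).CFrelSCv2) ∧
      (∀ l : Mok2015.LeafSupport.Leaf, ¬ (Mok2015.LeafSupport.mkN (Mok2015.LeafSupport.cm l)).leaf l ∧
        Implications134 νtop (Mok2015.LeafSupport.mkN (Mok2015.LeafSupport.cm l)) (canon₂₆ νtop (Mok2015.LeafSupport.mkN (Mok2015.LeafSupport.cm l)) κnoMok)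
          (canon₃₄ (Mok2015.LeafSupport.mkN (Mok2015.LeafSupport.cm l)) κnoMok) (canon₁₃₄ νtop (Mok2015.LeafSupport.mkN (Mok2015.LeafSupport.cm l)) κnoMok) ∧
        Implications136 (Mok2015.LeafSupport.mkN (Mok2015.LeafSupport.cm l)) (canon₃₄ (Mok2015.LeafSupport.mkN (Mok2015.LeafSupport.cm l)) κnoMok)
          (canon₁₃₆ (Mok2015.LeafSupport.mkN (Mok2015.LeafSupport.cm l)) κnoMok) ∧
        ¬ (canon₁₃₄ νtop (Mok2015.LeafSupport.mkN (Mok2015.LeafSupport.cm l)) κnoMok).CFrelSC ∧ ¬ (canon₁₃₄ νtop (Mok2015.LeafSupport.mkN (Mok2015.LeafSupport.cm l)) κnoMok).MatLCTclassical ∧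
        ¬ (canon₁₃₆ (Mok2015.LeafSupport.mkN (Mok2015.LeafSupport.cm l)) κnoMok).CFrelSCv2) ∧
      ((¬ (canon₁₃₄ νtop μtop κnoMok).CFrelSC ∧ ¬ (canon₁₃₆ μtop κnoMok).CFrelSCv2 ∧ (canon₁₃₄ νtop μtop κnoMok).MatLCTclassical) ∧
        ∀ l' : KMSW2014.LeafSupport.Leaf,
          Implications136 μtop (canon₃₄ μtop (KMSW2014.LeafSupport.mkN (KMSW2014.LeafSupport.cm l'))) (canon₁₃₆ μtop (KMSW2014.LeafSupport.mkN (KMSW2014.LeafSupport.cm l'))) ∧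
          ((canon₁₃₄ νtop μtop (KMSW2014.LeafSupport.mkN (KMSW2014.LeafSupport.cm l'))).CFrelSC ↔ l'.onlyFull = true) ∧
          ((canon₁₃₆ μtop (KMSW2014.LeafSupport.mkN (KMSW2014.LeafSupport.cm l'))).CFrelSCv2 ↔ l'.onlyFull = true)) := by
  have ns : ∀ N, ¬ κnoMok.Scope N := κnoMok_facts.2.2.2.2.2.1
  have b : ∀ N, νtop.Everything N := bookInputs_top.everything
  have m : ∀ N, μtop.Everything N := mokInputs_top.everything
  have top := hundredthirtyfourth_sixth_hold_top
  refine ⟨fun ν μ κ => ⟨canon_implications₁₃₄noA ν μ κ, fun h => h.1⟩,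
    fun l => ⟨(LeafSupport.countermodel l).2.2.1, canon_implications₁₃₄ _ _ _, fun h => not_B_cm l h.2.1, top.1.1, top.2.2⟩,
    fun l => have nm := not_M_cm l
      ⟨(Mok2015.LeafSupport.countermodel l).2.2.1, canon_implications₁₃₄ _ _ _, canon_implications₁₃₆ _ _, fun h => nm h.1, fun h => nm h.2.2.1, fun h => nm h.1⟩,
    ⟨⟨fun h => ns 0 (h.2.2.1 0), fun h => ns 0 (h.2.2.1 0), ⟨True.intro, b, m, m⟩⟩, fun l' => ?_⟩⟩
  have sc : (∀ N, (KMSW2014.LeafSupport.mkN (KMSW2014.LeafSupport.cm l')).Scope N) ↔ l'.onlyFull = true := by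
    refine ⟨fun h => ?_, fun h => scope_of_onlyFull l' h⟩
    cases hb : l'.onlyFull
    · exact absurd (h 0) (KMSW2014.LeafSupport.not_scope_of (KMSW2014.LeafSupport.scope_fails l' hb 0))
    · rfl
  have pl : ((∀ N, μtop.Everything N) ∧ (canon₃₄ μtop (KMSW2014.LeafSupport.mkN (KMSW2014.LeafSupport.cm l'))).BPPlancherel) ↔ l'.onlyFull = true :=
    ⟨fun h => sc.1 h.2.2.1, fun h => have s := sc.2 h
      ⟨m, m, s, ⟨m, s⟩, ⟨m, s, ⟨m, s⟩, ⟨m, s⟩⟩⟩⟩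
  exact ⟨canon_implications₁₃₆ _ _, pl, pl⟩

/-! ## 138. Hundred-and-thirty-fifth tranche (v2 of this file, after `Downstream38.lean` v4; unit `pub-arthur-down-g57`): supports of row B16 Cunningham – Fiori – Moussaoui – Mracek – Xu (the node-supplier
`CFMMXvoganLLC` ⇐ book ∧ the Chapter-9 leaf; `CFMMXpurePackets` ⇐ book ∧ the Chapter-9 leaf ∧ B75 `Consumers45.MoeglinMult1`; the examples `CFMMXexamples` ⇐ book ∧ both). -/

section Canon135

variable (ν : Nodes) (μ : Mok2015.Nodes) (κ : KMSW2014.Nodes)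

/-- The parametrised canonical reading of the hundred-and-thirty-fifth tranche over assignments of tranches 8 and 45: each statement := exactly the conjunction of its typed premises (the examples
:= book ∧ the pure-packets value ∧ the Vogan-LLC value). [cite: CunninghamEtAl2022ABV, §§1.3, 3.10–3.11, 9 (canonical model; bookkeeping)] -/
abbrev canon₁₃₅W (c₈ : Consumers8) (c₄₅ : Consumers45) : Consumers135 where
  CFMMXvoganLLC := (∀ N, ν.Everything N) ∧ c₈.InnerTwists
  CFMMXpurePackets := (∀ N, ν.Everything N) ∧ c₈.InnerTwists ∧ c₄₅.MoeglinMult1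
  CFMMXexamples := (∀ N, ν.Everything N) ∧ ((∀ N, ν.Everything N) ∧ c₈.InnerTwists ∧ c₄₅.MoeglinMult1) ∧ ((∀ N, ν.Everything N) ∧ c₈.InnerTwists)

/-- The canonical instance: Chapter-9 leaf GRANTED (`canon₈`), B75's node granted (`canon₄₅`). [cite: CunninghamEtAl2022ABV, §1.3 (canonical model; bookkeeping)] -/
abbrev canon₁₃₅ : Consumers135 := canon₁₃₅W ν (canon₈ ν μ κ) (canon₄₅ ν)

/-- CHAPTER-9 LEAF DENIED (`canon₈no`). [cite: CunninghamEtAl2022ABV, §1.3 with Arthur2013, Foreword p. xvii (separating model; bookkeeping)] -/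
abbrev canon₁₃₅noCh9 : Consumers135 := canon₁₃₅W ν (canon₈no ν μ) (canon₄₅ ν)

/-- B75's NODE DENIED (`canon₄₅noR`): the pure-packets statement and the examples false with it. [cite: CunninghamEtAl2022ABV, §3.11 with Moeglin2011Mult1, §1 (separating model; bookkeeping)] -/
abbrev canon₁₃₅noR : Consumers135 := canon₁₃₅W ν (canon₈ ν μ κ) (canon₄₅noR ν)

/-- Every hundred-and-thirty-fifth-tranche edge holds in the parametrised reading over ANY assignments of tranches 8 / 45, for arbitrary ν. [cite: CunninghamEtAl2022ABV, §§1.3, 3.10–3.11, 9 (bookkeeping proved here)] -/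
theorem canon_implications₁₃₅W (c₈ : Consumers8) (c₄₅ : Consumers45) : Implications135 ν c₈ c₄₅ (canon₁₃₅W ν c₈ c₄₅) where
  node := fun b n => ⟨b, n⟩
  pure := fun b n m => ⟨b, n, m⟩
  ex := fun b p v => ⟨b, p, v⟩

/-- The edges hold in the canonical instance and in the two denied readings. [cite: CunninghamEtAl2022ABV, §1.3 (bookkeeping proved here)] -/
theorem canon_implications₁₃₅ :
    Implications135 ν (canon₈ ν μ κ) (canon₄₅ ν) (canon₁₃₅ ν μ κ) ∧ Implications135 ν (canon₈no ν μ) (canon₄₅ ν) (canon₁₃₅noCh9 ν μ) ∧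
      Implications135 ν (canon₈ ν μ κ) (canon₄₅noR ν) (canon₁₃₅noR ν μ κ) :=
  ⟨canon_implications₁₃₅W ν _ _, canon_implications₁₃₅W ν _ _, canon_implications₁₃₅W ν _ _⟩

end Canon135

/-- At the top (every input of the book's DAG; leaf 9 and B75's node granted) all three statements hold — through the tranche's own `hundredthirtyfifth_of_inputs` fed by `canon_implications₄₅`,
`bookInputs_top`, the grant of the Chapter-9 leaf and B75's node from `fortyfifth_holds_top`. [cite: CunninghamEtAl2022ABV, §§1.3, 3.10–3.11, 9 (bookkeeping proved here)] -/
theorem hundredthirtyfifth_holds_top : (canon₁₃₅ νtop μtop κtop).CFMMXvoganLLC ∧ (canon₁₃₅ νtop μtop κtop).CFMMXpurePackets ∧ (canon₁₃₅ νtop μtop κtop).CFMMXexamples :=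
  hundredthirtyfifth_of_inputs (canon_implications₁₃₅ νtop μtop κtop).1 (canon_implications₄₅ νtop μtop κtop) bookInputs_top True.intro fortyfifth_holds_top.1

/-- EXACT SUPPORT AS TYPED: (i) Chapter-9 leaf denied — all three statements FAIL for every assignment; B75's node denied — the pure-packets statement and the examples FAIL, the Vogan-LLC supplier
keeps its value; (ii) in the book countermodel of ANY of the 24 leaves (leaf 9 and node granted; every edge of tranches 8 / 45 / 135 valid) all three FAIL; (iii) Mok / KMSW countermodels change
nothing.  Supports: support(`CFMMXvoganLLC`) = all 24 book leaves ∧ the Chapter-9 leaf; support(`CFMMXpurePackets`) = support(`CFMMXexamples`) = that ∧ B75's node. [cite: CunninghamEtAl2022ABV, §§1.3, 3.10–3.11, 9 (bookkeeping proved here)] [claim: KalethaMinguezShinWhite2014, under-review] -/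
theorem c135_regraded :
    ((canon₁₃₅ νtop μtop κtop).CFMMXvoganLLC ∧ (canon₁₃₅ νtop μtop κtop).CFMMXpurePackets ∧ (canon₁₃₅ νtop μtop κtop).CFMMXexamples) ∧
      (∀ (ν : Nodes) (μ : Mok2015.Nodes) (κ : KMSW2014.Nodes), ¬ (canon₁₃₅noCh9 ν μ).CFMMXvoganLLC ∧ ¬ (canon₁₃₅noCh9 ν μ).CFMMXpurePackets ∧ ¬ (canon₁₃₅noCh9 ν μ).CFMMXexamples ∧
        ¬ (canon₁₃₅noR ν μ κ).CFMMXpurePackets ∧ ¬ (canon₁₃₅noR ν μ κ).CFMMXexamples ∧ ((canon₁₃₅noR ν μ κ).CFMMXvoganLLC ↔ (canon₁₃₅ ν μ κ).CFMMXvoganLLC)) ∧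
      (∀ l : LeafSupport.Leaf, ¬ (LeafSupport.mkN (LeafSupport.cm l)).leaf l ∧
        Implications135 (LeafSupport.mkN (LeafSupport.cm l)) (canon₈ (LeafSupport.mkN (LeafSupport.cm l)) μtop κtop) (canon₄₅ (LeafSupport.mkN (LeafSupport.cm l))) (canon₁₃₅ (LeafSupport.mkN (LeafSupport.cm l)) μtop κtop) ∧
        ¬ (canon₁₃₅ (LeafSupport.mkN (LeafSupport.cm l)) μtop κtop).CFMMXvoganLLC ∧ ¬ (canon₁₃₅ (LeafSupport.mkN (LeafSupport.cm l)) μtop κtop).CFMMXpurePackets ∧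
        ¬ (canon₁₃₅ (LeafSupport.mkN (LeafSupport.cm l)) μtop κtop).CFMMXexamples) ∧
      (∀ (l : Mok2015.LeafSupport.Leaf) (l' : KMSW2014.LeafSupport.Leaf), ¬ (Mok2015.LeafSupport.mkN (Mok2015.LeafSupport.cm l)).leaf l ∧ ¬ (KMSW2014.LeafSupport.mkN (KMSW2014.LeafSupport.cm l')).leaf l' ∧
        (canon₁₃₅ νtop (Mok2015.LeafSupport.mkN (Mok2015.LeafSupport.cm l)) κnoMok).CFMMXexamples ∧ (canon₁₃₅ νtop μtop (KMSW2014.LeafSupport.mkN (KMSW2014.LeafSupport.cm l'))).CFMMXexamples) :=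
  have t := hundredthirtyfifth_holds_top
  ⟨t,
    fun _ _ _ => ⟨fun h => h.2, fun h => h.2.1, fun h => h.2.2.2, fun h => h.2.2.2, fun h => h.2.1.2.2.2, Iff.rfl⟩,
    fun l => have n := not_B_cm l
      ⟨(LeafSupport.countermodel l).2.2.1, (canon_implications₁₃₅ _ _ _).1, fun h => n h.1, fun h => n h.1, fun h => n h.1⟩,
    fun l l' => ⟨(Mok2015.LeafSupport.countermodel l).2.2.1, (KMSW2014.LeafSupport.countermodel l').2.2.1, t.2.2, t.2.2⟩⟩


/-! ## 139. Hundred-and-thirty-seventh tranche (v2 of this file, after `Downstream38.lean` v7 / v8; unit `pub-arthur-down-g58`'s 2026-08-25 arXiv MAILING): support of row C251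
H. T. Dang, arXiv:2608.14145 v2 (`Consumers137.DangTypeVa` = the new §5 Theorem 5.2 with Corollary 5.3, typed with the premise-free edge `E_DangTypeVa`: its printed inputs are
« [36, Thm. 11.4] » = Rösner – Weissauer = the census's control row C18 and « [39] » = Gan – Tantono 2014, both outside the three DAGs) — ∅ —, SIDE BY SIDE with the same
row's tranche-100 statement `Consumers100.DangRB` (Theorem 2.4 with Proposition 4.4, v1 = v2; section 103's `canon₁₀₀`: all 24 book leaves, nothing of Mok / KMSW). -/

/-- The canonical reading of the hundred-and-thirty-seventh tranche: C251 v2's Theorem 5.2 := `True` — its one edge `E_DangTypeVa` has no premise. [cite: Dang2026RichelotBrandt, Thm 5.2, Cor. 5.3 (arXiv v2, 2026-08-24) (canonical model; bookkeeping)] -/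
abbrev canon₁₃₇ : Consumers137 where
  DangTypeVa := True

/-- The tranche's one edge holds in the canonical reading. [cite: Dang2026RichelotBrandt, Thm 5.2 (bookkeeping proved here)] -/
theorem canon_implications₁₃₇ : Implications137 canon₁₃₇ where
  dangTypeVa := True.intro

/-- At the top BOTH typed statements of row C251 hold: v2's Theorem 5.2 through the tranche's own `hundredthirtyseventh_of_inputs`, Theorem 2.4 (v1 = v2) by section 103's
`hundredth_holds_top` (every input of the book's DAG; tranches 1 / 19 / 20 / 21 / 28 / 98 / 100 read canonically). [cite: Dang2026RichelotBrandt, Thm 2.4 (v1 = v2), Thm 5.2 (v2) (bookkeeping proved here)] -/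
theorem hundredthirtyseventh_holds_top : canon₁₃₇.DangTypeVa ∧ (canon₁₀₀ νtop μtop κtop).DangRB :=
  ⟨hundredthirtyseventh_of_inputs canon_implications₁₃₇, hundredth_holds_top.2.2⟩

/-- EXACT SUPPORT AS TYPED, THE TWO TEXT STATES OF ROW C251 SIDE BY SIDE: (i) at the top both hold; (ii) in the book countermodel of ANY of the 24 leaves `l` (Mok, KMSW at the
top; every edge of tranches 100 / 137 valid) v2's Theorem 5.2 HOLDS while Theorem 2.4 FAILS (section 103's `c100_book_cm`: « the Arthur classification of the split side » by
name and through rows C90 / C244 / C180); (iii) in every Mok countermodel and every KMSW leaf countermodel (book at the top) both HOLD (section 103's `c100_unitary_independent`).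
Supports: support(`DangTypeVa`) = ∅ — no leaf of the book's DAG (so none of the seven 2024–2026 preprint leaves and neither unwritten weighted fundamental lemma), none of
Mok's, none of KMSW's; support(`DangRB`) = all 24 book leaves, unchanged by the replacement.  The typed form of the v2 status table's two lines « Theorem 2.4 … Derived
from published transfer and classification results » / « Theorem 5.2 … Unconditional theorem, via [36, Thm. 11.4] » (`Downstream38.lean`, tranche 137, arXiv v2 p0007:L6-9).
[cite: Dang2026RichelotBrandt, status table (arXiv v2 p0007:L6-9), Thm 5.2 proof (p0016:L6-19), §4.2 (p0012:L37-42) (bookkeeping proved here)] [claim: KalethaMinguezShinWhite2014, under-review] -/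
theorem c137_regraded :
    (canon₁₃₇.DangTypeVa ∧ (canon₁₀₀ νtop μtop κtop).DangRB) ∧
      (∀ l : LeafSupport.Leaf, ¬ (LeafSupport.mkN (LeafSupport.cm l)).leaf l ∧ Implications137 canon₁₃₇ ∧
        Implications100 (LeafSupport.mkN (LeafSupport.cm l)) (canon₁₉ (LeafSupport.mkN (LeafSupport.cm l)) μtop κtop) (canon₂₁ (LeafSupport.mkN (LeafSupport.cm l)) μtop κtop)
          (canon₂₈ (LeafSupport.mkN (LeafSupport.cm l)) μtop κtop) (canon₉₈ (LeafSupport.mkN (LeafSupport.cm l)) μtop κtop) (canon₁₀₀ (LeafSupport.mkN (LeafSupport.cm l)) μtop κtop) ∧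
        canon₁₃₇.DangTypeVa ∧ ¬ (canon₁₀₀ (LeafSupport.mkN (LeafSupport.cm l)) μtop κtop).DangRB) ∧
      (∀ (l : Mok2015.LeafSupport.Leaf) (l' : KMSW2014.LeafSupport.Leaf), ¬ (Mok2015.LeafSupport.mkN (Mok2015.LeafSupport.cm l)).leaf l ∧
        ¬ (KMSW2014.LeafSupport.mkN (KMSW2014.LeafSupport.cm l')).leaf l' ∧ canon₁₃₇.DangTypeVa ∧
        (canon₁₀₀ νtop (Mok2015.LeafSupport.mkN (Mok2015.LeafSupport.cm l)) κnoMok).DangRB ∧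
        (canon₁₀₀ νtop μtop (KMSW2014.LeafSupport.mkN (KMSW2014.LeafSupport.cm l'))).DangRB) :=
  ⟨hundredthirtyseventh_holds_top,
    fun l => have h := c100_book_cm l
      ⟨h.2.2.1, canon_implications₁₃₇, h.2.2.2.1.2.2.2.2.2.2, True.intro, h.2.2.2.2.2.2⟩,
    fun l l' => have u := c100_unitary_independent l l'
      ⟨(Mok2015.LeafSupport.countermodel l).2.2.1, (KMSW2014.LeafSupport.countermodel l').2.2.1, True.intro, u.1.2.2, u.2.2.2⟩⟩



/-! ## 140. Hundred-and-thirty-eighth tranche (v4 of this file, after `Downstream39.lean` v1; unit `pub-arthur-down-g59`): supports of row C73 A. Graham, Algebra & Number Theory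
18:6 (2024), typed from the version of record (`GrahamSMO` = Prop. C.0.3 ⇐ Mok ∧ KMSW's proved scope ∧ row C13 `Consumers.LTXZZ`; `GrahamFamily` = Thm 6.2.5 / Cor. 6.2.3 ⇐ Mok ∧
scope ∧ row A6's case U `Consumers46.ChenZouU` ∧ `GrahamSMO`; `GrahamThmB` = Theorem B ⇐ `GrahamFamily`) and of row C306 W. T. Gan – A. Raghuram, Tata Inst. Fundam. Res. Stud.
Math. 22 (2013) (`GanRaghuramSigma` = Thm 9.5 / Cor. 9.6 ⇐ the book ∧ Mok; `GanRaghuramGeneric` = Thm 10.1 ⇐ the book ∧ Mok ∧ `GanRaghuramSigma`; printed numbering, arXiv v2 — the corpus TeX's sequential « 26 » / « 27 » / « 28 »), over section 1's `canon` (`LTXZZ` :=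
KMSW's scope at every rank) and section 49's `canon₄₆` (`ChenZouU` := Mok at every rank). -/

section Canon138

variable (ν : Nodes) (μ : Mok2015.Nodes) (κ : KMSW2014.Nodes)

/-- The canonical reading of the hundred-and-thirty-eighth tranche: each statement := exactly the conjunction of its typed premises over `canon` / `canon₄₆`. [cite: Graham2024FJinterpolation, Prop. C.0.3, Thm 6.2.5, Thm B; GanRaghuram2013Arithmeticity, Thms 9.5, 10.1 (canonical model; bookkeeping)] [claim: KalethaMinguezShinWhite2014, under-review] -/
abbrev canon₁₃₈ : Consumers138 where
  GrahamSMO := (∀ N, μ.Everything N) ∧ (∀ N, κ.Scope N) ∧ (canon ν μ κ).LTXZZ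
  GrahamFamily := (∀ N, μ.Everything N) ∧ (∀ N, κ.Scope N) ∧ (canon₄₆ ν μ).ChenZouU ∧ ((∀ N, μ.Everything N) ∧ (∀ N, κ.Scope N) ∧ (canon ν μ κ).LTXZZ)
  GrahamThmB := (∀ N, μ.Everything N) ∧ (∀ N, κ.Scope N) ∧ (canon₄₆ ν μ).ChenZouU ∧ ((∀ N, μ.Everything N) ∧ (∀ N, κ.Scope N) ∧ (canon ν μ κ).LTXZZ)
  GanRaghuramSigma := (∀ N, ν.Everything N) ∧ (∀ N, μ.Everything N)
  GanRaghuramGeneric := (∀ N, ν.Everything N) ∧ (∀ N, μ.Everything N) ∧ ((∀ N, ν.Everything N) ∧ (∀ N, μ.Everything N))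

/-- Every hundred-and-thirty-eighth-tranche edge holds in the canonical reading, for arbitrary ν, μ, κ. [cite: Graham2024FJinterpolation, Prop. C.0.3, Thm 6.2.5, Thm B; GanRaghuram2013Arithmeticity, Thms 9.5, 10.1 (bookkeeping proved here)] [claim: KalethaMinguezShinWhite2014, under-review] -/
theorem canon_implications₁₃₈ : Implications138 ν μ κ (canon ν μ κ) (canon₄₆ ν μ) (canon₁₃₈ ν μ κ) where
  smo := fun m s l => ⟨m, s, l⟩
  family := fun m s u g => ⟨m, s, u, g⟩
  thmB := fun f => f
  grSigma := fun b m => ⟨b, m⟩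
  grGeneric := fun b m t => ⟨b, m, t⟩

end Canon138

/-- At the top (every input of the three DAGs, KMSW's bundles for its proved scope) all five statements hold — through the tranche's own `hundredthirtyeighth_of_inputs` fed by
section 1's `canon_implications`, section 49's `canon_implications₄₆`, `bookInputs_top`, `mokInputs_top` and `kmswInputs_top`. [cite: Graham2024FJinterpolation, Prop. C.0.3, Thm 6.2.5, Thm B; GanRaghuram2013Arithmeticity, Thms 9.5, 10.1 (bookkeeping proved here)] [claim: KalethaMinguezShinWhite2014, under-review] -/
theorem hundredthirtyeighth_holds_top :
    ((canon₁₃₈ νtop μtop κtop).GrahamSMO ∧ (canon₁₃₈ νtop μtop κtop).GrahamFamily ∧ (canon₁₃₈ νtop μtop κtop).GrahamThmB) ∧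
      ((canon₁₃₈ νtop μtop κtop).GanRaghuramSigma ∧ (canon₁₃₈ νtop μtop κtop).GanRaghuramGeneric) :=
  hundredthirtyeighth_of_inputs (canon_implications₁₃₈ νtop μtop κtop) (canon_implications νtop μtop κtop) (canon_implications₄₆ νtop μtop κtop) bookInputs_top
    mokInputs_top (kmswInputs_top μtop).1

/-- BOOK SIDE, EXACT SUPPORTS AS TYPED: in the book countermodel of ANY of the 24 leaves `l` (Mok and KMSW at the top; every edge of tranches 1 / 46 / 138 valid over it)
row C73's three statements HOLD — no leaf of the book is load-bearing for them (the tranche's `c73_book_free`) — while row C306's two statements FAIL (`not_B_cm`):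
ALL 24 book leaves are load-bearing for C306. [cite: Graham2024FJinterpolation, Remark 1.1.5; GanRaghuram2013Arithmeticity, §9 p0018:L3-7 (bookkeeping proved here)] [claim: KalethaMinguezShinWhite2014, under-review] -/
theorem c138_book_cm (l : LeafSupport.Leaf) :
    ¬ (LeafSupport.mkN (LeafSupport.cm l)).leaf l ∧
      Implications138 (LeafSupport.mkN (LeafSupport.cm l)) μtop κtop (canon (LeafSupport.mkN (LeafSupport.cm l)) μtop κtop)
        (canon₄₆ (LeafSupport.mkN (LeafSupport.cm l)) μtop) (canon₁₃₈ (LeafSupport.mkN (LeafSupport.cm l)) μtop κtop) ∧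
      ((canon₁₃₈ (LeafSupport.mkN (LeafSupport.cm l)) μtop κtop).GrahamSMO ∧ (canon₁₃₈ (LeafSupport.mkN (LeafSupport.cm l)) μtop κtop).GrahamFamily ∧
        (canon₁₃₈ (LeafSupport.mkN (LeafSupport.cm l)) μtop κtop).GrahamThmB) ∧
      (¬ (canon₁₃₈ (LeafSupport.mkN (LeafSupport.cm l)) μtop κtop).GanRaghuramSigma ∧
        ¬ (canon₁₃₈ (LeafSupport.mkN (LeafSupport.cm l)) μtop κtop).GanRaghuramGeneric) :=
  have nb := not_B_cm l
  ⟨(LeafSupport.countermodel l).2.2.1, canon_implications₁₃₈ _ _ _,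
    c73_of_inputs (canon_implications₁₃₈ _ μtop κtop) (canon_implications _ μtop κtop) (canon_implications₄₆ _ μtop κtop) mokInputs_top (kmswInputs_top μtop).1,
    ⟨fun h => nb h.1, fun h => nb h.1⟩⟩

/-- MOK SIDE, EXACT SUPPORTS AS TYPED: in the Mok countermodel of ANY of the 29 leaves `l` (book at the top; KMSW without its Mok import; every edge valid) all five
statements FAIL — each carries Mok's `Everything` at every rank (`not_M_cm`): ALL 29 Mok leaves are load-bearing for both rows. [cite: Graham2024FJinterpolation, Remark 1.1.5, Appendix C; GanRaghuram2013Arithmeticity, §9 with Remark 9.1 (bookkeeping proved here)] [claim: KalethaMinguezShinWhite2014, under-review] -/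
theorem c138_mok_cm (l : Mok2015.LeafSupport.Leaf) :
    ¬ (Mok2015.LeafSupport.mkN (Mok2015.LeafSupport.cm l)).leaf l ∧
      Implications138 νtop (Mok2015.LeafSupport.mkN (Mok2015.LeafSupport.cm l)) κnoMok (canon νtop (Mok2015.LeafSupport.mkN (Mok2015.LeafSupport.cm l)) κnoMok)
        (canon₄₆ νtop (Mok2015.LeafSupport.mkN (Mok2015.LeafSupport.cm l))) (canon₁₃₈ νtop (Mok2015.LeafSupport.mkN (Mok2015.LeafSupport.cm l)) κnoMok) ∧
      (¬ (canon₁₃₈ νtop (Mok2015.LeafSupport.mkN (Mok2015.LeafSupport.cm l)) κnoMok).GrahamSMO ∧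
        ¬ (canon₁₃₈ νtop (Mok2015.LeafSupport.mkN (Mok2015.LeafSupport.cm l)) κnoMok).GrahamFamily ∧
        ¬ (canon₁₃₈ νtop (Mok2015.LeafSupport.mkN (Mok2015.LeafSupport.cm l)) κnoMok).GrahamThmB) ∧
      (¬ (canon₁₃₈ νtop (Mok2015.LeafSupport.mkN (Mok2015.LeafSupport.cm l)) κnoMok).GanRaghuramSigma ∧
        ¬ (canon₁₃₈ νtop (Mok2015.LeafSupport.mkN (Mok2015.LeafSupport.cm l)) κnoMok).GanRaghuramGeneric) :=
  have nm := not_M_cm l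
  ⟨(Mok2015.LeafSupport.countermodel l).2.2.1, canon_implications₁₃₈ _ _ _, ⟨fun h => nm h.1, fun h => nm h.1, fun h => nm h.1⟩, ⟨fun h => nm h.2, fun h => nm h.2.1⟩⟩

/-- KMSW SIDE, EXACT SUPPORTS AS TYPED: (i) with KMSW's Mok import denied (`κnoMok`: neither scope nor full statements at any rank) row C73's statements FAIL while row
C306's HOLD (book and Mok at the top; `c306_kmsw_free`); (ii) in KMSW's countermodel of leaf `l'` (book, Mok at the top) each C73 statement HOLDS iff `l'` is one of the
three leaves only the starred statements need (`AubertSS`, `KMS_A`, `KMS_B`) — the eleven proved-scope leaves are load-bearing, the sequels are not — and C306's Theorem 10.1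
HOLDS for every `l'`. [cite: Graham2024FJinterpolation, Prop. C.0.3, Appendix C; GanRaghuram2013Arithmeticity, Thm 10.1 (bookkeeping proved here)] [claim: KalethaMinguezShinWhite2014, under-review] -/
theorem c138_kmsw (l' : KMSW2014.LeafSupport.Leaf) :
    (¬ (canon₁₃₈ νtop μtop κnoMok).GrahamSMO ∧ ¬ (canon₁₃₈ νtop μtop κnoMok).GrahamThmB ∧ (canon₁₃₈ νtop μtop κnoMok).GanRaghuramGeneric) ∧
      Implications138 νtop μtop (KMSW2014.LeafSupport.mkN (KMSW2014.LeafSupport.cm l')) (canon νtop μtop (KMSW2014.LeafSupport.mkN (KMSW2014.LeafSupport.cm l')))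
        (canon₄₆ νtop μtop) (canon₁₃₈ νtop μtop (KMSW2014.LeafSupport.mkN (KMSW2014.LeafSupport.cm l'))) ∧
      (((canon₁₃₈ νtop μtop (KMSW2014.LeafSupport.mkN (KMSW2014.LeafSupport.cm l'))).GrahamSMO ↔ l'.onlyFull = true) ∧
        ((canon₁₃₈ νtop μtop (KMSW2014.LeafSupport.mkN (KMSW2014.LeafSupport.cm l'))).GrahamThmB ↔ l'.onlyFull = true) ∧
        (canon₁₃₈ νtop μtop (KMSW2014.LeafSupport.mkN (KMSW2014.LeafSupport.cm l'))).GanRaghuramGeneric) := by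
  have ns : ∀ N, ¬ κnoMok.Scope N := κnoMok_facts.2.2.2.2.2.1
  have m : ∀ N, μtop.Everything N := mokInputs_top.everything
  have b : ∀ N, νtop.Everything N := bookInputs_top.everything
  have sc : (∀ N, (KMSW2014.LeafSupport.mkN (KMSW2014.LeafSupport.cm l')).Scope N) ↔ l'.onlyFull = true := by
    refine ⟨fun h => ?_, fun h => scope_of_onlyFull l' h⟩
    cases hb : l'.onlyFull
    · exact absurd (h 0) (KMSW2014.LeafSupport.not_scope_of (KMSW2014.LeafSupport.scope_fails l' hb 0))
    · rfl
  refine ⟨⟨fun h => ns 0 (h.2.1 0), fun h => ns 0 (h.2.1 0), ⟨b, m, ⟨b, m⟩⟩⟩, canon_implications₁₃₈ _ _ _, ?_, ?_, ⟨b, m, ⟨b, m⟩⟩⟩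
  · exact ⟨fun h => sc.1 h.2.1, fun h => have s := sc.2 h; ⟨m, s, s⟩⟩
  · exact ⟨fun h => sc.1 h.2.1, fun h => have s := sc.2 h; ⟨m, s, m, ⟨m, s, s⟩⟩⟩

/-- THE HUNDRED-AND-THIRTY-EIGHTH TRANCHE REGRADED, in one statement: (i) at the top all five statements hold; (ii) in the book countermodel of ANY of the 24 leaves C73's
Theorem B HOLDS (no book leaf is load-bearing) and C306's Theorem 10.1 FAILS (every book leaf is); (iii) in the Mok countermodel of ANY of the 29 leaves both FAIL; (iv) with KMSW's
Mok import denied Theorem B fails and Theorem 10.1 holds, and in KMSW's countermodel of `l'` Theorem B holds iff `l'` ∈ {`AubertSS`, `KMS_A`, `KMS_B`} while Theorem 10.1 holds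
for every `l'`.  Supports: support(`GrahamSMO`) = support(`GrahamFamily`) = support(`GrahamThmB`) = all 29 Mok leaves ∧ KMSW's eleven proved-scope leaves, NO leaf of the book;
support(`GanRaghuramSigma`) = support(`GanRaghuramGeneric`) = all 24 book leaves ∧ all 29 Mok leaves, NO leaf of KMSW; no node for either row.  In 2026 terms: C73 is
conditional on Mok's 2024–2026 preprint layer and the two unwritten weighted fundamental lemmas as Mok's memoir consumes them (its printed Remark 1.1.5); C306 on the book's
AND Mok's preprint layers and on both copies of the two weighted fundamental lemmas (no sentence in its text). [cite: Graham2024FJinterpolation, Remark 1.1.5, Appendix C, Thm B; GanRaghuram2013Arithmeticity, Thms 9.5, 10.1 (bookkeeping proved here)] [claim: KalethaMinguezShinWhite2014, under-review] -/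
theorem c138_regraded :
    (((canon₁₃₈ νtop μtop κtop).GrahamSMO ∧ (canon₁₃₈ νtop μtop κtop).GrahamFamily ∧ (canon₁₃₈ νtop μtop κtop).GrahamThmB) ∧
        ((canon₁₃₈ νtop μtop κtop).GanRaghuramSigma ∧ (canon₁₃₈ νtop μtop κtop).GanRaghuramGeneric)) ∧
      (∀ l : LeafSupport.Leaf, ¬ (LeafSupport.mkN (LeafSupport.cm l)).leaf l ∧ (canon₁₃₈ (LeafSupport.mkN (LeafSupport.cm l)) μtop κtop).GrahamThmB ∧
        ¬ (canon₁₃₈ (LeafSupport.mkN (LeafSupport.cm l)) μtop κtop).GanRaghuramGeneric) ∧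
      (∀ l : Mok2015.LeafSupport.Leaf, ¬ (Mok2015.LeafSupport.mkN (Mok2015.LeafSupport.cm l)).leaf l ∧
        ¬ (canon₁₃₈ νtop (Mok2015.LeafSupport.mkN (Mok2015.LeafSupport.cm l)) κnoMok).GrahamThmB ∧
        ¬ (canon₁₃₈ νtop (Mok2015.LeafSupport.mkN (Mok2015.LeafSupport.cm l)) κnoMok).GanRaghuramGeneric) ∧
      ((¬ (canon₁₃₈ νtop μtop κnoMok).GrahamThmB ∧ (canon₁₃₈ νtop μtop κnoMok).GanRaghuramGeneric) ∧
        ∀ l' : KMSW2014.LeafSupport.Leaf, ((canon₁₃₈ νtop μtop (KMSW2014.LeafSupport.mkN (KMSW2014.LeafSupport.cm l'))).GrahamThmB ↔ l'.onlyFull = true) ∧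
          (canon₁₃₈ νtop μtop (KMSW2014.LeafSupport.mkN (KMSW2014.LeafSupport.cm l'))).GanRaghuramGeneric) :=
  ⟨hundredthirtyeighth_holds_top,
    fun l => have h := c138_book_cm l
      ⟨h.1, h.2.2.1.2.2, h.2.2.2.2⟩,
    fun l => have h := c138_mok_cm l
      ⟨h.1, h.2.2.1.2.2, h.2.2.2.2⟩,
    ⟨⟨(c138_kmsw .MokMain).1.2.1, (c138_kmsw .MokMain).1.2.2⟩, fun l' => ⟨(c138_kmsw l').2.2.2.1, (c138_kmsw l').2.2.2.2⟩⟩⟩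


/-! ## 141. Hundred-and-thirty-ninth tranche (v5 of this file, after `Downstream39.lean` v2; unit `pub-arthur-down-g60`): support of row C73's COROLLARY C — A. Graham, Algebra &
Number Theory 18:6 (2024), typed from the version of record once its further printed input [Chen and Gan 2021] = arXiv:2108.04064 was read (`GrahamCorC` ⇐ `GrahamThmB`, the
row's own Theorem B; Chen – Gan's Proposition 7.5 / Corollary 7.6 (1) and [Caraiani 2012] Arthur-free, absorbed) — over section 140's `canon₁₃₈`. -/

section Canon139

variable (ν : Nodes) (μ : Mok2015.Nodes) (κ : KMSW2014.Nodes)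

/-- The canonical reading of the hundred-and-thirty-ninth tranche: Corollary C := its one typed premise, section 140's reading of Theorem B (itself the conjunction Mok ∧ KMSW's
scope ∧ `canon₄₆.ChenZouU` ∧ (Mok ∧ scope ∧ `canon.LTXZZ`)). [cite: Graham2024FJinterpolation, Cor. C (canonical model; bookkeeping)] [claim: KalethaMinguezShinWhite2014, under-review] -/
abbrev canon₁₃₉ : Consumers139 where
  GrahamCorC := (canon₁₃₈ ν μ κ).GrahamThmB

/-- The hundred-and-thirty-ninth-tranche edge holds in the canonical reading, for arbitrary ν, μ, κ. [cite: Graham2024FJinterpolation, Cor. C (bookkeeping proved here)] [claim: KalethaMinguezShinWhite2014, under-review] -/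
theorem canon_implications₁₃₉ : Implications139 (canon₁₃₈ ν μ κ) (canon₁₃₉ ν μ κ) where
  corC := fun h => h

end Canon139

/-- At the top (every input of the three DAGs, KMSW's bundles for its proved scope) Corollary C holds — through the tranche's own `hundredthirtyninth_of_inputs` fed by section 140's
`canon_implications₁₃₈`, section 1's `canon_implications`, section 49's `canon_implications₄₆`, `mokInputs_top` and `kmswInputs_top`. [cite: Graham2024FJinterpolation, Cor. C (bookkeeping proved here)] [claim: KalethaMinguezShinWhite2014, under-review] -/
theorem hundredthirtyninth_holds_top : (canon₁₃₉ νtop μtop κtop).GrahamCorC :=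
  hundredthirtyninth_of_inputs (canon_implications₁₃₉ νtop μtop κtop) (canon_implications₁₃₈ νtop μtop κtop) (canon_implications νtop μtop κtop)
    (canon_implications₄₆ νtop μtop κtop) mokInputs_top (kmswInputs_top μtop).1

/-- BOOK SIDE, EXACT SUPPORT AS TYPED: in the book countermodel of ANY of the 24 leaves `l` (Mok and KMSW at the top; every edge of tranches 1 / 46 / 138 / 139 valid over it)
Corollary C HOLDS — no leaf of the book is load-bearing (the tranche's `c73corC_book_free`; section 140's `c138_book_cm` for Theorem B). [cite: Graham2024FJinterpolation, Cor. C, Remark 1.1.5 (bookkeeping proved here)] [claim: KalethaMinguezShinWhite2014, under-review] -/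
theorem c139_book_cm (l : LeafSupport.Leaf) :
    ¬ (LeafSupport.mkN (LeafSupport.cm l)).leaf l ∧
      Implications139 (canon₁₃₈ (LeafSupport.mkN (LeafSupport.cm l)) μtop κtop) (canon₁₃₉ (LeafSupport.mkN (LeafSupport.cm l)) μtop κtop) ∧
      (canon₁₃₉ (LeafSupport.mkN (LeafSupport.cm l)) μtop κtop).GrahamCorC :=
  ⟨(LeafSupport.countermodel l).2.2.1, canon_implications₁₃₉ _ _ _, (c138_book_cm l).2.2.1.2.2⟩

/-- MOK SIDE, EXACT SUPPORT AS TYPED: in the Mok countermodel of ANY of the 29 leaves `l` (book at the top; KMSW without its Mok import; every edge valid) Corollary C FAILS — it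
carries Mok's `Everything` at every rank through Theorem B (section 140's `c138_mok_cm`): ALL 29 Mok leaves are load-bearing. [cite: Graham2024FJinterpolation, Cor. C, Remark 1.1.5, Appendix C (bookkeeping proved here)] [claim: KalethaMinguezShinWhite2014, under-review] -/
theorem c139_mok_cm (l : Mok2015.LeafSupport.Leaf) :
    ¬ (Mok2015.LeafSupport.mkN (Mok2015.LeafSupport.cm l)).leaf l ∧
      Implications139 (canon₁₃₈ νtop (Mok2015.LeafSupport.mkN (Mok2015.LeafSupport.cm l)) κnoMok) (canon₁₃₉ νtop (Mok2015.LeafSupport.mkN (Mok2015.LeafSupport.cm l)) κnoMok) ∧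
      ¬ (canon₁₃₉ νtop (Mok2015.LeafSupport.mkN (Mok2015.LeafSupport.cm l)) κnoMok).GrahamCorC :=
  ⟨(Mok2015.LeafSupport.countermodel l).2.2.1, canon_implications₁₃₉ _ _ _, (c138_mok_cm l).2.2.1.2.2⟩

/-- KMSW SIDE, EXACT SUPPORT AS TYPED: (i) with KMSW's Mok import denied (`κnoMok`: neither scope nor full statements at any rank) Corollary C FAILS (book and Mok at the top);
(ii) in KMSW's countermodel of leaf `l'` (book, Mok at the top; every edge valid) Corollary C HOLDS iff `l'` is one of the three leaves only the starred statements need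
(`AubertSS`, `KMS_A`, `KMS_B`) — the eleven proved-scope leaves are load-bearing, the sequels are not (section 140's `c138_kmsw` for Theorem B). [cite: Graham2024FJinterpolation, Cor. C, Appendix C (bookkeeping proved here)] [claim: KalethaMinguezShinWhite2014, under-review] -/
theorem c139_kmsw (l' : KMSW2014.LeafSupport.Leaf) :
    ¬ (canon₁₃₉ νtop μtop κnoMok).GrahamCorC ∧
      Implications139 (canon₁₃₈ νtop μtop (KMSW2014.LeafSupport.mkN (KMSW2014.LeafSupport.cm l'))) (canon₁₃₉ νtop μtop (KMSW2014.LeafSupport.mkN (KMSW2014.LeafSupport.cm l'))) ∧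
      ((canon₁₃₉ νtop μtop (KMSW2014.LeafSupport.mkN (KMSW2014.LeafSupport.cm l'))).GrahamCorC ↔ l'.onlyFull = true) :=
  ⟨(c138_kmsw l').1.2.1, canon_implications₁₃₉ _ _ _, (c138_kmsw l').2.2.2.1⟩

/-- THE HUNDRED-AND-THIRTY-NINTH TRANCHE REGRADED, in one statement: (i) at the top Corollary C holds; (ii) in the book countermodel of ANY of the 24 leaves it HOLDS (no book leaf
is load-bearing); (iii) in the Mok countermodel of ANY of the 29 leaves it FAILS; (iv) with KMSW's Mok import denied it FAILS, and in KMSW's countermodel of `l'` it holds iff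
`l'` ∈ {`AubertSS`, `KMS_A`, `KMS_B`}.  Support: support(`GrahamCorC`) = support(`GrahamThmB`) = all 29 Mok leaves ∧ KMSW's eleven proved-scope leaves, NO leaf of the book, no
node — row C73 is now typed in full (Proposition C.0.3, Theorem 6.2.5 / Corollary 6.2.3, Theorem B, Corollary C) with one and the same support.  In 2026 terms: conditional on Mok's
2024–2026 preprint layer and the two unwritten weighted fundamental lemmas as Mok's memoir consumes them — the row's printed Remark 1.1.5. [cite: Graham2024FJinterpolation, Cor. C, Remark 1.1.5, Appendix C (bookkeeping proved here)] [claim: KalethaMinguezShinWhite2014, under-review] -/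
theorem c139_regraded :
    (canon₁₃₉ νtop μtop κtop).GrahamCorC ∧
      (∀ l : LeafSupport.Leaf, ¬ (LeafSupport.mkN (LeafSupport.cm l)).leaf l ∧ (canon₁₃₉ (LeafSupport.mkN (LeafSupport.cm l)) μtop κtop).GrahamCorC) ∧
      (∀ l : Mok2015.LeafSupport.Leaf, ¬ (Mok2015.LeafSupport.mkN (Mok2015.LeafSupport.cm l)).leaf l ∧
        ¬ (canon₁₃₉ νtop (Mok2015.LeafSupport.mkN (Mok2015.LeafSupport.cm l)) κnoMok).GrahamCorC) ∧
      (¬ (canon₁₃₉ νtop μtop κnoMok).GrahamCorC ∧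
        ∀ l' : KMSW2014.LeafSupport.Leaf, ((canon₁₃₉ νtop μtop (KMSW2014.LeafSupport.mkN (KMSW2014.LeafSupport.cm l'))).GrahamCorC ↔ l'.onlyFull = true)) :=
  ⟨hundredthirtyninth_holds_top,
    fun l => have h := c139_book_cm l
      ⟨h.1, h.2.2⟩,
    fun l => have h := c139_mok_cm l
      ⟨h.1, h.2.2⟩,
    ⟨(c139_kmsw .MokMain).1, fun l' => (c139_kmsw l').2.2⟩⟩


/-! ## 142. Hundred-and-fortieth tranche (v5 of this file, after `Downstream39.lean` v3; unit `pub-arthur-down-g60`): supports of row C307 N. Grbac, Glas. Mat. 47(67) (2012)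
(`GrbacFrankeSiegel` = Corollary 4.2 ⇐ the book, the corollary's printed hypothesis) and of row C308 A. Saha, Forum Math. 27 (2015) (`SahaProp419` = Proposition 4.19 ⇐ its node
`SahaStrongLift` = Definition 4.18) — a reading parametrised by the node's truth value `s`; Mok's memoir and KMSW occur nowhere in the tranche. -/

section Canon140

variable (ν : Nodes) (s : Prop)

/-- The parametrised canonical reading of the hundred-and-fortieth tranche: Corollary 4.2 := the book at every rank; the node := `s`; Proposition 4.19 := its one premise, the node.
[cite: Grbac2012Franke, Cor. 4.2; Saha2015YoshidaNorms, Prop. 4.19 (canonical model; bookkeeping)] -/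
abbrev canon₁₄₀ : Consumers140 where
  GrbacFrankeSiegel := ∀ N, ν.Everything N
  SahaStrongLift := s
  SahaProp419 := s

/-- Both hundred-and-fortieth-tranche edges hold in the canonical reading, for arbitrary ν and s. [cite: Grbac2012Franke, Cor. 4.2; Saha2015YoshidaNorms, Prop. 4.19 (bookkeeping proved here)] -/
theorem canon_implications₁₄₀ : Implications140 ν (canon₁₄₀ ν s) where
  grbac := fun b => b
  saha419 := fun h => h

end Canon140

/-- At the top (every input of the book's DAG; the node granted) both statements hold — through the tranche's own `hundredfortieth_of_inputs` fed by `bookInputs_top`.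
[cite: Grbac2012Franke, Cor. 4.2; Saha2015YoshidaNorms, Prop. 4.19 (bookkeeping proved here)] -/
theorem hundredfortieth_holds_top : (canon₁₄₀ νtop True).GrbacFrankeSiegel ∧ (canon₁₄₀ νtop True).SahaProp419 :=
  hundredfortieth_of_inputs (canon_implications₁₄₀ νtop True) bookInputs_top True.intro

/-- BOOK SIDE, EXACT SUPPORTS AS TYPED: in the book countermodel of ANY of the 24 leaves `l` (the node granted; both edges valid) Corollary 4.2 FAILS (`not_B_cm`: every book leaf is
load-bearing for it) while Proposition 4.19 HOLDS (no book leaf is a premise of it). [cite: Grbac2012Franke, Cor. 4.2; Saha2015YoshidaNorms, Prop. 4.19 (bookkeeping proved here)] -/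
theorem c140_book_cm (l : LeafSupport.Leaf) :
    ¬ (LeafSupport.mkN (LeafSupport.cm l)).leaf l ∧ Implications140 (LeafSupport.mkN (LeafSupport.cm l)) (canon₁₄₀ (LeafSupport.mkN (LeafSupport.cm l)) True) ∧
      ¬ (canon₁₄₀ (LeafSupport.mkN (LeafSupport.cm l)) True).GrbacFrankeSiegel ∧ (canon₁₄₀ (LeafSupport.mkN (LeafSupport.cm l)) True).SahaProp419 :=
  ⟨(LeafSupport.countermodel l).2.2.1, canon_implications₁₄₀ _ _, not_B_cm l, True.intro⟩

/-- THE NODE IS LOAD-BEARING FOR C308 AND IRRELEVANT TO C307: with `SahaStrongLift` denied (book at the top; both edges valid) Proposition 4.19 FAILS and Corollary 4.2 HOLDS.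
[cite: Saha2015YoshidaNorms, Prop. 4.19, Def. 4.18; Grbac2012Franke, Cor. 4.2 (bookkeeping proved here)] -/
theorem c140_node_denied :
    Implications140 νtop (canon₁₄₀ νtop False) ∧ ¬ (canon₁₄₀ νtop False).SahaProp419 ∧ (canon₁₄₀ νtop False).GrbacFrankeSiegel :=
  ⟨canon_implications₁₄₀ _ _, fun h => h, bookInputs_top.everything⟩

/-- THE HUNDRED-AND-FORTIETH TRANCHE REGRADED, in one statement: (i) at the top both statements hold; (ii) in the book countermodel of ANY of the 24 leaves Corollary 4.2 FAILS and
Proposition 4.19 HOLDS; (iii) with the node denied Proposition 4.19 FAILS and Corollary 4.2 HOLDS.  Supports: support(`GrbacFrankeSiegel`) = all 24 book leaves (the seven 2024–2026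
preprint leaves and the two unwritten weighted fundamental lemmas included), nothing of Mok / KMSW, no node; support(`SahaProp419`) = its node `SahaStrongLift` only — μ and κ do not
occur in the tranche, so no Mok / KMSW countermodel statement is needed.  In 2026 terms: C307's corollary is conditional on the book's preprint layer and the two weighted lemmas (its own
2012 hypothesis); C308's proposition on an unsupplied hypothesis the text forecasts from Arthur's classification. [cite: Grbac2012Franke, Cor. 4.2; Saha2015YoshidaNorms, Prop. 4.19 (bookkeeping proved here)] -/
theorem c140_regraded :
    ((canon₁₄₀ νtop True).GrbacFrankeSiegel ∧ (canon₁₄₀ νtop True).SahaProp419) ∧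
      (∀ l : LeafSupport.Leaf, ¬ (LeafSupport.mkN (LeafSupport.cm l)).leaf l ∧ ¬ (canon₁₄₀ (LeafSupport.mkN (LeafSupport.cm l)) True).GrbacFrankeSiegel ∧
        (canon₁₄₀ (LeafSupport.mkN (LeafSupport.cm l)) True).SahaProp419) ∧
      (¬ (canon₁₄₀ νtop False).SahaProp419 ∧ (canon₁₄₀ νtop False).GrbacFrankeSiegel) :=
  ⟨hundredfortieth_holds_top,
    fun l => have h := c140_book_cm l
      ⟨h.1, h.2.2.1, h.2.2.2⟩,
    ⟨c140_node_denied.2.1, c140_node_denied.2.2⟩⟩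

/-! ## 143. Hundred-and-forty-first tranche (v6 of this file, after `Downstream39.lean` v6; unit `pub-arthur-down-g61`): supports of row C312 A. Zenteno, Math. Res. Lett. 26 (2019)
921–947 (`ZentenoRAESDC` = Theorem 7.3 ⇐ the book at every rank; `ZentenoCompatible` = Corollary 7.4 ⇐ Theorem 7.3; `ZentenoOrthGalois` = Corollary 8.3 ⇐ Corollary 7.4) — the
thesis sibling of row C171 (`Consumers64.ADSWInverseGalois`, section 67 of `DownstreamSupport7.lean`): the same exact support, all 24 leaves of the book's DAG; Mok's memoir and KMSW
occur nowhere in the tranche. -/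

section Canon141

variable (ν : Nodes)

/-- The canonical reading of the hundred-and-forty-first tranche: each of C312's three statements := the book at every rank (the value of its one chain of premises).
[cite: Zenteno2019RAESDC, Thm 7.3, Cor. 7.4, Cor. 8.3 (canonical model; bookkeeping)] -/
abbrev canon₁₄₁ : Consumers141 where
  ZentenoRAESDC := ∀ N, ν.Everything N
  ZentenoCompatible := ∀ N, ν.Everything N
  ZentenoOrthGalois := ∀ N, ν.Everything N

/-- All three hundred-and-forty-first-tranche edges hold in the canonical reading, for arbitrary ν. [cite: Zenteno2019RAESDC, Thm 7.3, Cor. 7.4, Cor. 8.3 (bookkeeping proved here)] -/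
theorem canon_implications₁₄₁ : Implications141 ν (canon₁₄₁ ν) where
  raesdc := fun b => b
  compatible := fun h => h
  orthGalois := fun h => h

end Canon141

/-- At the top (every input of the book's DAG) all three statements hold — through the tranche's own `hundredfortyfirst_of_inputs` fed by `bookInputs_top`.
[cite: Zenteno2019RAESDC, Thm 7.3, Cor. 7.4, Cor. 8.3 (bookkeeping proved here)] -/
theorem hundredfortyfirst_holds_top :
    (canon₁₄₁ νtop).ZentenoRAESDC ∧ (canon₁₄₁ νtop).ZentenoCompatible ∧ (canon₁₄₁ νtop).ZentenoOrthGalois :=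
  hundredfortyfirst_of_inputs (canon_implications₁₄₁ νtop) bookInputs_top

/-- EXACT SUPPORTS AS TYPED: in the book countermodel of ANY of the 24 leaves `l` (all three edges valid) each of C312's three statements FAILS (`not_B_cm`: every book leaf is
load-bearing for Theorem 7.3 and, through it, for Corollaries 7.4 and 8.3). [cite: Zenteno2019RAESDC, Thm 7.3, Cor. 7.4, Cor. 8.3 (bookkeeping proved here)] -/
theorem c141_book_cm (l : LeafSupport.Leaf) :
    ¬ (LeafSupport.mkN (LeafSupport.cm l)).leaf l ∧ Implications141 (LeafSupport.mkN (LeafSupport.cm l)) (canon₁₄₁ (LeafSupport.mkN (LeafSupport.cm l))) ∧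
      ¬ (canon₁₄₁ (LeafSupport.mkN (LeafSupport.cm l))).ZentenoRAESDC ∧ ¬ (canon₁₄₁ (LeafSupport.mkN (LeafSupport.cm l))).ZentenoCompatible ∧
      ¬ (canon₁₄₁ (LeafSupport.mkN (LeafSupport.cm l))).ZentenoOrthGalois :=
  ⟨(LeafSupport.countermodel l).2.2.1, canon_implications₁₄₁ _, not_B_cm l, not_B_cm l, not_B_cm l⟩

/-- THE SIBLINGS SHARE THEIR SUPPORT: in the book countermodel of any leaf `l`, C312's Theorem 7.3 (this section) and C171's theorem (section 67's `canon₆₄`, tranche 64) fail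
TOGETHER, and at the top both hold — one binder, one support. [cite: Zenteno2019RAESDC, Thm 7.3; AriasDeReynaDieulefaitShinWiese2015, Thm 3.4 (bookkeeping proved here)] -/
theorem c141_c171_same_support (l : LeafSupport.Leaf) :
    (¬ (canon₁₄₁ (LeafSupport.mkN (LeafSupport.cm l))).ZentenoRAESDC ∧ ¬ (canon₆₄ (LeafSupport.mkN (LeafSupport.cm l)) μtop κtop).ADSWInverseGalois) ∧
      ((canon₁₄₁ νtop).ZentenoRAESDC ∧ (canon₆₄ νtop μtop κtop).ADSWInverseGalois) :=
  ⟨⟨not_B_cm l, not_B_cm l⟩, ⟨bookInputs_top.everything, bookInputs_top.everything⟩⟩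

/-- THE HUNDRED-AND-FORTY-FIRST TRANCHE REGRADED, in one statement: (i) at the top all three statements hold; (ii) in the book countermodel of ANY of the 24 leaves all three FAIL.
Supports: support(`ZentenoRAESDC`) = support(`ZentenoCompatible`) = support(`ZentenoOrthGalois`) = all 24 book leaves (the seven 2024–2026 preprint leaves and the two unwritten
weighted fundamental lemmas included), nothing of Mok / KMSW, no node — μ and κ do not occur in the tranche.  In 2026 terms: C312's Galois realizations of the orthogonal groups
PΩ⁺₁₂(𝔽_ℓ^s), … are conditional on the book's preprint layer and the two weighted lemmas, exactly as row C171's symplectic ones (section 67), whose Remark 3.3 named the deferred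
references this text's Remark 7.2 leaves out. [cite: Zenteno2019RAESDC, Thm 7.3, Cor. 7.4, Cor. 8.3, Rem. 7.2 (bookkeeping proved here)] -/
theorem c141_regraded :
    ((canon₁₄₁ νtop).ZentenoRAESDC ∧ (canon₁₄₁ νtop).ZentenoCompatible ∧ (canon₁₄₁ νtop).ZentenoOrthGalois) ∧
      (∀ l : LeafSupport.Leaf, ¬ (LeafSupport.mkN (LeafSupport.cm l)).leaf l ∧ ¬ (canon₁₄₁ (LeafSupport.mkN (LeafSupport.cm l))).ZentenoRAESDC ∧
        ¬ (canon₁₄₁ (LeafSupport.mkN (LeafSupport.cm l))).ZentenoCompatible ∧ ¬ (canon₁₄₁ (LeafSupport.mkN (LeafSupport.cm l))).ZentenoOrthGalois) :=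
  ⟨hundredfortyfirst_holds_top,
    fun l => have h := c141_book_cm l
      ⟨h.1, h.2.2.1, h.2.2.2.1, h.2.2.2.2⟩⟩

/-! ## 144. Hundred-and-forty-second tranche (v6 of this file, after `Downstream39.lean` v7; unit `pub-arthur-down-g61`): supports of row C313 A. Zenteno, J. Number Theory 206 (2020)
182–193 (`ZentenoLuebeckImages` = Theorem 1.1, premise-free; `ZentenoLuebeckGalois` = Corollary 1.2 ⇐ row C312's `ZentenoCompatible` ∧ Theorem 1.1) — second order through section 143's
`canon₁₄₁`: support(`ZentenoLuebeckGalois`) = all 24 book leaves, support(`ZentenoLuebeckImages`) = ∅. -/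

section Canon142

variable (ν : Nodes)

/-- The canonical reading of the hundred-and-forty-second tranche over `canon₁₄₁ ν`: Theorem 1.1 := True (premise-free); Corollary 1.2 := the conjunction of its two premises' values.
[cite: Zenteno2020Luebeck, Thm 1.1, Cor. 1.2 (canonical model; bookkeeping)] -/
abbrev canon₁₄₂ : Consumers142 where
  ZentenoLuebeckImages := True
  ZentenoLuebeckGalois := (∀ N, ν.Everything N) ∧ True

/-- Both hundred-and-forty-second-tranche edges hold in the canonical reading over `canon₁₄₁ ν`, for arbitrary ν. [cite: Zenteno2020Luebeck, Thm 1.1, Cor. 1.2 (bookkeeping proved here)] -/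
theorem canon_implications₁₄₂ : Implications142 (canon₁₄₁ ν) (canon₁₄₂ ν) where
  images := True.intro
  galois := fun h i => ⟨h, i⟩

end Canon142

/-- At the top (every input of the book's DAG) both statements hold — through the tranche's own `hundredfortysecond_of_inputs` fed by section 143's `canon_implications₁₄₁` and `bookInputs_top`.
[cite: Zenteno2020Luebeck, Thm 1.1, Cor. 1.2 (bookkeeping proved here)] -/
theorem hundredfortysecond_holds_top : (canon₁₄₂ νtop).ZentenoLuebeckImages ∧ (canon₁₄₂ νtop).ZentenoLuebeckGalois :=
  hundredfortysecond_of_inputs (canon_implications₁₄₂ νtop) (canon_implications₁₄₁ νtop) bookInputs_top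

/-- EXACT SUPPORTS AS TYPED: in the book countermodel of ANY of the 24 leaves `l` (both edges and tranche 141's valid) Corollary 1.2 FAILS — through row C312's Corollary 7.4 — while
Theorem 1.1 HOLDS (premise-free). [cite: Zenteno2020Luebeck, Thm 1.1, Cor. 1.2; Zenteno2019RAESDC, Cor. 7.4 (bookkeeping proved here)] -/
theorem c142_book_cm (l : LeafSupport.Leaf) :
    ¬ (LeafSupport.mkN (LeafSupport.cm l)).leaf l ∧ Implications142 (canon₁₄₁ (LeafSupport.mkN (LeafSupport.cm l))) (canon₁₄₂ (LeafSupport.mkN (LeafSupport.cm l))) ∧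
      ¬ (canon₁₄₂ (LeafSupport.mkN (LeafSupport.cm l))).ZentenoLuebeckGalois ∧ (canon₁₄₂ (LeafSupport.mkN (LeafSupport.cm l))).ZentenoLuebeckImages :=
  ⟨(LeafSupport.countermodel l).2.2.1, canon_implications₁₄₂ _, fun h => not_B_cm l h.1, True.intro⟩

/-- THE HUNDRED-AND-FORTY-SECOND TRANCHE REGRADED, in one statement: (i) at the top both statements hold; (ii) in the book countermodel of ANY of the 24 leaves Corollary 1.2 FAILS and
Theorem 1.1 HOLDS.  Supports: support(`ZentenoLuebeckGalois`) = all 24 book leaves (the seven 2024–2026 preprint leaves and the two unwritten weighted fundamental lemmas included) —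
inherited ENTIRELY through row C312, the paper itself citing none of the three classifications; support(`ZentenoLuebeckImages`) = ∅; nothing of Mok / KMSW (μ, κ do not occur).  In
2026 terms: the Galois realizations of PΩ±_n(𝔽_ℓ^s), …, n = 4ϖ with 17 ≤ ϖ ≤ 73, are conditional on the book's preprint layer and the two weighted lemmas, with no sentence in the
paper saying so (second-order silence; the supplier's Remark 7.2 is the only flag on the chain). [cite: Zenteno2020Luebeck, Thm 1.1, Cor. 1.2 (bookkeeping proved here)] -/
theorem c142_regraded :
    ((canon₁₄₂ νtop).ZentenoLuebeckImages ∧ (canon₁₄₂ νtop).ZentenoLuebeckGalois) ∧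
      (∀ l : LeafSupport.Leaf, ¬ (LeafSupport.mkN (LeafSupport.cm l)).leaf l ∧ ¬ (canon₁₄₂ (LeafSupport.mkN (LeafSupport.cm l))).ZentenoLuebeckGalois ∧
        (canon₁₄₂ (LeafSupport.mkN (LeafSupport.cm l))).ZentenoLuebeckImages) :=
  ⟨hundredfortysecond_holds_top,
    fun l => have h := c142_book_cm l
      ⟨h.1, h.2.2.1, h.2.2.2⟩⟩

/-! ## 145. Hundred-and-forty-third tranche (v6 of this file, after `Downstream39.lean` v8; unit `pub-arthur-down-g61`): support of class row B82's member row B127, M. Hanzer, *On the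
cuspidal support of a generic representation*, J. Lie Theory 28 (2018) no. 1, 71–78 (`HanzerGenericSupp` = Theorem 2.4 ⇐ the book at every rank ∧ row B75's statements
`Consumers45.MoeglinMult1` ∧ the Mœglin – Tadić classification `Consumers51.MoeglinTadicDS`), read over section 48's `canon₄₅` / `canon₄₅noR` and section 54's `canon₅₁`:
support(`HanzerGenericSupp`) = all 24 book leaves ∧ B75's node — the residue of the class-B82 members with a B75 locator (sections 55 / 131 / 134) —, nothing of Mok / KMSW. -/

section Canon143

variable (ν : Nodes)

/-- The parametrised canonical reading of the hundred-and-forty-third tranche over assignments `c₄₅`, `c₅₁` of tranches 45 / 51: Theorem 2.4 := the conjunction of the values of its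
three premises (the book at every rank, B75's multiplicity one, the classification). [cite: Hanzer2018CuspidalSupport, Thm 2.4 (canonical model; bookkeeping)] -/
abbrev canon₁₄₃W (c₄₅ : Consumers45) (c₅₁ : Consumers51) : Consumers143 where
  HanzerGenericSupp := (∀ N, ν.Everything N) ∧ c₄₅.MoeglinMult1 ∧ c₅₁.MoeglinTadicDS

/-- The canonical instance: over section 48's `canon₄₅` (B75's « hypothèse générale » GRANTED) and section 54's `canon₅₁` (Gan – Lomeli granted, (BA) := the book).
[cite: Hanzer2018CuspidalSupport, Thm 2.4 (canonical model; bookkeeping)] -/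
abbrev canon₁₄₃ : Consumers143 := canon₁₄₃W ν (canon₄₅ ν) (canon₅₁ ν)

/-- B75's NODE DENIED: over section 48's `canon₄₅noR` (Mœglin's « hypothèse générale » false, so B75's multiplicity one carries the conjunct `False`), tranche 51 canonical.
[cite: Hanzer2018CuspidalSupport, Thm 2.4 with Moeglin2011Mult1, §1 (separating model; bookkeeping)] -/
abbrev canon₁₄₃noR : Consumers143 := canon₁₄₃W ν (canon₄₅noR ν) (canon₅₁ ν)

/-- The hundred-and-forty-third-tranche edge holds in the parametrised reading over ANY assignments of tranches 45 / 51, for arbitrary ν. [cite: Hanzer2018CuspidalSupport, Thm 2.4 (bookkeeping proved here)] -/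
theorem canon_implications₁₄₃W (c₄₅ : Consumers45) (c₅₁ : Consumers51) : Implications143 ν c₄₅ c₅₁ (canon₁₄₃W ν c₄₅ c₅₁) where
  hanzer := fun b m d => ⟨b, m, d⟩

/-- The edge holds in the canonical instance. [cite: Hanzer2018CuspidalSupport, Thm 2.4 (bookkeeping proved here)] -/
theorem canon_implications₁₄₃ : Implications143 ν (canon₄₅ ν) (canon₅₁ ν) (canon₁₄₃ ν) :=
  canon_implications₁₄₃W ν _ _

/-- The edge holds over the node-denied `canon₄₅noR`. [cite: Hanzer2018CuspidalSupport, Thm 2.4 (bookkeeping proved here)] -/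
theorem canon_implications₁₄₃noR : Implications143 ν (canon₄₅noR ν) (canon₅₁ ν) (canon₁₄₃noR ν) :=
  canon_implications₁₄₃W ν _ _

/-- Tranche 51's seven edges also hold over section 48's node-denied `canon₄₅noR` with section 54's `canon₅₁` — the one tranche-45 value they receive (E43's `MoeglinUnitaryDS`, in
`E_BasicAssumption13`) is the same in both tranche-45 readings and is ignored by (BA) := the book. [cite: MoeglinTadic2002DS, §2 (BA); Tadic2013Tempered, Remark 2.2 (bookkeeping proved here)] -/
theorem canon_implications₅₁noR : Implications51 ν (canon₄₅noR ν) (canon₅₀ ν) (canon₅₁ ν) where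
  ba := fun b _ _ => b
  ba13 := fun b _ => b
  mtds := fun b => b
  tadic := fun b _ => b
  matic16 := fun d => d
  matic19 := fun b _ => b
  matic24 := fun d => d

end Canon143

/-- At the top (every input of the book's DAG; Gan – Lomeli's node and B75's remainder granted by the readings) Theorem 2.4 holds — through the tranche's own `hundredfortythird_of_inputs`
fed by `canon_implications₁₄₃`, section 54's `canon_implications₅₁`, `canon_implications₅₀`, `canon_implications₁₄`, `bookInputs_top`, the grant of `GanLomeliBA` and B75's multiplicity
one from section 48's `fortyfifth_holds_top`. [cite: Hanzer2018CuspidalSupport, Thm 2.4 (bookkeeping proved here)] -/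
theorem hundredfortythird_holds_top : (canon₁₄₃ νtop).HanzerGenericSupp :=
  hundredfortythird_of_inputs (canon_implications₁₄₃ νtop) (canon_implications₅₁ νtop) (canon_implications₅₀ νtop) (canon_implications₁₄ νtop) bookInputs_top True.intro
    fortyfifth_holds_top.2.2.1

/-- B75's NODE, for EVERY assignment of the three DAGs: with Mœglin's « hypothèse générale » denied (section 48's `canon₄₅noR` with its companions `c₄₃noM` / `c₄₄noM`) Theorem 2.4
FAILS, every edge of tranches 45 / 51 / 143 valid in that reading. [cite: Hanzer2018CuspidalSupport, Thm 2.4 with Moeglin2011Mult1, §1 (separating model; bookkeeping proved here)] -/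
theorem c143_node (ν : Nodes) (μ : Mok2015.Nodes) (κ : KMSW2014.Nodes) :
    Implications143 ν (canon₄₅noR ν) (canon₅₁ ν) (canon₁₄₃noR ν) ∧ Implications51 ν (canon₄₅noR ν) (canon₅₀ ν) (canon₅₁ ν) ∧
      Implications45 ν μ κ (canon₁₃ ν κ) (canon₁₄ ν) (c₄₃noM ν μ κ) (c₄₄noM ν μ κ) (canon₄₅noR ν) ∧ ¬ (canon₁₄₃noR ν).HanzerGenericSupp :=
  ⟨canon_implications₁₄₃noR ν, canon_implications₅₁noR ν, canon_implications₄₅noR ν μ κ, fun h => h.2.1.2⟩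

/-- BOOK SIDE, EXACT SUPPORT AS TYPED — in the book countermodel of ANY of the 24 leaves `l` (B75's remainder and Gan – Lomeli granted; every edge of tranches 51 / 143 valid): Theorem
2.4 FAILS through its own book premise (« By the work of Arthur », all ranks) — and therefore for ANY readings `c₄₅`, `c₅₁` of tranches 45 / 51 whatsoever, B75's value and the
classification adding nothing to and removing nothing from the support. [cite: Hanzer2018CuspidalSupport, Thm 2.4 (bookkeeping proved here)] -/
theorem c143_book_cm (l : LeafSupport.Leaf) :
    ¬ (LeafSupport.mkN (LeafSupport.cm l)).leaf l ∧
      Implications143 (LeafSupport.mkN (LeafSupport.cm l)) (canon₄₅ (LeafSupport.mkN (LeafSupport.cm l))) (canon₅₁ (LeafSupport.mkN (LeafSupport.cm l)))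
        (canon₁₄₃ (LeafSupport.mkN (LeafSupport.cm l))) ∧
      Implications51 (LeafSupport.mkN (LeafSupport.cm l)) (canon₄₅ (LeafSupport.mkN (LeafSupport.cm l))) (canon₅₀ (LeafSupport.mkN (LeafSupport.cm l)))
        (canon₅₁ (LeafSupport.mkN (LeafSupport.cm l))) ∧
      ¬ (canon₁₄₃ (LeafSupport.mkN (LeafSupport.cm l))).HanzerGenericSupp ∧
      (∀ (c₄₅ : Consumers45) (c₅₁ : Consumers51),
        Implications143 (LeafSupport.mkN (LeafSupport.cm l)) c₄₅ c₅₁ (canon₁₄₃W (LeafSupport.mkN (LeafSupport.cm l)) c₄₅ c₅₁) ∧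
          ¬ (canon₁₄₃W (LeafSupport.mkN (LeafSupport.cm l)) c₄₅ c₅₁).HanzerGenericSupp) :=
  have n := not_B_cm l
  ⟨(LeafSupport.countermodel l).2.2.1, canon_implications₁₄₃ _, canon_implications₅₁ _, fun h => n h.1,
    fun c₄₅ c₅₁ => ⟨canon_implications₁₄₃W _ c₄₅ c₅₁, fun h => n h.1⟩⟩

/-- THE PREPRINT LEAVES AND THE WEIGHTED LEMMAS: on each of the seven 2024–2026 preprint leaves E41's Théorème 3.1.1 — tranche 50's input to the (BA) line — HOLDS (section 54's
`baLine_open_leaves`) while Theorem 2.4 FAILS; on the two unwritten weighted fundamental lemmas E41 FAILS as well. [cite: Hanzer2018CuspidalSupport, Thm 2.4; Moeglin2014Stable, Théorème 3.1.1 (bookkeeping proved here)] -/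
theorem c143_open_and_weighted_leaves (l : LeafSupport.Leaf) :
    ((l = .AGIKMS_181 ∨ l = .AGIKMS_191 ∨ l = .AGIKMS_1105 ∨ l = .AGIKMS_D21 ∨ l = .AGIKMS_AppE ∨ l = .KM26 ∨ l = .CK26) →
        (canon₅₀ (LeafSupport.mkN (LeafSupport.cm l))).MoeglinHalfInt ∧ ¬ (canon₁₄₃ (LeafSupport.mkN (LeafSupport.cm l))).HanzerGenericSupp) ∧
      ((l = .WFL_general ∨ l = .WFL_nonstandard) →
        ¬ (canon₅₀ (LeafSupport.mkN (LeafSupport.cm l))).MoeglinHalfInt ∧ ¬ (canon₁₄₃ (LeafSupport.mkN (LeafSupport.cm l))).HanzerGenericSupp) :=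
  have n := not_B_cm l
  ⟨fun hl => ⟨(baLine_open_leaves l hl).2.2.1.1, fun h => n h.1⟩, fun hl => ⟨(baLine_weighted_leaves l hl).2.2.1.1, fun h => n h.1⟩⟩

/-- MOK and KMSW SIDES: in the Mok countermodel of ANY of the 29 leaves and in KMSW's countermodel of ANY leaf (book at the top) the edge holds and Theorem 2.4 HOLDS — no Mok / KMSW
premise anywhere in the tranche (for the quasi-split unitary groups among the paper's G_n the parameters are taken from Gan – Gross – Prasad's Proposition 7.3, not from Mok's memoir).
[cite: Hanzer2018CuspidalSupport, Thm 2.4, §1.1 (bookkeeping proved here)] [claim: KalethaMinguezShinWhite2014, under-review] -/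
theorem c143_mok_kmsw (l : Mok2015.LeafSupport.Leaf) (l' : KMSW2014.LeafSupport.Leaf) :
    ¬ (Mok2015.LeafSupport.mkN (Mok2015.LeafSupport.cm l)).leaf l ∧ ¬ (KMSW2014.LeafSupport.mkN (KMSW2014.LeafSupport.cm l')).leaf l' ∧
      Implications143 νtop (canon₄₅ νtop) (canon₅₁ νtop) (canon₁₄₃ νtop) ∧ (canon₁₄₃ νtop).HanzerGenericSupp :=
  ⟨(Mok2015.LeafSupport.countermodel l).2.2.1, (KMSW2014.LeafSupport.countermodel l').2.2.1, canon_implications₁₄₃ _, hundredfortythird_holds_top⟩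

/-- THE HUNDRED-AND-FORTY-THIRD TRANCHE REGRADED, in one statement: (i) at the top Theorem 2.4 holds; (ii) with B75's « hypothèse générale » denied it fails for every assignment; (iii)
in the book countermodel of ANY of the 24 leaves it fails — for any readings of tranches 45 / 51 —, E41 holding on the seven preprint leaves and failing on the two weighted lemmas;
(iv) Mok / KMSW countermodels change nothing.  Support: support(`HanzerGenericSupp`) = all 24 book leaves (the seven 2024–2026 preprint leaves and the two unwritten weighted
fundamental lemmas included) ∧ B75's node; nothing of Mok / KMSW.  In 2026 terms: the statement that the generic member of a discrete L-packet of a quasi-split p-adic classical group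
has the smallest cuspidal support in its packet is, as derived, conditional on the book's preprint layer, on the two weighted lemmas and on Mœglin's « hypothèse générale » beyond
its quasi-split instance, with no sentence in the paper saying so. [cite: Hanzer2018CuspidalSupport, Thm 2.4 (bookkeeping proved here)] [claim: KalethaMinguezShinWhite2014, under-review] -/
theorem c143_regraded :
    (canon₁₄₃ νtop).HanzerGenericSupp ∧
      (∀ (ν : Nodes) (μ : Mok2015.Nodes) (κ : KMSW2014.Nodes),
        Implications45 ν μ κ (canon₁₃ ν κ) (canon₁₄ ν) (c₄₃noM ν μ κ) (c₄₄noM ν μ κ) (canon₄₅noR ν) ∧ ¬ (canon₁₄₃noR ν).HanzerGenericSupp) ∧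
      (∀ l : LeafSupport.Leaf, ¬ (LeafSupport.mkN (LeafSupport.cm l)).leaf l ∧ ¬ (canon₁₄₃ (LeafSupport.mkN (LeafSupport.cm l))).HanzerGenericSupp ∧
        ∀ (c₄₅ : Consumers45) (c₅₁ : Consumers51), ¬ (canon₁₄₃W (LeafSupport.mkN (LeafSupport.cm l)) c₄₅ c₅₁).HanzerGenericSupp) ∧
      (∀ l : LeafSupport.Leaf, (l = .AGIKMS_181 ∨ l = .AGIKMS_191 ∨ l = .AGIKMS_1105 ∨ l = .AGIKMS_D21 ∨ l = .AGIKMS_AppE ∨ l = .KM26 ∨ l = .CK26) →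
        (canon₅₀ (LeafSupport.mkN (LeafSupport.cm l))).MoeglinHalfInt ∧ ¬ (canon₁₄₃ (LeafSupport.mkN (LeafSupport.cm l))).HanzerGenericSupp) ∧
      (∀ (l : Mok2015.LeafSupport.Leaf) (l' : KMSW2014.LeafSupport.Leaf), ¬ (Mok2015.LeafSupport.mkN (Mok2015.LeafSupport.cm l)).leaf l ∧
        ¬ (KMSW2014.LeafSupport.mkN (KMSW2014.LeafSupport.cm l')).leaf l' ∧ (canon₁₄₃ νtop).HanzerGenericSupp) :=
  ⟨hundredfortythird_holds_top,
    fun ν μ κ => have h := c143_node ν μ κ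
      ⟨h.2.2.1, h.2.2.2⟩,
    fun l => have h := c143_book_cm l
      ⟨h.1, h.2.2.2.1, fun c₄₅ c₅₁ => (h.2.2.2.2 c₄₅ c₅₁).2⟩,
    fun l hl => (c143_open_and_weighted_leaves l).1 hl,
    fun l l' => have h := c143_mok_kmsw l l'
      ⟨h.1, h.2.1, h.2.2.2⟩⟩

/-! ## 146. Hundred-and-forty-fourth tranche (v7 of this file, after the NEW `Downstream40.lean` v1 = p402629; unit `pub-arthur-down-g62`): supports of row C170 M. Furusawa – K. Martin, *Local root
numbers, Bessel models, and a conj. of Guo and Jacquet*, J. Number Theory 146 (2015) 150–170 (`FMGJThm4` / `FMGJThm7` / `FMGJThm8` premise-free; `FMGJCor5` ⇐ Theorem 4 ∧ the node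
`LocalGPSO5SO2`, itself ⇐ the free node `GPStandardHyps`; `FMSimpleRTF` (= the results of [7], control E53) ⇐ `GPStandardHyps` ∧ `Nodes.StabTw`; `FMGJCor6` ⇐ Theorem 4 ∧ `FMSimpleRTF` ∧
`GPStandardHyps` ∧ `Nodes.StabTw`), read over a truth value of the free node: support(Theorems 4 / 7 / 8) = ∅; support(`LocalGPSO5SO2`) = support(`FMGJCor5`) = the node, NO book leaf;
support(`FMSimpleRTF`) = support(`FMGJCor6`) = the node ∧ the SIX book leaves under `StabTw` (section 21's `LeafSupport.Leaf.stabTwB` of `DownstreamSupport2.lean`: FL, [W4] Thm 3.8, the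
twisted trace formula, Mœglin – Waldspurger's stabilisation, the general and the non-standard weighted fundamental lemmas) — leaf for leaf the support of row B94's Hypothesis 3.2 (a)
(section 21's `cghyp_support`), holding on each of the seven 2024–2026 preprint leaves and failing on the two unwritten weighted lemmas; nothing of Mok / KMSW. -/

section Canon144

variable (ν : Nodes)

/-- The parametrised canonical reading of the hundred-and-forty-fourth tranche over a truth value `g` of the free node `GPStandardHyps` (the hypotheses of [35], [27] as the authors admit
them): the three premise-free theorems := `True`; every other field := the conjunction of the values of its premises along the tranche's edges (`LocalGPSO5SO2` := g; Corollary 5 :=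
True ∧ g; [7] := g ∧ `StabTw`; Corollary 6 := True ∧ (g ∧ `StabTw`) ∧ g ∧ `StabTw`). [cite: FurusawaMartin2015GuoJacquet, Thms 4, 7, 8, Cors 5, 6 (canonical model; bookkeeping)] -/
abbrev canon₁₄₄W (g : Prop) : Consumers144 where
  FMGJThm4 := True
  FMGJCor5 := True ∧ g
  FMGJCor6 := True ∧ (g ∧ ν.StabTw) ∧ g ∧ ν.StabTw
  FMGJThm7 := True
  FMGJThm8 := True
  LocalGPSO5SO2 := g
  GPStandardHyps := g
  FMSimpleRTF := g ∧ ν.StabTw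

/-- The canonical instance: the free node GRANTED. [cite: FurusawaMartin2015GuoJacquet, Cors 5, 6 (canonical model; bookkeeping)] -/
abbrev canon₁₄₄ : Consumers144 := canon₁₄₄W ν True

/-- The free node DENIED (the hypotheses of [35], [27] false). [cite: FurusawaMartin2015GuoJacquet, p. 4 (separating model; bookkeeping)] -/
abbrev canon₁₄₄no : Consumers144 := canon₁₄₄W ν False

/-- All seven hundred-and-forty-fourth-tranche edges hold in the parametrised reading, for arbitrary ν and g. [cite: FurusawaMartin2015GuoJacquet, Thms 4, 7, 8, Cors 5, 6 (bookkeeping proved here)] -/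
theorem canon_implications₁₄₄W (g : Prop) : Implications144 ν (canon₁₄₄W ν g) where
  thm4 := trivial
  thm7 := trivial
  thm8 := trivial
  localGP := fun h => h
  cor5 := fun a b => ⟨a, b⟩
  fm7 := fun a b => ⟨a, b⟩
  cor6 := fun a b c d => ⟨a, b, c, d⟩

/-- The edges hold in the canonical instance. [cite: FurusawaMartin2015GuoJacquet, Cors 5, 6 (bookkeeping proved here)] -/
theorem canon_implications₁₄₄ : Implications144 ν (canon₁₄₄ ν) := canon_implications₁₄₄W ν True

/-- The edges hold in the node-denied reading. [cite: FurusawaMartin2015GuoJacquet, Cors 5, 6 (bookkeeping proved here)] -/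
theorem canon_implications₁₄₄no : Implications144 ν (canon₁₄₄no ν) := canon_implications₁₄₄W ν False

end Canon144

/-- At the top (every input of the book's DAG, the free node granted) all five typed statements and the two dependent nodes hold — through the tranche's own `hundredfortyfourth_of_inputs`
fed by `canon_implications₁₄₄` and `bookInputs_top`. [cite: FurusawaMartin2015GuoJacquet, Thms 4, 7, 8, Cors 5, 6 (bookkeeping proved here)] -/
theorem hundredfortyfourth_holds_top :
    (canon₁₄₄ νtop).FMGJThm4 ∧ (canon₁₄₄ νtop).FMGJThm7 ∧ (canon₁₄₄ νtop).FMGJThm8 ∧ (canon₁₄₄ νtop).LocalGPSO5SO2 ∧ (canon₁₄₄ νtop).FMGJCor5 ∧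
      (canon₁₄₄ νtop).FMSimpleRTF ∧ (canon₁₄₄ νtop).FMGJCor6 :=
  hundredfortyfourth_of_inputs (canon_implications₁₄₄ νtop) bookInputs_top True.intro

/-- THE FREE NODE, for EVERY assignment of the book's DAG (in particular with every book leaf and every book edge holding): with the hypotheses of [35], [27] denied, all seven edges valid,
Theorems 4, 7, 8 HOLD while the local node, Corollary 5, [7]'s results and Corollary 6 FAIL — the node is load-bearing for both corollaries and nothing the book delivers replaces it.
[cite: FurusawaMartin2015GuoJacquet, p. 4 (« implicitly assume certain not- yet-proven (but likely soon to be) results ») (separating model; bookkeeping proved here)] -/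
theorem c144_node (ν : Nodes) :
    Implications144 ν (canon₁₄₄no ν) ∧ ((canon₁₄₄no ν).FMGJThm4 ∧ (canon₁₄₄no ν).FMGJThm7 ∧ (canon₁₄₄no ν).FMGJThm8) ∧
      ¬ (canon₁₄₄no ν).LocalGPSO5SO2 ∧ ¬ (canon₁₄₄no ν).FMGJCor5 ∧ ¬ (canon₁₄₄no ν).FMSimpleRTF ∧ ¬ (canon₁₄₄no ν).FMGJCor6 :=
  ⟨canon_implications₁₄₄no ν, ⟨trivial, trivial, trivial⟩, id, fun h => h.2, fun h => h.1, fun h => h.2.2.1⟩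

/-- COROLLARY 6, TWO-SIDED BOOK SUPPORT AS TYPED: in the book countermodel of leaf `l` (free node granted) Corollary 6 HOLDS exactly when `l` is none of the six leaves under `StabTw` —
section 21's `cghyp_support` read through the tranche's premise `Nodes.StabTw` (the same bit of the carver's least model). [cite: FurusawaMartin2015GuoJacquet, Cor. 6 with p0004:L39-43; Arthur2013, Hyp. 3.2.1 (bookkeeping proved here: two-sided support)] -/
theorem c144_cor6_support (l : LeafSupport.Leaf) : (canon₁₄₄ (LeafSupport.mkN (LeafSupport.cm l))).FMGJCor6 ↔ l.stabTwB = false :=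
  have e : (LeafSupport.mkN (LeafSupport.cm l)).StabTw ↔ l.stabTwB = false := cghyp_support l
  ⟨fun h => e.1 h.2.2.2, fun h => ⟨trivial, ⟨trivial, e.2 h⟩, trivial, e.2 h⟩⟩

/-- [7]'s RESULTS AS THIS TEXT INVOKES THEM, TWO-SIDED: the node `FMSimpleRTF` has the same six-leaf book support (its supplier edge carries `StabTw`). [cite: FurusawaMartin2015GuoJacquet, p0004:L39-41 (bookkeeping proved here: two-sided support)] -/
theorem c144_fm7_support (l : LeafSupport.Leaf) : (canon₁₄₄ (LeafSupport.mkN (LeafSupport.cm l))).FMSimpleRTF ↔ l.stabTwB = false :=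
  have e : (LeafSupport.mkN (LeafSupport.cm l)).StabTw ↔ l.stabTwB = false := cghyp_support l
  ⟨fun h => e.1 h.2, fun h => ⟨trivial, e.2 h⟩⟩

/-- ONE HYPOTHESIS, TWO ROWS: in every book countermodel Corollary 6 (this tranche, node granted) and row B94's Hypotheses 3.2 node (section 21's `canon₁₇`, Chapter-9 leaf granted) hold or
fail TOGETHER — both rows take over the book's standing hypothesis [Ar, Hyp. 3.2.1] and nothing else of its leaf list decides them. [cite: FurusawaMartin2015GuoJacquet, Cor. 6; ChoiyGoldberg2016, Hypotheses 3.2 (a) (bookkeeping proved here)] -/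
theorem c144_cor6_iff_B94hyp (l : LeafSupport.Leaf) :
    (canon₁₄₄ (LeafSupport.mkN (LeafSupport.cm l))).FMGJCor6 ↔ (canon₁₇ (LeafSupport.mkN (LeafSupport.cm l))).CGhyp :=
  (c144_cor6_support l).trans (cghyp_support l).symm

/-- BOOK SIDE, leaf by leaf (free node granted; all seven edges valid in the countermodel of ANY of the 24 leaves `l`): Theorems 4, 7, 8, the local node and Corollary 5 HOLD for every `l`
— no book leaf is load-bearing for them —, while Corollary 6 and [7]'s node hold exactly off the six `StabTw` leaves. [cite: FurusawaMartin2015GuoJacquet, Thms 4, 7, 8, Cors 5, 6 (bookkeeping proved here)] -/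
theorem c144_book_cm (l : LeafSupport.Leaf) :
    ¬ (LeafSupport.mkN (LeafSupport.cm l)).leaf l ∧ Implications144 (LeafSupport.mkN (LeafSupport.cm l)) (canon₁₄₄ (LeafSupport.mkN (LeafSupport.cm l))) ∧
      ((canon₁₄₄ (LeafSupport.mkN (LeafSupport.cm l))).FMGJThm4 ∧ (canon₁₄₄ (LeafSupport.mkN (LeafSupport.cm l))).FMGJThm7 ∧ (canon₁₄₄ (LeafSupport.mkN (LeafSupport.cm l))).FMGJThm8 ∧
        (canon₁₄₄ (LeafSupport.mkN (LeafSupport.cm l))).LocalGPSO5SO2 ∧ (canon₁₄₄ (LeafSupport.mkN (LeafSupport.cm l))).FMGJCor5) ∧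
      ((canon₁₄₄ (LeafSupport.mkN (LeafSupport.cm l))).FMGJCor6 ↔ l.stabTwB = false) ∧ ((canon₁₄₄ (LeafSupport.mkN (LeafSupport.cm l))).FMSimpleRTF ↔ l.stabTwB = false) :=
  ⟨(LeafSupport.countermodel l).2.2.1, canon_implications₁₄₄ _, ⟨trivial, trivial, trivial, trivial, ⟨trivial, trivial⟩⟩, c144_cor6_support l, c144_fm7_support l⟩

/-- THE SIX LEAVES: on FL, [W4] Thm 3.8, the twisted trace formula, Mœglin – Waldspurger's stabilisation and the two unwritten weighted fundamental lemmas Corollary 6 and [7]'s node FAIL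
(Corollary 5 still holding) — in 2026 terms the first four are PUBLISHED, so the live book-side residue of Corollary 6 is the general and the non-standard weighted fundamental lemma.
[cite: FurusawaMartin2015GuoJacquet, Cor. 6; AGIKMS2024 l.986-990 (status of the weighted lemmas) (bookkeeping proved here)] -/
theorem c144_stabTw_leaves (l : LeafSupport.Leaf) (hl : l.stabTwB = true) :
    ¬ (canon₁₄₄ (LeafSupport.mkN (LeafSupport.cm l))).FMGJCor6 ∧ ¬ (canon₁₄₄ (LeafSupport.mkN (LeafSupport.cm l))).FMSimpleRTF ∧ (canon₁₄₄ (LeafSupport.mkN (LeafSupport.cm l))).FMGJCor5 :=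
  ⟨fun h => Bool.false_ne_true (((c144_cor6_support l).1 h).symm.trans hl), fun h => Bool.false_ne_true (((c144_fm7_support l).1 h).symm.trans hl), ⟨trivial, trivial⟩⟩

/-- THE OTHER EIGHTEEN LEAVES, among them ALL SEVEN 2024–2026 PREPRINT LEAVES (AGIKMS Thms 1.8.1 / 1.9.1 / 1.10.5, D.2.1, App. E, [KM26], [CK26]) and the deferred-reference suppliers: there
Corollary 6 HOLDS in the book countermodel — the authors named the stabilisation hypothesis of [1], not its classification, and the register's support follows the text.
[cite: FurusawaMartin2015GuoJacquet, Cor. 6 with p0004:L39-43 (bookkeeping proved here)] -/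
theorem c144_preprint_leaves (l : LeafSupport.Leaf)
    (hl : l = .AGIKMS_181 ∨ l = .AGIKMS_191 ∨ l = .AGIKMS_1105 ∨ l = .AGIKMS_D21 ∨ l = .AGIKMS_AppE ∨ l = .KM26 ∨ l = .CK26) :
    ¬ (LeafSupport.mkN (LeafSupport.cm l)).leaf l ∧ (canon₁₄₄ (LeafSupport.mkN (LeafSupport.cm l))).FMGJCor6 :=
  ⟨(LeafSupport.countermodel l).2.2.1,
    (c144_cor6_support l).2 (by rcases hl with h | h | h | h | h | h | h <;> subst h <;> decide)⟩

/-- MOK and KMSW SIDES: in the Mok countermodel of ANY of the 29 leaves and in KMSW's countermodel of ANY leaf (book at the top, node granted) the edges hold and everything HOLDS — no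
unitary group occurs in the paper. [cite: FurusawaMartin2015GuoJacquet, Thms 4, 7, 8, Cors 5, 6 (bookkeeping proved here)] [claim: KalethaMinguezShinWhite2014, under-review] -/
theorem c144_mok_kmsw (l : Mok2015.LeafSupport.Leaf) (l' : KMSW2014.LeafSupport.Leaf) :
    ¬ (Mok2015.LeafSupport.mkN (Mok2015.LeafSupport.cm l)).leaf l ∧ ¬ (KMSW2014.LeafSupport.mkN (KMSW2014.LeafSupport.cm l')).leaf l' ∧
      Implications144 νtop (canon₁₄₄ νtop) ∧ (canon₁₄₄ νtop).FMGJCor5 ∧ (canon₁₄₄ νtop).FMGJCor6 :=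
  ⟨(Mok2015.LeafSupport.countermodel l).2.2.1, (KMSW2014.LeafSupport.countermodel l').2.2.1, canon_implications₁₄₄ _, hundredfortyfourth_holds_top.2.2.2.2.1,
    hundredfortyfourth_holds_top.2.2.2.2.2.2⟩

/-- THE HUNDRED-AND-FORTY-FOURTH TRANCHE REGRADED, in one statement: (i) at the top everything holds; (ii) with the free node denied (any ν) Theorems 4 / 7 / 8 hold and Corollaries 5 / 6 fail;
(iii) in the book countermodel of ANY of the 24 leaves Corollary 5 holds, and Corollary 6 holds exactly off the six `StabTw` leaves — on the seven preprint leaves in particular — and fails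
on the two unwritten weighted lemmas; (iv) Mok / KMSW countermodels change nothing.  Supports: support(`FMGJThm4`) = support(`FMGJThm7`) = support(`FMGJThm8`) = ∅; support(`FMGJCor5`) =
the node `GPStandardHyps`; support(`FMGJCor6`) = the node ∧ {FL, W4_Thm38, TwistedTF, MW_Stab, WFL_general, WFL_nonstandard}.  In 2026 terms: as its authors derived it, Corollary 6 is
conditional on the hypotheses of [35], [27] and — on the book's side — on exactly the two unwritten weighted fundamental lemmas (Mœglin – Waldspurger's published volumes having reduced
the stabilisation hypothesis of [1] to them), not on the 2024–2026 preprint layer. [cite: FurusawaMartin2015GuoJacquet, Thms 4, 7, 8, Cors 5, 6 (bookkeeping proved here)] [claim: KalethaMinguezShinWhite2014, under-review] -/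
theorem c144_regraded :
    ((canon₁₄₄ νtop).FMGJThm4 ∧ (canon₁₄₄ νtop).FMGJThm7 ∧ (canon₁₄₄ νtop).FMGJThm8 ∧ (canon₁₄₄ νtop).LocalGPSO5SO2 ∧ (canon₁₄₄ νtop).FMGJCor5 ∧
        (canon₁₄₄ νtop).FMSimpleRTF ∧ (canon₁₄₄ νtop).FMGJCor6) ∧
      (∀ ν : Nodes, Implications144 ν (canon₁₄₄no ν) ∧ (canon₁₄₄no ν).FMGJThm4 ∧ ¬ (canon₁₄₄no ν).FMGJCor5 ∧ ¬ (canon₁₄₄no ν).FMGJCor6) ∧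
      (∀ l : LeafSupport.Leaf, ¬ (LeafSupport.mkN (LeafSupport.cm l)).leaf l ∧ (canon₁₄₄ (LeafSupport.mkN (LeafSupport.cm l))).FMGJCor5 ∧
        ((canon₁₄₄ (LeafSupport.mkN (LeafSupport.cm l))).FMGJCor6 ↔ l.stabTwB = false)) ∧
      (∀ l : LeafSupport.Leaf, (l = .AGIKMS_181 ∨ l = .AGIKMS_191 ∨ l = .AGIKMS_1105 ∨ l = .AGIKMS_D21 ∨ l = .AGIKMS_AppE ∨ l = .KM26 ∨ l = .CK26) →
        (canon₁₄₄ (LeafSupport.mkN (LeafSupport.cm l))).FMGJCor6) ∧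
      (∀ l : LeafSupport.Leaf, (l = .WFL_general ∨ l = .WFL_nonstandard) → ¬ (canon₁₄₄ (LeafSupport.mkN (LeafSupport.cm l))).FMGJCor6) ∧
      (∀ (l : Mok2015.LeafSupport.Leaf) (l' : KMSW2014.LeafSupport.Leaf), ¬ (Mok2015.LeafSupport.mkN (Mok2015.LeafSupport.cm l)).leaf l ∧
        ¬ (KMSW2014.LeafSupport.mkN (KMSW2014.LeafSupport.cm l')).leaf l' ∧ (canon₁₄₄ νtop).FMGJCor6) :=
  ⟨hundredfortyfourth_holds_top,
    fun ν => have h := c144_node ν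
      ⟨h.1, h.2.1.1, h.2.2.2.1, h.2.2.2.2.2⟩,
    fun l => have h := c144_book_cm l
      ⟨h.1, h.2.2.1.2.2.2.2, h.2.2.2.1⟩,
    fun l hl => (c144_preprint_leaves l hl).2,
    fun l hl => (c144_stabTw_leaves l (by rcases hl with h | h <;> subst h <;> decide)).1,
    fun l l' => have h := c144_mok_kmsw l l'
      ⟨h.1, h.2.1, h.2.2.2.2⟩⟩

/-! ## 147. Hundred-and-forty-fifth tranche (v8 of this file, after `Downstream40.lean` v2; unit `pub-arthur-down-g65`): supports of row C315 B. Liu – B. Xu, Amer. J. Math. 145 (2023)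
807–859 (`LiuXuProp43` = Proposition 4.3, `LiuXuThm13` = Theorem 1.3, `LiuXuThm14` = Theorem 1.4, `LiuXuThm62` = Theorem 6.2, `LiuXuProp66` = Proposition 6.6 ⇐ the book at every rank;
`LiuXuThm15` = Theorem 1.5 = 6.8 ⇐ the book ∧ the node `FJPeriodLvalue`) — a reading parametrised by the node's truth value `p`; Mok's memoir and KMSW occur nowhere in the tranche's
edges (μ, κ enter only the parameter list of the sibling theorem `liuXu_vs_c56`). -/

section Canon145

variable (ν : Nodes) (p : Prop)

/-- The parametrised canonical reading of the hundred-and-forty-fifth tranche: the five descent statements := the book at every rank; the node := `p`; Theorem 1.5 := book ∧ `p`.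
[cite: LiuXu2023Descent, Prop. 4.3, Thms 1.3, 1.4, 6.2, Prop. 6.6, Thm 1.5 (canonical model; bookkeeping)] -/
abbrev canon₁₄₅ : Consumers145 where
  LiuXuProp43 := ∀ N, ν.Everything N
  LiuXuThm13 := ∀ N, ν.Everything N
  LiuXuThm14 := ∀ N, ν.Everything N
  LiuXuThm62 := ∀ N, ν.Everything N
  LiuXuProp66 := ∀ N, ν.Everything N
  LiuXuThm15 := (∀ N, ν.Everything N) ∧ p
  FJPeriodLvalue := p

/-- All six hundred-and-forty-fifth-tranche edges hold in the canonical reading, for arbitrary ν and p. [cite: LiuXu2023Descent, Prop. 4.3, Thms 1.3, 1.4, 6.2, Prop. 6.6, Thm 1.5 (bookkeeping proved here)] -/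
theorem canon_implications₁₄₅ : Implications145 ν (canon₁₄₅ ν p) where
  prop43 := fun b => b
  thm13 := fun b _ => b
  thm14 := fun h _ => h
  thm62 := fun h _ => h
  prop66 := fun h _ => h
  thm15 := fun b hp _ _ => ⟨b, hp⟩

end Canon145

/-- At the top (every input of the book's DAG; the node granted) all six statements hold — through the tranche's own `hundredfortyfifth_of_inputs` fed by `bookInputs_top`.
[cite: LiuXu2023Descent, Prop. 4.3, Thms 1.3, 1.4, 6.2, Prop. 6.6, Thm 1.5 (bookkeeping proved here)] -/
theorem hundredfortyfifth_holds_top :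
    (canon₁₄₅ νtop True).LiuXuProp43 ∧ (canon₁₄₅ νtop True).LiuXuThm13 ∧ (canon₁₄₅ νtop True).LiuXuThm14 ∧ (canon₁₄₅ νtop True).LiuXuThm62 ∧
      (canon₁₄₅ νtop True).LiuXuProp66 ∧ (canon₁₄₅ νtop True).LiuXuThm15 :=
  hundredfortyfifth_of_inputs (canon_implications₁₄₅ νtop True) bookInputs_top True.intro

/-- BOOK SIDE, EXACT SUPPORTS AS TYPED: in the book countermodel of ANY of the 24 leaves `l` (the node granted; all six edges valid) each of C315's six statements FAILS (`not_B_cm`: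
every book leaf is load-bearing for Proposition 4.3 and, through it, for Theorems 1.3, 1.4, 6.2, Proposition 6.6 and Theorem 1.5). [cite: LiuXu2023Descent, Prop. 4.3 (p0022:L26-28) (bookkeeping proved here)] -/
theorem c145_book_cm (l : LeafSupport.Leaf) :
    ¬ (LeafSupport.mkN (LeafSupport.cm l)).leaf l ∧ Implications145 (LeafSupport.mkN (LeafSupport.cm l)) (canon₁₄₅ (LeafSupport.mkN (LeafSupport.cm l)) True) ∧
      ¬ (canon₁₄₅ (LeafSupport.mkN (LeafSupport.cm l)) True).LiuXuProp43 ∧ ¬ (canon₁₄₅ (LeafSupport.mkN (LeafSupport.cm l)) True).LiuXuThm13 ∧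
      ¬ (canon₁₄₅ (LeafSupport.mkN (LeafSupport.cm l)) True).LiuXuThm14 ∧ ¬ (canon₁₄₅ (LeafSupport.mkN (LeafSupport.cm l)) True).LiuXuThm62 ∧
      ¬ (canon₁₄₅ (LeafSupport.mkN (LeafSupport.cm l)) True).LiuXuProp66 ∧ ¬ (canon₁₄₅ (LeafSupport.mkN (LeafSupport.cm l)) True).LiuXuThm15 :=
  have nb := not_B_cm l
  ⟨(LeafSupport.countermodel l).2.2.1, canon_implications₁₄₅ _ _, nb, nb, nb, nb, nb, fun h => nb h.1⟩

/-- THE NODE IS LOAD-BEARING FOR THEOREM 1.5 ONLY: with `FJPeriodLvalue` denied (book at the top; all six edges valid) Theorem 1.5 FAILS while the five descent statements HOLD.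
[cite: LiuXu2023Descent, Thm 6.8 with (6.8) (p0038:L26-31) (bookkeeping proved here)] -/
theorem c145_node_denied :
    Implications145 νtop (canon₁₄₅ νtop False) ∧ ¬ (canon₁₄₅ νtop False).LiuXuThm15 ∧
      ((canon₁₄₅ νtop False).LiuXuProp43 ∧ (canon₁₄₅ νtop False).LiuXuThm13 ∧ (canon₁₄₅ νtop False).LiuXuThm14 ∧ (canon₁₄₅ νtop False).LiuXuThm62 ∧
        (canon₁₄₅ νtop False).LiuXuProp66) :=
  have b : ∀ N, νtop.Everything N := bookInputs_top.everything
  ⟨canon_implications₁₄₅ _ _, fun h => h.2, ⟨b, b, b, b, b⟩⟩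

/-- THE SIBLINGS' SUPPORTS DIFFER EXACTLY BY MOK, KMSW AND CHAPTER 9: (i) with the Chapter-9 node denied (every DAG input granted; section 68's `canon₆₅noCh9`) row C56's Theorem 1.2 FAILS
while C315's Theorem 1.3 HOLDS; (ii) in the Mok countermodel of ANY of the 29 leaves (book at the top, KMSW without its import; section 68's `galoisIII_mok_cm`) C56 FAILS and C315
HOLDS — C315's reading does not mention μ or κ. [cite: LiuXu2023Descent, Thm 1.3 with p0002:L42-43; JiangLiuXu2020Reciprocal, Thm 1.2 with p0005:L27 (bookkeeping proved here)] -/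
theorem c145_vs_c56 (l : Mok2015.LeafSupport.Leaf) :
    (¬ (canon₆₅noCh9 νtop μtop).JLXReciprocal ∧ (canon₁₄₅ νtop True).LiuXuThm13) ∧
      (¬ (canon₆₅ νtop (Mok2015.LeafSupport.mkN (Mok2015.LeafSupport.cm l)) κnoMok).JLXReciprocal ∧ (canon₁₄₅ νtop True).LiuXuThm13) :=
  have b : ∀ N, νtop.Everything N := bookInputs_top.everything
  ⟨⟨jlx_needs_ch9_top.2.1, b⟩, ⟨(galoisIII_mok_cm l).2.2.2.2.2.2.2, b⟩⟩

/-- THE HUNDRED-AND-FORTY-FIFTH TRANCHE REGRADED, in one statement: (i) at the top all six statements hold; (ii) in the book countermodel of ANY of the 24 leaves all six FAIL; (iii) with the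
node denied Theorem 1.5 FAILS and the five descent statements HOLD.  Supports: support(`LiuXuProp43`) = support(`LiuXuThm13`) = support(`LiuXuThm14`) = support(`LiuXuThm62`) =
support(`LiuXuProp66`) = all 24 book leaves (the seven 2024–2026 preprint leaves and the two unwritten weighted fundamental lemmas included), no node, nothing of Mok / KMSW — row C56's
support (section 68: book ∧ Mok ∧ KMSW's scope ∧ the Chapter-9 node) MINUS everything but the book; support(`LiuXuThm15`) = the 24 leaves ∧ the node `FJPeriodLvalue`.  In 2026 terms:
the descent theorems of Amer. J. Math. 145 (2023) are conditional on the book's preprint layer and the two weighted lemmas (no sentence in the text), the quadratic-twist theorem in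
addition on the period-to-L-value input [73] / [48]. [cite: LiuXu2023Descent, Prop. 4.3, Thms 1.3, 1.4, 6.2, Prop. 6.6, Thm 1.5 = 6.8 (bookkeeping proved here)] -/
theorem c145_regraded :
    ((canon₁₄₅ νtop True).LiuXuProp43 ∧ (canon₁₄₅ νtop True).LiuXuThm13 ∧ (canon₁₄₅ νtop True).LiuXuThm14 ∧ (canon₁₄₅ νtop True).LiuXuThm62 ∧
        (canon₁₄₅ νtop True).LiuXuProp66 ∧ (canon₁₄₅ νtop True).LiuXuThm15) ∧
      (∀ l : LeafSupport.Leaf, ¬ (LeafSupport.mkN (LeafSupport.cm l)).leaf l ∧ ¬ (canon₁₄₅ (LeafSupport.mkN (LeafSupport.cm l)) True).LiuXuThm13 ∧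
        ¬ (canon₁₄₅ (LeafSupport.mkN (LeafSupport.cm l)) True).LiuXuThm15) ∧
      (¬ (canon₁₄₅ νtop False).LiuXuThm15 ∧ (canon₁₄₅ νtop False).LiuXuThm13) :=
  ⟨hundredfortyfifth_holds_top,
    fun l => have h := c145_book_cm l
      ⟨h.1, h.2.2.2.1, h.2.2.2.2.2.2.2⟩,
    ⟨c145_node_denied.2.1, c145_node_denied.2.2.2.1⟩⟩

/-! ## 148. Hundred-and-forty-sixth tranche (v8 of this file, after `Downstream40.lean` v2; unit `pub-arthur-down-g65`): supports of row C316 H. Xue, J. reine angew. Math. 756 (2019)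
(`XueWeakBC` ⇐ Mok ∧ `KMSW2014.Nodes.Full`, `XueGGParch` = Theorem 1.1 ⇐ `XueWeakBC`) and of row C317 H. Xue, Duke Math. J. 168 (2019) (`XueProp410` ⇐ Mok ∧ KMSW's proved scope,
`XueAGGP53` = Theorem 5.3 premise-free, `XueAGGP52` = Theorem 5.2 ⇐ Proposition 4.10 ∧ Theorem 5.3); the book occurs nowhere in the tranche (ν enters only the parameter list of the
sibling theorem `xue_beside_c181`). -/

section Canon146

variable (μ : Mok2015.Nodes) (κ : KMSW2014.Nodes)

/-- The canonical reading of the hundred-and-forty-sixth tranche: each statement := exactly the conjunction of its typed premises (Theorem 5.3 := `True`).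
[cite: Xue2019SmoothTransfer, Thm 1.1; Xue2019ArithmeticTheta, Prop. 4.10, Thms 5.2, 5.3 (canonical model; bookkeeping)] [claim: KalethaMinguezShinWhite2014, under-review] -/
abbrev canon₁₄₆ : Consumers146 where
  XueWeakBC := (∀ N, μ.Everything N) ∧ (∀ N, κ.Full N)
  XueGGParch := (∀ N, μ.Everything N) ∧ (∀ N, κ.Full N)
  XueProp410 := (∀ N, μ.Everything N) ∧ (∀ N, κ.Scope N)
  XueAGGP52 := ((∀ N, μ.Everything N) ∧ (∀ N, κ.Scope N)) ∧ True
  XueAGGP53 := True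

/-- All five hundred-and-forty-sixth-tranche edges hold in the canonical reading, for arbitrary μ, κ. [cite: Xue2019SmoothTransfer, Thm 1.1; Xue2019ArithmeticTheta, Prop. 4.10, Thms 5.2, 5.3 (bookkeeping proved here)] [claim: KalethaMinguezShinWhite2014, under-review] -/
theorem canon_implications₁₄₆ : Implications146 μ κ (canon₁₄₆ μ κ) where
  weakBC := fun m f => ⟨m, f⟩
  ggpArch := fun h => h
  prop410 := fun m s => ⟨m, s⟩
  aggp53 := True.intro
  aggp52 := fun h t => ⟨h, t⟩

end Canon146

/-- At the top (every input of Mok's memoir and of KMSW, both sequels included) all five statements hold — through the tranche's own `hundredfortysixth_of_inputs` fed by `mokInputs_top` and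
`kmswInputs_top`. [cite: Xue2019SmoothTransfer, Thm 1.1; Xue2019ArithmeticTheta, Prop. 4.10, Thms 5.2, 5.3 (bookkeeping proved here)] [claim: KalethaMinguezShinWhite2014, under-review] -/
theorem hundredfortysixth_holds_top :
    (canon₁₄₆ μtop κtop).XueWeakBC ∧ (canon₁₄₆ μtop κtop).XueGGParch ∧ (canon₁₄₆ μtop κtop).XueProp410 ∧ (canon₁₄₆ μtop κtop).XueAGGP52 ∧ (canon₁₄₆ μtop κtop).XueAGGP53 :=
  have KQ := kmswInputs_top μtop
  hundredfortysixth_of_inputs (canon_implications₁₄₆ μtop κtop) mokInputs_top KQ.1 KQ.2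

/-- MOK SIDE, EXACT SUPPORTS AS TYPED: in the Mok countermodel of ANY of the 29 leaves `l` (KMSW without its Mok import, `κnoMok`; all five edges valid) C316's two statements and C317's
Proposition 4.10 / Theorem 5.2 FAIL — each carries Mok's `Everything` at every rank (`not_M_cm`) — while C317's Theorem 5.3 HOLDS. [cite: Xue2019SmoothTransfer, p0002:L16-20; Xue2019ArithmeticTheta, p0031:L18-19, §1.3 (bookkeeping proved here)] [claim: KalethaMinguezShinWhite2014, under-review] -/
theorem c146_mok_cm (l : Mok2015.LeafSupport.Leaf) :
    ¬ (Mok2015.LeafSupport.mkN (Mok2015.LeafSupport.cm l)).leaf l ∧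
      Implications146 (Mok2015.LeafSupport.mkN (Mok2015.LeafSupport.cm l)) κnoMok (canon₁₄₆ (Mok2015.LeafSupport.mkN (Mok2015.LeafSupport.cm l)) κnoMok) ∧
      ¬ (canon₁₄₆ (Mok2015.LeafSupport.mkN (Mok2015.LeafSupport.cm l)) κnoMok).XueWeakBC ∧ ¬ (canon₁₄₆ (Mok2015.LeafSupport.mkN (Mok2015.LeafSupport.cm l)) κnoMok).XueGGParch ∧
      ¬ (canon₁₄₆ (Mok2015.LeafSupport.mkN (Mok2015.LeafSupport.cm l)) κnoMok).XueProp410 ∧ ¬ (canon₁₄₆ (Mok2015.LeafSupport.mkN (Mok2015.LeafSupport.cm l)) κnoMok).XueAGGP52 ∧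
      (canon₁₄₆ (Mok2015.LeafSupport.mkN (Mok2015.LeafSupport.cm l)) κnoMok).XueAGGP53 :=
  have nm := not_M_cm l
  ⟨(Mok2015.LeafSupport.countermodel l).2.2.1, canon_implications₁₄₆ _ _, fun h => nm h.1, fun h => nm h.1, fun h => nm h.1, fun h => nm h.1.1, True.intro⟩

/-- KMSW SIDE, EXACT SUPPORTS AS TYPED: (i) with KMSW's Mok import denied (`κnoMok`: neither scope nor full statements at any rank; Mok at the top) the four conduit-fed statements FAIL and
Theorem 5.3 HOLDS; (ii) in KMSW's countermodel of ANY leaf `l'` (Mok at the top) C316's two statements FAIL for EVERY `l'` — all thirteen KMSW leaves, BOTH SEQUELS INCLUDED, are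
load-bearing for the weak base change as cited (`κ.Full`, row C181's certificate `nineteenth_kmsw_cm` of `DownstreamSupport2.lean` once more) — while C317's Proposition 4.10 and
Theorem 5.2 HOLD iff `l'` is one of the three leaves only the starred statements need (`AubertSS`, `KMS_A`, `KMS_B`): the proved-scope leaves are load-bearing for them, the sequels are
not; Theorem 5.3 holds throughout. [cite: Xue2019SmoothTransfer, p0002:L16-20; Xue2019ArithmeticTheta, p0031:L18-19 (bookkeeping proved here)] [claim: KalethaMinguezShinWhite2014, under-review] -/
theorem c146_kmsw (l' : KMSW2014.LeafSupport.Leaf) :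
    (¬ (canon₁₄₆ μtop κnoMok).XueGGParch ∧ ¬ (canon₁₄₆ μtop κnoMok).XueAGGP52 ∧ (canon₁₄₆ μtop κnoMok).XueAGGP53) ∧
      Implications146 μtop (KMSW2014.LeafSupport.mkN (KMSW2014.LeafSupport.cm l')) (canon₁₄₆ μtop (KMSW2014.LeafSupport.mkN (KMSW2014.LeafSupport.cm l'))) ∧
      (¬ (canon₁₄₆ μtop (KMSW2014.LeafSupport.mkN (KMSW2014.LeafSupport.cm l'))).XueWeakBC ∧ ¬ (canon₁₄₆ μtop (KMSW2014.LeafSupport.mkN (KMSW2014.LeafSupport.cm l'))).XueGGParch) ∧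
      (((canon₁₄₆ μtop (KMSW2014.LeafSupport.mkN (KMSW2014.LeafSupport.cm l'))).XueProp410 ↔ l'.onlyFull = true) ∧
        ((canon₁₄₆ μtop (KMSW2014.LeafSupport.mkN (KMSW2014.LeafSupport.cm l'))).XueAGGP52 ↔ l'.onlyFull = true) ∧
        (canon₁₄₆ μtop (KMSW2014.LeafSupport.mkN (KMSW2014.LeafSupport.cm l'))).XueAGGP53) := by
  have ns : ∀ N, ¬ κnoMok.Scope N := κnoMok_facts.2.2.2.2.2.1
  have m : ∀ N, μtop.Everything N := mokInputs_top.everything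
  have cmod := KMSW2014.LeafSupport.countermodel l'
  have nf : ¬ ∀ N, (KMSW2014.LeafSupport.mkN (KMSW2014.LeafSupport.cm l')).Full N :=
    fun h => KMSW2014.LeafSupport.not_full_of_noFull (cmod.2.2.2 0) (h 0)
  have sc : (∀ N, (KMSW2014.LeafSupport.mkN (KMSW2014.LeafSupport.cm l')).Scope N) ↔ l'.onlyFull = true := by
    refine ⟨fun h => ?_, fun h => scope_of_onlyFull l' h⟩
    cases hb : l'.onlyFull
    · exact absurd (h 0) (KMSW2014.LeafSupport.not_scope_of (KMSW2014.LeafSupport.scope_fails l' hb 0))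
    · rfl
  have nF : ∀ N, ¬ κnoMok.Full N := κnoMok_facts.2.2.2.2.2.2
  refine ⟨⟨fun h => nF 0 (h.2 0), fun h => ns 0 (h.1.2 0), True.intro⟩, canon_implications₁₄₆ _ _, ⟨fun h => nf h.2, fun h => nf h.2⟩, ?_, ?_, True.intro⟩
  · exact ⟨fun h => sc.1 h.2, fun h => ⟨m, sc.2 h⟩⟩
  · exact ⟨fun h => sc.1 h.1.2, fun h => ⟨⟨m, sc.2 h⟩, True.intro⟩⟩

/-- C316 AND C181 SHARE THEIR SUPPORT: in KMSW's countermodels of `KMS_A` and of `KMS_B` (Mok, the book and every other KMSW leaf granted) Xue's Theorem 1.1 (this section) and W. Zhang's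
theorems (row C181, `canon₁₉` of `DownstreamSupport2.lean`) fail TOGETHER, and at the top both hold. [cite: Xue2019SmoothTransfer, Thm 1.1 with p0002:L14-20; WZhang2014GGP, Thm 1.1 with Hypothesis (∗) (bookkeeping proved here)] [claim: KalethaMinguezShinWhite2014, under-review] -/
theorem c146_c181_same_support :
    (¬ (canon₁₄₆ μtop (KMSW2014.LeafSupport.mkN (KMSW2014.LeafSupport.cm .KMS_A))).XueGGParch ∧
        ¬ (canon₁₉ νtop μtop (KMSW2014.LeafSupport.mkN (KMSW2014.LeafSupport.cm .KMS_A))).WZhangGGP) ∧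
      (¬ (canon₁₄₆ μtop (KMSW2014.LeafSupport.mkN (KMSW2014.LeafSupport.cm .KMS_B))).XueGGParch ∧
        ¬ (canon₁₉ νtop μtop (KMSW2014.LeafSupport.mkN (KMSW2014.LeafSupport.cm .KMS_B))).WZhangGGP) ∧
      ((canon₁₄₆ μtop κtop).XueGGParch ∧ (canon₁₉ νtop μtop κtop).WZhangGGP) :=
  ⟨⟨(c146_kmsw .KMS_A).2.2.1.2, wzhyp_needs_sequels.1.2⟩, ⟨(c146_kmsw .KMS_B).2.2.1.2, wzhyp_needs_sequels.2.2⟩,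
    ⟨hundredfortysixth_holds_top.2.1, nineteenth_holds_top.2.2⟩⟩

/-- THE HUNDRED-AND-FORTY-SIXTH TRANCHE REGRADED, in one statement: (i) at the top all five statements hold; (ii) in the Mok countermodel of ANY of the 29 leaves the four conduit-fed
statements FAIL and Theorem 5.3 HOLDS; (iii) in KMSW's countermodel of ANY leaf `l'` C316's Theorem 1.1 FAILS, C317's Theorem 5.2 holds iff `l'` ∈ {`AubertSS`, `KMS_A`, `KMS_B`}, and
Theorem 5.3 HOLDS.  Supports: support(`XueWeakBC`) = support(`XueGGParch`) = all 29 Mok leaves ∧ all thirteen KMSW leaves (both sequels) = row C181's support, NO book leaf;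
support(`XueProp410`) = support(`XueAGGP52`) = all 29 Mok leaves ∧ KMSW's proved-scope leaves (no sequel, no `AubertSS`), NO book leaf; support(`XueAGGP53`) = ∅ — ν does not
occur in the tranche.  In 2026 terms: Xue's archimedean GGP theorem is conditional on Mok's 2024–2026 preprint layer, Mok's two weighted lemmas and KMSW's two unwritten sequels
(through the weak base change cited without a genericity qualifier); the provisional arithmetic GGP theorem on Mok's preprint layer and weighted lemmas only; the unconditional
one on nothing of the three DAGs. [cite: Xue2019SmoothTransfer, Thm 1.1; Xue2019ArithmeticTheta, Thms 5.2, 5.3 (bookkeeping proved here)] [claim: KalethaMinguezShinWhite2014, under-review] -/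
theorem c146_regraded :
    ((canon₁₄₆ μtop κtop).XueWeakBC ∧ (canon₁₄₆ μtop κtop).XueGGParch ∧ (canon₁₄₆ μtop κtop).XueProp410 ∧ (canon₁₄₆ μtop κtop).XueAGGP52 ∧ (canon₁₄₆ μtop κtop).XueAGGP53) ∧
      (∀ l : Mok2015.LeafSupport.Leaf, ¬ (Mok2015.LeafSupport.mkN (Mok2015.LeafSupport.cm l)).leaf l ∧
        ¬ (canon₁₄₆ (Mok2015.LeafSupport.mkN (Mok2015.LeafSupport.cm l)) κnoMok).XueGGParch ∧ ¬ (canon₁₄₆ (Mok2015.LeafSupport.mkN (Mok2015.LeafSupport.cm l)) κnoMok).XueAGGP52 ∧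
        (canon₁₄₆ (Mok2015.LeafSupport.mkN (Mok2015.LeafSupport.cm l)) κnoMok).XueAGGP53) ∧
      (∀ l' : KMSW2014.LeafSupport.Leaf, ¬ (canon₁₄₆ μtop (KMSW2014.LeafSupport.mkN (KMSW2014.LeafSupport.cm l'))).XueGGParch ∧
        ((canon₁₄₆ μtop (KMSW2014.LeafSupport.mkN (KMSW2014.LeafSupport.cm l'))).XueAGGP52 ↔ l'.onlyFull = true) ∧
        (canon₁₄₆ μtop (KMSW2014.LeafSupport.mkN (KMSW2014.LeafSupport.cm l'))).XueAGGP53) :=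
  ⟨hundredfortysixth_holds_top,
    fun l => have h := c146_mok_cm l
      ⟨h.1, h.2.2.2.1, h.2.2.2.2.2.1, h.2.2.2.2.2.2⟩,
    fun l' => have h := c146_kmsw l'
      ⟨h.2.2.1.2, h.2.2.2.2.1, h.2.2.2.2.2⟩⟩

end Support

end Downstream

end Literature.NumberTheory.Automorphic.Arthur2013
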